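import Literature.NumberTheory.EllipticCurves.FormalGroupXDerivativeProofs
import Mathlib.RingTheory.Ideal.Quotient.Operations
import Literature.NumberTheory.EllipticCurves.SigmaSqDivisionBridgeProofs
import Literature.NumberTheory.EllipticCurves.FormalGroupDictionaryProofs
import Literature.NumberTheory.EllipticCurves.PadicSigmaConstantFormulaProofs
import Literature.NumberTheory.EllipticCurves.PadicSigmaSqTwoUniversalRing
import Literature.NumberTheory.EllipticCurves.PadicWeierstrassZetaProofs
import Literature.NumberTheory.EllipticCurves.FormalLogExpBaseChangeProofs
import Mathlib.RingTheory.Localization.FractionRing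
import Literature.NumberTheory.EllipticCurves.FormalGroupFiniteHeightProofs
import Literature.RingTheory.FormalGroups.DworkFrobeniusLift
import Literature.NumberTheory.EllipticCurves.PadicSigmaSqTwoDworkShapeProofs
import Literature.NumberTheory.EllipticCurves.PadicSigmaSqTwoIsogenyChartProofs
import HarnessLib

/-!
# `mazurTate_sigmaSq_existsUnique_two` HOLDS — Mazur–Tate 1991 Thm. 3.1 at `p = 2`: the sigma-squared division series of a good ordinary `W/ℚ` over `ℚ₂` exists and is unique (re-homed proofs, file 3 of 3)

Family `bsd` material RE-HOMED into `Literature/` by the Hodge foundations lane (`lit-hodgefound`, seat p20, generation 35),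
file 3 of 3: verbatim ports, in dependency order and each with its original module docstring (Parts 1–11), of the cell `bsd-f1-sign2`
(WIDTH-5 attach seat `bsd-line-att-p3` g8/g9, crux C3′ = stmt-BirchSwinnertonDyer-23008, plan SIGMASQ-AT-TWO-att-p3.md) modules
`Summits/BirchSwinnertonDyer/BirchSwinnertonDyer/Theorems/AlignedTransportAtTwoBSDOfMainConjectureRankOneAtTwoSigmaSqTwo{FrobeniusSeries, VeluFE, ODEFamily, FieldVeluFE, UniversalSpecialization, ConstantFixedPoint, DomainFE, FrobeniusModel, DworkGlue, DworkPackage, Existence}.lean`,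
namespace `Summit.BirchSwinnertonDyer.BirchSwinnertonDyer.Theorems.AlignedTransportAtTwoSigmaSqTwo` (and its sub-namespace `Field`) re-rooted as
`Literature.NumberTheory.EllipticCurves.PadicSigmaSqTwo.MazurTate`; theorems only (no definition, no named fact), imports Literature/Mathlib only;
all `[folklore]` helpers privatised; `open` commands made `_root_`-explicit (inside `Literature.NumberTheory.EllipticCurves.…` a bare
`open WeierstrassCurve` / `open Polynomial` would resolve to the Literature sub-namespace only).  Part 0 re-proves privately the five
short `[folklore]` helpers of files 1–2 that Parts 1–11 use (`isUnit_of_sub_mem`, `frobParam_isUnit_q`, `frobParam_isUnit_u2`, `sigmaShift_map`,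
`coeff_one_sigmaShift_sq`, private there).  CONTENT: the Frobenius series and model `E″ = vc • V′` of Vélu's quotient (Parts 1, 8), the squared
`2`-isogeny functional equations (Parts 2, 4, 7), the ODE family of odd normalised solutions `σ_c` (Part 3), universal specialisation
(Blakestad–Grant Thm. 15; Part 5), the Mazur–Tate constant as the `2`-adic fixed point `4u₂²α(c) − 2c = 8δ` (Part 6), Dwork glue and package
(Parts 9–10) and the assembly (Part 11; apex renamed `MazurTate.sigmaSq_existsUnique_two_of_dworkFrobenius`, the Summits-side alias
`mazurTate_sigmaSq_existsUnique_two_holds` of the same namespace dropped in favour of Part 12's FULLY-QUALIFIED discharge of record).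
Summits-side twins: `Summit.BirchSwinnertonDyer.BirchSwinnertonDyer.Theorems.AlignedTransportAtTwoSigmaSqTwo.{stub_sigmaSqTwo, mazurTate_sigmaSq_existsUnique_two_holds}`.
WHY: the three files together carry the only proof in
the tree of the Literature named fact `NumberTheory.EllipticCurves.mazurTate_sigmaSq_existsUnique_two` (Mazur–Tate 1991 Thm. 3.1 at `p = 2`,
Silverman 2005 §5 Rem. 2: for every globally minimal `W/ℚ` with good ORDINARY reduction at `2` there is exactly one `Σ ∈ ℚ₂⟦z⟧` satisfying all
squared `n`-division identities — proved by Blakestad–Grant's method at `p = 2`, squared: Vélu's `2`-isogeny, the Frobenius model over the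
universal ordinary `a₁`-chart ring, the Mazur–Tate constant as a `2`-adic fixed point, and the tree's Dwork lemma
`Literature.RingTheory.FormalGroups.coeff_mem_of_map_subst_eq_pow_mul`), which `Literature/` could not import.  The Summits originals stay in
place (transitional duplication; cited here).  Honest framing of the originals stands: BSD is NOT proved by any of this; consumers merely lose the
hypothesis `(hMT : mazurTate_sigmaSq_existsUnique_two)`.
-/

noncomputable section

/-! ## Part 0 — five short `[folklore]` helpers of files 1–2 (private there) -/

section Part0

set_option autoImplicit false

open scoped _root_.Classical

namespace Literature.NumberTheory.EllipticCurves.PadicSigmaSqTwo.MazurTate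

open _root_.PowerSeries _root_.Literature.NumberTheory.EllipticCurves

/-- An element congruent to a unit modulo `(2)` is a unit (`(2) ⊆` Jacobson radical of a `2`-adically complete ring). [folklore] -/
private theorem isUnit_of_sub_mem {A : Type*} [CommRing A] [IsAdicComplete (Ideal.span {(2 : A)}) A] {x y : A} (hy : IsUnit y)
    (h : x - y ∈ Ideal.span {(2 : A)}) : IsUnit x := by
  refine Literature.RingTheory.AdicTopology.isUnit_of_isUnit_mk (Ideal.span {(2 : A)}) ?_
  have e : Ideal.Quotient.mk (Ideal.span {(2 : A)}) x = Ideal.Quotient.mk (Ideal.span {(2 : A)}) y := by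
    rw [Ideal.Quotient.eq]; exact h
  rw [e]; exact hy.map _

/-- `q(ν)` is a unit of a `2`-adically complete ring. [folklore] -/
private theorem frobParam_isUnit_q {A : Type*} [CommRing A] [IsAdicComplete (Ideal.span {(2 : A)}) A] (nu : A) :
    IsUnit (3 * ((1 + 4 * nu) ^ 2 - 4 * (1 + 4 * nu) - 16)) :=
  isUnit_of_sub_mem isUnit_one (Ideal.mem_span_singleton.mpr ⟨24 * nu ^ 2 - 12 * nu - 29, by ring⟩)

/-- `u₂ = 1 + 2B₂` is a unit of a `2`-adically complete ring. [folklore] -/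
private theorem frobParam_isUnit_u2 {A : Type*} [CommRing A] [IsAdicComplete (Ideal.span {(2 : A)}) A] (B2 : A) :
    IsUnit (1 + 2 * B2) :=
  isUnit_of_sub_mem isUnit_one (Ideal.mem_span_singleton.mpr ⟨B2, by ring⟩)

/-- `s(σ^φ) = s(σ)^φ`: the shift `σ ↦ σ/z` commutes with base change. [folklore] -/
private theorem sigmaShift_map {K : Type*} [CommRing K] {S : Type*} [CommRing S] (φ : K →+* S) (σ : K⟦X⟧) :
    sigmaShift (PowerSeries.map φ σ) = PowerSeries.map φ (sigmaShift σ) := by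
  ext n
  rw [coeff_sigmaShift, coeff_map, coeff_map, coeff_sigmaShift]

/-- `[z¹](s²) = 2·[z²]σ` for `σ = z + ⋯` (`s = σ/z = 1 + [z²]σ·z + ⋯`). [folklore] -/
private theorem coeff_one_sigmaShift_sq {K : Type*} [CommRing K] {σ : K⟦X⟧} (h1 : coeff 1 σ = 1) :
    coeff 1 (sigmaShift σ ^ 2) = 2 * coeff 2 σ := by
  rw [pow_two, coeff_one_mul_eq, coeff_zero_eq_constantCoeff_apply, constantCoeff_sigmaShift, h1, coeff_sigmaShift]
  ring

end Literature.NumberTheory.EllipticCurves.PadicSigmaSqTwo.MazurTate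

end Part0

/-!
## Part 1 — port of `Summits/BirchSwinnertonDyer/BirchSwinnertonDyer/Theorems/AlignedTransportAtTwoBSDOfMainConjectureRankOneAtTwoSigmaSqTwoFrobeniusSeries.lean`

# The Frobenius model of the universal ordinary `a₁`-chart at `p = 2`, I: the CLOSED-FORM series identities
# (step S3 of the discharge plan for the PRINT stub `stub_sigmaSqTwo` of crux C3′; route-independent, any commutative ring)

Cell `bsd-f1-sign2`, WIDTH-5 attach seat `bsd-line-att-p3` g9 (`--supports stmt-BirchSwinnertonDyer-23008`; plan
`Cruxes/BSDOfMainConjectureRankOneAtTwo/SIGMASQ-AT-TWO-att-p3.md` §8 (S3.4)). THEOREMS ONLY; pure power-series algebra over an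
ARBITRARY commutative ring `K`. BSD is not proved by any of this.

SETTING. `V = ⟨1, B₂, 0, 0, B₆⟩` an `a₁`-chart curve whose canonical `2`-torsion abscissa is RATIONALLY PARAMETRISED: for elements
`X₀, B₂, g₂` with `X₀ = −1 − 4B₂ − 64g₂` and `B₆ = g₂X₀²` (equivalently `g₂ = B₆/X₀²` and `X₀³ + (1 + 4B₂)X₀² + 64B₆ = 0`: `X₀ = 4x(Q)`,
`Q = (X₀/4, −X₀/8)` the generator of the canonical subgroup), write `Xs = z²x(z)` (`formalXMulSq`) and put
* `𝒜 = 4Xs − X₀z²` (`= 4z²(x − x(Q))`), `𝒬 = Xs² − 16g₂·Xs·z² − 4g₂X₀·z⁴` (a UNIT series),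
* `𝒰 = Xs² − 8δ·Xs·z² + 2c₁z⁴`, `c₁ = δX₀ − 4g₂X₀` (`= z⁴·u₂²(4x − X₀)·x″`, `x″` the abscissa of the Frobenius model, `4r = R₁ = −X₀ + 32δ`),
* `𝒢`, `𝔇 = (1 + 2B₂)·z·Xs·𝒰 + Xs²𝒬 + 8g₂X₀·z⁴𝒬 − z²Xs𝒢` (a UNIT series), `ℳ = 4Xs𝒜 + t₁₆z⁴` (`t₁₆ = 16t = 3X₀² + 8B₂X₀ + 2X₀`),
  `ℰ₀ = 128·E₁` (the denominator of the isogeny parameter `T = θ_vc(τ)` of the Frobenius model `vc = [2(1 + 2B₂); R₁/4, 2B₂ + ½, −R₁/8]`,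
  see `…SigmaSqTwoFrobeniusModel.lean`), `𝔇₁ = ℰ₀/64`.
Here `δ` is a free parameter in §1 (the identities hold for every `δ`); in §2 `δ = −(1 + 4ν)g₂` (the rational parametrisation of the
Hensel root `R₁` of `3R₁² + (8B₂ + 2)R₁ − 5t₁₆ = 0`, `…SigmaSqTwoFrobeniusParam.lean`).

§1 (exact identities, any `δ`): `frob_cM_sub_eq` (`ℳ − R₁z²𝒜 = 16𝒰`), `frob_E0_eq` (`ℰ₀ = 64𝔇₁`), `frob_calQ_mul_D1` (`𝒬𝔇₁ = (2 − z)Xs𝔇`),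
**`frob_calA_mul_calQ` (`𝒜·𝒬 = (2 − z)²·Xs²` — the DOUBLE zero of `x − x(Q)` at `z(Q) = 2`, which is EXACTLY `2` because `2y + x = 0` on
`E[2]` for the `a₁`-chart)**. Consequence (next file): `T = (1 + 2B₂)·z(2 − z)·Xs·𝒰/𝔇` and `V = 𝔇²/(𝒬𝒰²)` — manifestly integral.
§2 (congruences, `δ = −(1 + 4ν)g₂`): modulo `2`, `𝒰 ≡ 𝒬 ≡ Xs²`, `𝔇 ≡ Xs³` (`frob_map_calU/calQ/calD`), hence
**`T ≡ z²` (`frob_coeff_N2_sub_mem`) and `V ≡ 1` (`frob_coeff_calD_sq_sub_mem`) — the hypotheses `hφ`, `hu` of the tree's Dwork lemma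
`Literature.RingTheory.FormalGroups.coeff_mem_of_map_subst_eq_pow_mul`.** All certificates were found with a hand-rolled eliminator
(curve equation `Xs² = Xs³ + zXs² + B₂z²Xs² + B₆z⁶`, then `X₀`, then `δ`) and are checked by `linear_combination`.

## Sources
J. Vélu, C. R. Acad. Sci. Paris 273 (1971) [cite: SilvermanAEC2009, III.4]; C. Blakestad, D. Grant, J. Number Theory 249 (2023), Prop. 7 (c),
Lemma 12 (`t_p ≡ tᵖ`, `u ≡ 1 (mod p)` for the canonical quotient) [cite: BlakestadGrant2023, Prop. 7]; N. M. Katz, LNM 350 (1973) §3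
(quotient by the canonical subgroup lifts Frobenius) [cite: MazurTate1991, Thm. 3.1].
-/

section Part1


set_option autoImplicit false

open scoped _root_.Classical
open _root_.PowerSeries _root_.WeierstrassCurve

namespace Literature.NumberTheory.EllipticCurves.PadicSigmaSqTwo.MazurTate

section FrobeniusSeries

variable {K : Type*} [CommRing K] (V : WeierstrassCurve K) {X0 B2 g2 d nu : K}
  {cA cU cQ cG cD cM E0 D1 : K⟦X⟧}

/-- The cleared Weierstrass equation of the formal point of the chart curve `⟨1, B₂, 0, 0, g₂X₀²⟩`:
`Xs² = Xs³ + zXs² + B₂z²Xs² + g₂X₀²z⁶`. [cite: SilvermanAEC2009, IV.1.1] -/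
theorem frob_curve_eq (h1 : V.a₁ = 1) (h2 : V.a₂ = B2) (h3 : V.a₃ = 0) (h4 : V.a₄ = 0) (h6 : V.a₆ = g2 * X0 ^ 2) :
    V.formalXMulSq ^ 2 = V.formalXMulSq ^ 3 + X * V.formalXMulSq ^ 2 + C B2 * X ^ 2 * V.formalXMulSq ^ 2 +
      C g2 * C X0 ^ 2 * X ^ 6 := by
  have h := V.formalXMulSq_sq_eq
  rw [h1, h2, h3, h4, h6] at h
  simp only [map_one, map_zero, map_mul, map_pow, one_mul, zero_mul, add_zero] at h
  linear_combination h

/-- `X₀ = −1 − 4B₂ − 64g₂` read in `K⟦z⟧`. [folklore] -/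
private theorem frob_C_X0 (hX0 : X0 = -1 - 4 * B2 - 64 * g2) : (C X0 : K⟦X⟧) = -1 - 4 * C B2 - 64 * C g2 := by
  rw [hX0]; simp only [map_sub, map_neg, map_mul, map_one, map_ofNat]

/-! ## §1 Exact identities (any `δ`) -/

/-- **`ℳ − R₁z²𝒜 = 16·𝒰`** (`R₁ = −X₀ + 32δ`): the numerator `16x² − 4(X₀ + R₁)x + (t₁₆ + R₁X₀)` of `4u₂²x″·(4x − X₀)` is
`16(x² − 8δx + 2c₁)` because `X₀ + R₁ = 32δ` and `t₁₆ + R₁X₀ = 32c₁` (the cubic of `X₀`). [cite: SilvermanAEC2009, III.4] -/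
theorem frob_cM_sub_eq (hX0 : X0 = -1 - 4 * B2 - 64 * g2) (hA : cA = 4 * V.formalXMulSq - C X0 * X ^ 2)
    (hU : cU = V.formalXMulSq ^ 2 - 8 * C d * V.formalXMulSq * X ^ 2 + 2 * (C d * C X0 - 4 * C g2 * C X0) * X ^ 4)
    (hM : cM = 4 * V.formalXMulSq * cA + (3 * C X0 ^ 2 + 8 * C B2 * C X0 + 2 * C X0) * X ^ 4) :
    cM - (-C X0 + 32 * C d) * X ^ 2 * cA = 16 * cU := by
  have hX0C := frob_C_X0 (K := K) hX0
  set Xs := V.formalXMulSq with hXs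
  subst hA hU hM
  linear_combination ((2 : K⟦X⟧) * X ^ 4 * C X0) * hX0C

/-- **`ℰ₀ = 64·𝔇₁`**: the denominator `ℰ₀ = 128·(Dn + s·zAM + (t − sr)z³A²)` of `T = θ_vc(τ)` for `vc = [2u₂; r, u₂ − ½, −r/2]`,
`u₂ = 1 + 2B₂`, is `64` times a series with constant term `2`. [cite: BlakestadGrant2023, Prop. 7] -/
theorem frob_E0_eq (h1 : V.a₁ = 1) (h2 : V.a₂ = B2) (h3 : V.a₃ = 0) (h4 : V.a₄ = 0) (h6 : V.a₆ = g2 * X0 ^ 2)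
    (hX0 : X0 = -1 - 4 * B2 - 64 * g2) (hA : cA = 4 * V.formalXMulSq - C X0 * X ^ 2)
    (hM : cM = 4 * V.formalXMulSq * cA + (3 * C X0 ^ 2 + 8 * C B2 * C X0 + 2 * C X0) * X ^ 4)
    (hE0 : E0 = 8 * V.formalXMulSq * cA ^ 2 + (3 * C X0 ^ 2 + 8 * C B2 * C X0 + 2 * C X0) * X ^ 4 *
        (2 * X * cA - 8 * V.formalXMulSq + C X0 * X ^ 3) + (1 + 4 * C B2) * X * cA * cM -
        2 * (1 + 2 * C B2) * (-C X0 + 32 * C d) * X ^ 3 * cA ^ 2)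
    (hD1 : D1 = V.formalXMulSq ^ 3 * (2 + (1 + 4 * C B2) * X) - C X0 * V.formalXMulSq ^ 2 * X ^ 2 -
        (C B2 * C X0 + 16 * (1 + 2 * C B2) * C d) * V.formalXMulSq ^ 2 * X ^ 3 + 16 * C g2 * C X0 * V.formalXMulSq * X ^ 4 +
        (4 * (C d * C X0 - 4 * C g2 * C X0) + (1 + 4 * C B2) * (2 * C d * C X0 + 2 * (C d * C X0 - 4 * C g2 * C X0))) *
          V.formalXMulSq * X ^ 5 - (1 + 2 * C B2) * (C d * C X0 - 4 * C g2 * C X0) * C X0 * X ^ 7) :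
    E0 = 64 * D1 := by
  have hcurve := frob_curve_eq V h1 h2 h3 h4 h6
  have hX0C := frob_C_X0 (K := K) hX0
  set Xs := V.formalXMulSq with hXs
  subst hA hM hE0 hD1
  linear_combination ((-8 : K⟦X⟧) * X ^ 7 * C X0 ^ 2 * C B2 + (-4 : K⟦X⟧) * X ^ 7 * C X0 ^ 2 + (32 : K⟦X⟧) * Xs * X ^ 5 * C X0 * C B2 + (24 : K⟦X⟧) * Xs * X ^ 5 * C X0 + (-16 : K⟦X⟧) * Xs * X ^ 4 * C X0) * hX0C

/-- **`𝒬·𝔇₁ = (2 − z)·Xs·𝔇`** — the passage from the `64`-cleared denominator to the UNIT denominator `𝔇`.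
[cite: BlakestadGrant2023, Prop. 7] -/
theorem frob_calQ_mul_D1 (h1 : V.a₁ = 1) (h2 : V.a₂ = B2) (h3 : V.a₃ = 0) (h4 : V.a₄ = 0) (h6 : V.a₆ = g2 * X0 ^ 2)
    (hX0 : X0 = -1 - 4 * B2 - 64 * g2)
    (hU : cU = V.formalXMulSq ^ 2 - 8 * C d * V.formalXMulSq * X ^ 2 + 2 * (C d * C X0 - 4 * C g2 * C X0) * X ^ 4)
    (hQ : cQ = V.formalXMulSq ^ 2 - 16 * C g2 * V.formalXMulSq * X ^ 2 - 4 * C g2 * C X0 * X ^ 4)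
    (hG : cG = (-C B2 - 32 * C g2) * V.formalXMulSq ^ 2 - 4 * (1 + 2 * C B2) * C d * V.formalXMulSq * X ^ 2 +
        (1 + 2 * C B2) * (C d * C X0 - 4 * C g2 * C X0) * X ^ 4 - 8 * C g2 * C X0 * V.formalXMulSq * X ^ 2 -
        2 * C g2 * C X0 ^ 2 * X ^ 4)
    (hD : cD = (1 + 2 * C B2) * X * V.formalXMulSq * cU + V.formalXMulSq ^ 2 * cQ + 8 * C g2 * C X0 * X ^ 4 * cQ -
        X ^ 2 * V.formalXMulSq * cG)
    (hD1 : D1 = V.formalXMulSq ^ 3 * (2 + (1 + 4 * C B2) * X) - C X0 * V.formalXMulSq ^ 2 * X ^ 2 -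
        (C B2 * C X0 + 16 * (1 + 2 * C B2) * C d) * V.formalXMulSq ^ 2 * X ^ 3 + 16 * C g2 * C X0 * V.formalXMulSq * X ^ 4 +
        (4 * (C d * C X0 - 4 * C g2 * C X0) + (1 + 4 * C B2) * (2 * C d * C X0 + 2 * (C d * C X0 - 4 * C g2 * C X0))) *
          V.formalXMulSq * X ^ 5 - (1 + 2 * C B2) * (C d * C X0 - 4 * C g2 * C X0) * C X0 * X ^ 7) :
    cQ * D1 = (2 - X) * V.formalXMulSq * cD := by
  have hcurve := frob_curve_eq V h1 h2 h3 h4 h6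
  have hX0C := frob_C_X0 (K := K) hX0
  set Xs := V.formalXMulSq with hXs
  subst hU hQ hG hD hD1
  linear_combination ((-512 : K⟦X⟧) * X ^ 5 * C B2 * C g2 * C d + (-32 : K⟦X⟧) * X ^ 5 * C B2 ^ 2 * C d + (-64 : K⟦X⟧) * X ^ 5 * C B2 ^ 2 * C g2 + (-4 : K⟦X⟧) * X ^ 5 * C B2 ^ 3 + (-16 : K⟦X⟧) * X ^ 5 * C X0 * C B2 * C d + (32 : K⟦X⟧) * X ^ 5 * C X0 * C B2 * C g2 + (-1 : K⟦X⟧) * X ^ 5 * C X0 * C B2 ^ 2 + (-256 : K⟦X⟧) * X ^ 5 * C g2 * C d + (-24 : K⟦X⟧) * X ^ 5 * C B2 * C d + (-1 : K⟦X⟧) * X ^ 5 * C B2 ^ 2 + (-8 : K⟦X⟧) * X ^ 5 * C X0 * C d + (16 : K⟦X⟧) * X ^ 5 * C X0 * C g2 + (-128 : K⟦X⟧) * X ^ 4 * C B2 * C g2 + (-8 : K⟦X⟧) * X ^ 4 * C B2 ^ 2 + (-2 : K⟦X⟧) * X ^ 4 * C X0 * C B2 + (-4 : K⟦X⟧) *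 X ^ 5 * C d + (32 : K⟦X⟧) * Xs * X ^ 3 * C B2 * C d + (64 : K⟦X⟧) * Xs * X ^ 3 * C B2 * C g2 + (4 : K⟦X⟧) * Xs * X ^ 3 * C B2 ^ 2 + Xs * X ^ 3 * C X0 * C B2 + (64 : K⟦X⟧) * X ^ 3 * C B2 * C g2 + (4 : K⟦X⟧) * X ^ 3 * C B2 ^ 2 + X ^ 3 * C X0 * C B2 + (-2 : K⟦X⟧) * X ^ 4 * C B2 + (16 : K⟦X⟧) * Xs * X ^ 3 * C d + Xs * X ^ 3 * C B2 + (-64 : K⟦X⟧) * X ^ 3 * C g2 + (-3 : K⟦X⟧) * X ^ 3 * C B2 + (-1 : K⟦X⟧) * X ^ 3 * C X0 + (64 : K⟦X⟧) * Xs * X ^ 2 * C g2 + (4 : K⟦X⟧) * Xs * X ^ 2 * C B2 + Xs * X ^ 2 * C X0 + (-4 : K⟦X⟧) * Xs ^ 2 * X * C B2 + (64 : K⟦X⟧) * X ^ 2 * C g2 + (4 : K⟦X⟧) * X ^ 2 * C B2 + X ^ 2 * C X0 + (-1 : K⟦X⟧) * X ^ 3 + Xs * X ^ 2 + (-2 :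 K⟦X⟧) * Xs ^ 2 * X + X ^ 2) * hcurve + ((-8 : K⟦X⟧) * X ^ 11 * C X0 ^ 2 * C B2 * C g2 * C d + (-1 : K⟦X⟧) * X ^ 11 * C X0 ^ 2 * C B2 ^ 2 * C g2 + (-4 : K⟦X⟧) * X ^ 11 * C X0 ^ 2 * C g2 * C d + (-2 : K⟦X⟧) * X ^ 10 * C X0 ^ 2 * C B2 * C g2 + Xs * X ^ 9 * C X0 ^ 2 * C B2 * C g2 + X ^ 9 * C X0 ^ 2 * C B2 * C g2 + (-1 : K⟦X⟧) * X ^ 9 * C X0 ^ 2 * C g2 + Xs * X ^ 8 * C X0 ^ 2 * C g2 + (-8 : K⟦X⟧) * Xs ^ 2 * X ^ 7 * C B2 ^ 2 * C d + (-1 : K⟦X⟧) * Xs ^ 2 * X ^ 7 * C B2 ^ 3 + (-2 : K⟦X⟧) * Xs ^ 2 * X ^ 7 * C X0 * C B2 * C d + (8 : K⟦X⟧) * Xs ^ 2 * X ^ 7 * C X0 * C B2 * C g2 + X ^ 8 * C X0 ^ 2 * C g2 + (-4 : K⟦X⟧) * Xs ^ 2 * X ^ 7 * C B2 * C d + (-1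 : K⟦X⟧) * Xs ^ 2 * X ^ 7 * C X0 * C d + (4 : K⟦X⟧) * Xs ^ 2 * X ^ 7 * C X0 * C g2 + (-8 : K⟦X⟧) * Xs ^ 2 * X ^ 6 * C B2 * C d + (-3 : K⟦X⟧) * Xs ^ 2 * X ^ 6 * C B2 ^ 2 + (8 : K⟦X⟧) * Xs ^ 2 * X ^ 5 * C B2 * C d + (2 : K⟦X⟧) * Xs ^ 2 * X ^ 5 * C B2 ^ 2 + (-4 : K⟦X⟧) * Xs ^ 2 * X ^ 6 * C d + (4 : K⟦X⟧) * Xs ^ 2 * X ^ 5 * C d + (-3 : K⟦X⟧) * Xs ^ 2 * X ^ 5 * C B2 + (4 : K⟦X⟧) * Xs ^ 2 * X ^ 4 * C B2 + (-1 : K⟦X⟧) * Xs ^ 2 * X ^ 3 * C B2 + (-1 : K⟦X⟧) * Xs ^ 2 * X ^ 4 + (2 : K⟦X⟧) * Xs ^ 2 * X ^ 3 + (-1 : K⟦X⟧) * Xs ^ 2 * X ^ 2) * hX0C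

/-- **`𝒜·𝒬 = (2 − z)²·Xs²`**: `η² = 4x³ + b₂x² + b₆ = 4(x − e)·q₁(x)` with `η = 2y + x = Xs·(z − 2)/z³`, `e = X₀/4`,
`q₁ = x² − 16g₂x − 4g₂X₀` — the double zero of `x − x(Q)` at `Q ∈ E[2]`, located at `z(Q) = −x(Q)/y(Q) = 2` EXACTLY.
[cite: SilvermanAEC2009, III.4] -/
theorem frob_calA_mul_calQ (h1 : V.a₁ = 1) (h2 : V.a₂ = B2) (h3 : V.a₃ = 0) (h4 : V.a₄ = 0) (h6 : V.a₆ = g2 * X0 ^ 2)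
    (hX0 : X0 = -1 - 4 * B2 - 64 * g2) (hA : cA = 4 * V.formalXMulSq - C X0 * X ^ 2)
    (hQ : cQ = V.formalXMulSq ^ 2 - 16 * C g2 * V.formalXMulSq * X ^ 2 - 4 * C g2 * C X0 * X ^ 4) :
    cA * cQ = (2 - X) ^ 2 * V.formalXMulSq ^ 2 := by
  have hcurve := frob_curve_eq V h1 h2 h3 h4 h6
  have hX0C := frob_C_X0 (K := K) hX0
  set Xs := V.formalXMulSq with hXs
  subst hA hQ
  linear_combination ((-4 : K⟦X⟧)) * hcurve + ((-1 : K⟦X⟧) * Xs ^ 2 * X ^ 2) * hX0C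

/-- Constant terms: `𝒰(0) = 𝒬(0) = 𝔇(0) = 1` (so `𝒬`, `𝔇` are units of `K⟦z⟧`). [folklore] -/
private theorem frob_constantCoeff
    (hU : cU = V.formalXMulSq ^ 2 - 8 * C d * V.formalXMulSq * X ^ 2 + 2 * (C d * C X0 - 4 * C g2 * C X0) * X ^ 4)
    (hQ : cQ = V.formalXMulSq ^ 2 - 16 * C g2 * V.formalXMulSq * X ^ 2 - 4 * C g2 * C X0 * X ^ 4)
    (hD : cD = (1 + 2 * C B2) * X * V.formalXMulSq * cU + V.formalXMulSq ^ 2 * cQ + 8 * C g2 * C X0 * X ^ 4 * cQ -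
        X ^ 2 * V.formalXMulSq * cG) :
    constantCoeff cU = 1 ∧ constantCoeff cQ = 1 ∧ constantCoeff cD = 1 := by
  have hX : constantCoeff (X : K⟦X⟧) = 0 := constantCoeff_X
  have hXs0 := V.constantCoeff_formalXMulSq
  have hU0 : constantCoeff cU = 1 := by
    rw [hU]; simp only [map_add, map_sub, map_mul, map_pow, constantCoeff_C, hX, hXs0]; ring
  have hQ0 : constantCoeff cQ = 1 := by
    rw [hQ]; simp only [map_sub, map_mul, map_pow, constantCoeff_C, hX, hXs0]; ring
  refine ⟨hU0, hQ0, ?_⟩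
  rw [hD]; simp only [map_add, map_sub, map_mul, map_pow, constantCoeff_C, hX, hXs0, hU0, hQ0]; ring

/-! ## §2 Congruences modulo `2` (`δ = −(1 + 4ν)g₂`) -/

section ModTwo

variable (I : Ideal K)

/-- In `(K/I)⟦z⟧` with `2 ∈ I`: `X₀ ↦ −1`. [folklore] -/
private theorem frob_mk_X0 (hI : (2 : K) ∈ I) (hX0 : X0 = -1 - 4 * B2 - 64 * g2) : Ideal.Quotient.mk I X0 = -1 := by
  have h2 : Ideal.Quotient.mk I 2 = 0 := Ideal.Quotient.eq_zero_iff_mem.mpr hI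
  rw [hX0, map_sub, map_sub, map_neg, map_one, map_mul, map_mul,
    show (4 : K) = 2 * 2 by norm_num, show (64 : K) = 2 * 32 by norm_num, map_mul, map_mul, h2]
  ring

/-- In `(K/I)⟦z⟧` with `2 ∈ I`: `δ = −(1 + 4ν)g₂ ↦ −g₂`. [folklore] -/
private theorem frob_mk_d (hI : (2 : K) ∈ I) (hd : d = -(1 + 4 * nu) * g2) : Ideal.Quotient.mk I d = -Ideal.Quotient.mk I g2 := by
  have h2 : Ideal.Quotient.mk I 2 = 0 := Ideal.Quotient.eq_zero_iff_mem.mpr hI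
  rw [hd, map_mul, map_neg, map_add, map_one, map_mul, show (4 : K) = 2 * 2 by norm_num, map_mul, h2]
  ring

/-- The curve equation in `(K/I)⟦z⟧`: `Xq² = Xq³ + zXq² + b₂z²Xq² + c₂z⁶` with `b₂, c₂` the images of `B₂, g₂`. [cite: SilvermanAEC2009, IV.1.1] -/
theorem frob_curve_eq_mk (hI : (2 : K) ∈ I) (h1 : V.a₁ = 1) (h2 : V.a₂ = B2) (h3 : V.a₃ = 0) (h4 : V.a₄ = 0) (h6 : V.a₆ = g2 * X0 ^ 2)
    (hX0 : X0 = -1 - 4 * B2 - 64 * g2) :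
    PowerSeries.map (Ideal.Quotient.mk I) V.formalXMulSq ^ 2 =
      PowerSeries.map (Ideal.Quotient.mk I) V.formalXMulSq ^ 3 + X * PowerSeries.map (Ideal.Quotient.mk I) V.formalXMulSq ^ 2 +
        C (Ideal.Quotient.mk I B2) * X ^ 2 * PowerSeries.map (Ideal.Quotient.mk I) V.formalXMulSq ^ 2 +
        C (Ideal.Quotient.mk I g2) * X ^ 6 := by
  have h := congrArg (PowerSeries.map (Ideal.Quotient.mk I)) (frob_curve_eq V h1 h2 h3 h4 h6)
  simp only [map_add, map_mul, map_pow, map_C, map_X, frob_mk_X0 I hI hX0, map_neg, map_one] at h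
  linear_combination h

/-- **`𝒰 ≡ Xs² (mod 2)`.** [cite: BlakestadGrant2023, Prop. 7] -/
theorem frob_map_calU (hI : (2 : K) ∈ I) (hX0 : X0 = -1 - 4 * B2 - 64 * g2) (hd : d = -(1 + 4 * nu) * g2)
    (hU : cU = V.formalXMulSq ^ 2 - 8 * C d * V.formalXMulSq * X ^ 2 + 2 * (C d * C X0 - 4 * C g2 * C X0) * X ^ 4) :
    PowerSeries.map (Ideal.Quotient.mk I) cU = PowerSeries.map (Ideal.Quotient.mk I) V.formalXMulSq ^ 2 := by
  have h2Q : (2 : (K ⧸ I)⟦X⟧) = 0 := by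
    rw [show (2 : (K ⧸ I)⟦X⟧) = C (Ideal.Quotient.mk I 2) by rw [map_ofNat, map_ofNat],
      Ideal.Quotient.eq_zero_iff_mem.mpr hI, map_zero]
  set Xq := PowerSeries.map (Ideal.Quotient.mk I) V.formalXMulSq with hXq
  set b2 := Ideal.Quotient.mk I B2 with hb2
  set c2 := Ideal.Quotient.mk I g2 with hc2
  rw [hU]
  simp only [map_add, map_sub, map_mul, map_pow, map_C, map_X, map_ofNat, map_neg, map_one, frob_mk_X0 I hI hX0,
    frob_mk_d I hI hd]
  rw [← hXq, ← hc2]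
  linear_combination ((5 : (K ⧸ I)⟦X⟧) * X ^ 4 * C c2 + (4 : (K ⧸ I)⟦X⟧) * Xq * X ^ 2 * C c2) * h2Q

/-- **`𝒬 ≡ Xs² (mod 2)`.** [cite: BlakestadGrant2023, Prop. 7] -/
theorem frob_map_calQ (hI : (2 : K) ∈ I) (hX0 : X0 = -1 - 4 * B2 - 64 * g2)
    (hQ : cQ = V.formalXMulSq ^ 2 - 16 * C g2 * V.formalXMulSq * X ^ 2 - 4 * C g2 * C X0 * X ^ 4) :
    PowerSeries.map (Ideal.Quotient.mk I) cQ = PowerSeries.map (Ideal.Quotient.mk I) V.formalXMulSq ^ 2 := by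
  have h2Q : (2 : (K ⧸ I)⟦X⟧) = 0 := by
    rw [show (2 : (K ⧸ I)⟦X⟧) = C (Ideal.Quotient.mk I 2) by rw [map_ofNat, map_ofNat],
      Ideal.Quotient.eq_zero_iff_mem.mpr hI, map_zero]
  set Xq := PowerSeries.map (Ideal.Quotient.mk I) V.formalXMulSq with hXq
  set c2 := Ideal.Quotient.mk I g2 with hc2
  rw [hQ]
  simp only [map_sub, map_mul, map_pow, map_C, map_X, map_ofNat, map_neg, map_one, frob_mk_X0 I hI hX0]
  rw [← hXq, ← hc2]
  linear_combination ((2 : (K ⧸ I)⟦X⟧) * X ^ 4 * C c2 + (-8 : (K ⧸ I)⟦X⟧) * Xq * X ^ 2 * C c2) * h2Q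

/-- **`𝔇 ≡ Xs³ (mod 2)`** (uses the curve equation and `c₁ ≡ B₆`, i.e. `δ ≡ g₂ (mod 2)`). [cite: BlakestadGrant2023, Prop. 7] -/
theorem frob_map_calD (hI : (2 : K) ∈ I) (h1 : V.a₁ = 1) (h2 : V.a₂ = B2) (h3 : V.a₃ = 0) (h4 : V.a₄ = 0) (h6 : V.a₆ = g2 * X0 ^ 2)
    (hX0 : X0 = -1 - 4 * B2 - 64 * g2) (hd : d = -(1 + 4 * nu) * g2)
    (hU : cU = V.formalXMulSq ^ 2 - 8 * C d * V.formalXMulSq * X ^ 2 + 2 * (C d * C X0 - 4 * C g2 * C X0) * X ^ 4)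
    (hQ : cQ = V.formalXMulSq ^ 2 - 16 * C g2 * V.formalXMulSq * X ^ 2 - 4 * C g2 * C X0 * X ^ 4)
    (hG : cG = (-C B2 - 32 * C g2) * V.formalXMulSq ^ 2 - 4 * (1 + 2 * C B2) * C d * V.formalXMulSq * X ^ 2 +
        (1 + 2 * C B2) * (C d * C X0 - 4 * C g2 * C X0) * X ^ 4 - 8 * C g2 * C X0 * V.formalXMulSq * X ^ 2 -
        2 * C g2 * C X0 ^ 2 * X ^ 4)
    (hD : cD = (1 + 2 * C B2) * X * V.formalXMulSq * cU + V.formalXMulSq ^ 2 * cQ + 8 * C g2 * C X0 * X ^ 4 * cQ -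
        X ^ 2 * V.formalXMulSq * cG) :
    PowerSeries.map (Ideal.Quotient.mk I) cD = PowerSeries.map (Ideal.Quotient.mk I) V.formalXMulSq ^ 3 := by
  have h2Q : (2 : (K ⧸ I)⟦X⟧) = 0 := by
    rw [show (2 : (K ⧸ I)⟦X⟧) = C (Ideal.Quotient.mk I 2) by rw [map_ofNat, map_ofNat],
      Ideal.Quotient.eq_zero_iff_mem.mpr hI, map_zero]
  have hcurveQ := frob_curve_eq_mk V I hI h1 h2 h3 h4 h6 hX0
  set Xq := PowerSeries.map (Ideal.Quotient.mk I) V.formalXMulSq with hXq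
  set b2 := Ideal.Quotient.mk I B2 with hb2
  set c2 := Ideal.Quotient.mk I g2 with hc2
  rw [hD, hU, hQ, hG]
  simp only [map_add, map_sub, map_mul, map_pow, map_neg, map_C, map_X, map_ofNat, map_one, frob_mk_X0 I hI hX0, frob_mk_d I hI hd]
  rw [← hXq, ← hb2, ← hc2]
  linear_combination ((-16 : (K ⧸ I)⟦X⟧) * X ^ 2 * C c2 + (-2 : (K ⧸ I)⟦X⟧) * X * C b2 + (-1 : (K ⧸ I)⟦X⟧) * Xq) * hcurveQ + ((-24 : (K ⧸ I)⟦X⟧) * X ^ 8 * C c2 ^ 2 + (-1 : (K ⧸ I)⟦X⟧) * X ^ 7 * C b2 * C c2 + (64 : (K ⧸ I)⟦X⟧) * Xq * X ^ 6 * C c2 ^ 2 + (-5 : (K ⧸ I)⟦X⟧) * Xq * X ^ 6 * C b2 * C c2 + (10 : (K ⧸ I)⟦X⟧) * Xq * X ^ 5 * C b2 * C c2 + (-2 : (K ⧸ I)⟦X⟧) * Xq * X ^ 6 * C c2 + (-12 : (K ⧸ I)⟦X⟧) * Xq ^ 2 * X ^ 4 * C b2 * C c2 + (5 : (K ⧸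 I)⟦X⟧) * Xq * X ^ 5 * C c2 + (8 : (K ⧸ I)⟦X⟧) * Xq ^ 2 * X ^ 3 * C b2 * C c2 + (-1 : (K ⧸ I)⟦X⟧) * Xq ^ 2 * X ^ 3 * C b2 ^ 2 + (-8 : (K ⧸ I)⟦X⟧) * Xq ^ 2 * X ^ 4 * C c2 + (-4 : (K ⧸ I)⟦X⟧) * Xq ^ 2 * X ^ 3 * C c2 + (8 : (K ⧸ I)⟦X⟧) * Xq ^ 2 * X ^ 2 * C c2 + (-1 : (K ⧸ I)⟦X⟧) * Xq ^ 2 * X ^ 2 * C b2 + Xq ^ 2 * X * C b2) * h2Q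

/-- Coefficients of a series are all in `I` iff its image in `(K/I)⟦z⟧` vanishes. [folklore] -/
private theorem coeff_mem_of_map_mk_eq_zero {f : K⟦X⟧} (h : PowerSeries.map (Ideal.Quotient.mk I) f = 0) (n : ℕ) : coeff n f ∈ I := by
  have := congrArg (coeff n) h
  rw [coeff_map, map_zero] at this
  exact Ideal.Quotient.eq_zero_iff_mem.mp this

/-- **`T ≡ z² (mod 2)`, numerator form: every coefficient of `N₂ − z²·𝔇`, `N₂ = (1 + 2B₂)·z·(2 − z)·Xs·𝒰`, lies in any ideal containing `2`**
(with `T·𝔇 = N₂`, `…FrobeniusModel.lean`, and `𝔇` a unit this is the Frobenius-lift hypothesis `hφ` of the tree's Dwork lemma).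
[cite: BlakestadGrant2023, Prop. 7] -/
theorem frob_coeff_N2_sub_mem (hI : (2 : K) ∈ I) (h1 : V.a₁ = 1) (h2 : V.a₂ = B2) (h3 : V.a₃ = 0) (h4 : V.a₄ = 0) (h6 : V.a₆ = g2 * X0 ^ 2)
    (hX0 : X0 = -1 - 4 * B2 - 64 * g2) (hd : d = -(1 + 4 * nu) * g2)
    (hU : cU = V.formalXMulSq ^ 2 - 8 * C d * V.formalXMulSq * X ^ 2 + 2 * (C d * C X0 - 4 * C g2 * C X0) * X ^ 4)
    (hQ : cQ = V.formalXMulSq ^ 2 - 16 * C g2 * V.formalXMulSq * X ^ 2 - 4 * C g2 * C X0 * X ^ 4)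
    (hG : cG = (-C B2 - 32 * C g2) * V.formalXMulSq ^ 2 - 4 * (1 + 2 * C B2) * C d * V.formalXMulSq * X ^ 2 +
        (1 + 2 * C B2) * (C d * C X0 - 4 * C g2 * C X0) * X ^ 4 - 8 * C g2 * C X0 * V.formalXMulSq * X ^ 2 -
        2 * C g2 * C X0 ^ 2 * X ^ 4)
    (hD : cD = (1 + 2 * C B2) * X * V.formalXMulSq * cU + V.formalXMulSq ^ 2 * cQ + 8 * C g2 * C X0 * X ^ 4 * cQ -
        X ^ 2 * V.formalXMulSq * cG) (n : ℕ) :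
    coeff n ((1 + 2 * C B2) * X * (2 - X) * V.formalXMulSq * cU - X ^ 2 * cD) ∈ I := by
  refine coeff_mem_of_map_mk_eq_zero I ?_ n
  have h2Q : (2 : (K ⧸ I)⟦X⟧) = 0 := by
    rw [show (2 : (K ⧸ I)⟦X⟧) = C (Ideal.Quotient.mk I 2) by rw [map_ofNat, map_ofNat],
      Ideal.Quotient.eq_zero_iff_mem.mpr hI, map_zero]
  have hUq := frob_map_calU V I hI hX0 hd hU
  have hDq := frob_map_calD V I hI h1 h2 h3 h4 h6 hX0 hd hU hQ hG hD
  simp only [map_add, map_sub, map_mul, map_pow, map_C, map_X, map_ofNat, map_one, hUq, hDq]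
  set Xq := PowerSeries.map (Ideal.Quotient.mk I) V.formalXMulSq with hXq
  linear_combination (X * Xq ^ 3 - X ^ 2 * Xq ^ 3 + 2 * C (Ideal.Quotient.mk I B2) * X * Xq ^ 3 -
    C (Ideal.Quotient.mk I B2) * X ^ 2 * Xq ^ 3) * h2Q

/-- **`V ≡ 1 (mod 2)`, numerator form: every coefficient of `𝔇² − 𝒬·𝒰²` lies in any ideal containing `2`** (with `V = 𝔇²/(𝒬𝒰²)` this is the
hypothesis `hu` of the tree's Dwork lemma). [cite: BlakestadGrant2023, Prop. 7] -/
theorem frob_coeff_calD_sq_sub_mem (hI : (2 : K) ∈ I) (h1 : V.a₁ = 1) (h2 : V.a₂ = B2) (h3 : V.a₃ = 0) (h4 : V.a₄ = 0) (h6 : V.a₆ = g2 * X0 ^ 2)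
    (hX0 : X0 = -1 - 4 * B2 - 64 * g2) (hd : d = -(1 + 4 * nu) * g2)
    (hU : cU = V.formalXMulSq ^ 2 - 8 * C d * V.formalXMulSq * X ^ 2 + 2 * (C d * C X0 - 4 * C g2 * C X0) * X ^ 4)
    (hQ : cQ = V.formalXMulSq ^ 2 - 16 * C g2 * V.formalXMulSq * X ^ 2 - 4 * C g2 * C X0 * X ^ 4)
    (hG : cG = (-C B2 - 32 * C g2) * V.formalXMulSq ^ 2 - 4 * (1 + 2 * C B2) * C d * V.formalXMulSq * X ^ 2 +
        (1 + 2 * C B2) * (C d * C X0 - 4 * C g2 * C X0) * X ^ 4 - 8 * C g2 * C X0 * V.formalXMulSq * X ^ 2 -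
        2 * C g2 * C X0 ^ 2 * X ^ 4)
    (hD : cD = (1 + 2 * C B2) * X * V.formalXMulSq * cU + V.formalXMulSq ^ 2 * cQ + 8 * C g2 * C X0 * X ^ 4 * cQ -
        X ^ 2 * V.formalXMulSq * cG) (n : ℕ) :
    coeff n (cD ^ 2 - cQ * cU ^ 2) ∈ I := by
  refine coeff_mem_of_map_mk_eq_zero I ?_ n
  have hUq := frob_map_calU V I hI hX0 hd hU
  have hQq := frob_map_calQ V I hI hX0 hQ
  have hDq := frob_map_calD V I hI h1 h2 h3 h4 h6 hX0 hd hU hQ hG hD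
  simp only [map_sub, map_mul, map_pow, hUq, hQq, hDq]
  ring

end ModTwo

end FrobeniusSeries

end Literature.NumberTheory.EllipticCurves.PadicSigmaSqTwo.MazurTate

end Part1

/-!
## Part 2 — port of `Summits/BirchSwinnertonDyer/BirchSwinnertonDyer/Theorems/AlignedTransportAtTwoBSDOfMainConjectureRankOneAtTwoSigmaSqTwoVeluFE.lean`

# The squared `2`-isogeny functional equation for Vélu's quotient, ALL GEOMETRIC INPUTS DISCHARGED: for every model `vc • V'` of
# `V/⟨Q⟩` (`Q` a `2`-torsion point) and normalised odd formal solutions `σ` on `V`, `σ''` on `vc • V'` whose constants satisfy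
# `u²c'' − 2c − e − r = 0`:  `z²·σ''(T)² = u²·σ⁴·(X − ez²)`, i.e. `Σ''(ψP) = u²·Σ(P)²·(x(P) − x(Q))` — the per-curve residue of the
# PRINT stub `stub_sigmaSqTwo` of crux C3′ is now ONLY the constant relation + integrality (route-independent)

Cell `bsd-f1-sign2`, WIDTH-5 attach seat `bsd-line-att-p3` g8 (`--supports stmt-BirchSwinnertonDyer-23008`; plan
`Cruxes/BSDOfMainConjectureRankOneAtTwo/SIGMASQ-AT-TWO-att-p3.md`). THEOREMS ONLY. BSD is not proved by any of this.
Assembly of `X_sq_mul_sq_subst_eq_of_twoIsogeny` (IsogenyFE) with the Vélu files (Velu, VeluFormal, VeluDifferential, VeluTransport):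
the hypotheses `he`, `ht`, `hx`, `hlog`, `hπ` of the functional equation are theorems for `T = θ_vc(τ)`, `τ = zAM/Dn` the parameter of
Vélu's isogeny; at an ordinary `2` with the Frobenius-compatible model `vc = [2; r, ½, −r/2]` (recon R5/R6) this is `H''(T) = H²·V`,
`V = 4z⁴(x − e)/T²`, the input of Dwork's lemma.

## Sources
* J. Vélu, C. R. Acad. Sci. Paris 273 (1971). [cite: SilvermanAEC2009, III.4]
* B. Perrin-Riou, Mém. SMF 17 (1984), Ch. III §1.2. [cite: Perrinriou1984, Ch. III §1.2 Lemme 3 (ii)]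
* C. Blakestad, D. Grant, J. Number Theory 249 (2023), Prop. 13. [cite: BlakestadGrant2023, Prop. 13]
* J. H. Silverman, Math. Ann. 332 (2005), §5 Rem. 2. [cite: Silverman2005DivPoly, §5 Rem. 2]
-/

section Part2


set_option autoImplicit false

open scoped _root_.Classical
open _root_.PowerSeries _root_.WeierstrassCurve _root_.Literature.NumberTheory.EllipticCurves

namespace Literature.NumberTheory.EllipticCurves.PadicSigmaSqTwo.MazurTate

variable {p : ℕ} [Fact p.Prime] (V : WeierstrassCurve ℚ_[p])

/-- The `2`-division condition at a `2`-torsion point `(e, f)`: `4e³ + b₂e² + 2b₄e + b₆ = 0`. [cite: SilvermanAEC2009, III.1] -/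
theorem twoTorsionPolynomial_eq_zero_of_point {R : Type*} [CommRing R] (W : WeierstrassCurve R) {e f : R}
    (hQ : f ^ 2 + W.a₁ * e * f + W.a₃ * f = e ^ 3 + W.a₂ * e ^ 2 + W.a₄ * e + W.a₆) (h2 : 2 * f + W.a₁ * e + W.a₃ = 0) :
    4 * e ^ 3 + W.b₂ * e ^ 2 + 2 * W.b₄ * e + W.b₆ = 0 := by
  simp only [WeierstrassCurve.b₂, WeierstrassCurve.b₄, WeierstrassCurve.b₆]
  linear_combination (-4) * hQ + (2 * f + W.a₁ * e + W.a₃) * h2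

/-- Vélu's `t` in `b`-form: `2t = 6e² + b₂e + b₄`. [cite: SilvermanAEC2009, III.4] -/
theorem two_mul_velu_t {R : Type*} [CommRing R] (W : WeierstrassCurve R) {e f t : R}
    (h2 : 2 * f + W.a₁ * e + W.a₃ = 0) (ht : t = 3 * e ^ 2 + 2 * W.a₂ * e + W.a₄ - W.a₁ * f) :
    2 * t = 6 * e ^ 2 + W.b₂ * e + W.b₄ := by
  simp only [WeierstrassCurve.b₂, WeierstrassCurve.b₄]
  linear_combination 2 * ht - W.a₁ * h2

/-- **The squared `2`-isogeny functional equation for Vélu's quotient, geometric inputs discharged.** `V/ℚ_p`, `Q = (e, f) ∈ V[2]`,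
`t = 3e² + 2a₂e + a₄ − a₁f`, Vélu's `V'` and ANY model `vc • V'` (`vc = (u; r, s, t₀)`), `T = θ_vc(τ)` the isogeny parameter
(`τ = zAM/Dn`); `σ` a normalised odd formal solution of `x + c = −D(Dσ/σ)` on `V`, `σ''` one on `vc • V'` with constant `c''`, and
**`−r + u²c'' − 2c − e = 0`**. Then `z²·σ''(T)² = u²·σ⁴·(X − ez²)`. [cite: Perrinriou1984, Ch. III §1.2 Lemme 3 (ii)]
[cite: BlakestadGrant2023, Prop. 13] [cite: Silverman2005DivPoly, §5 Rem. 2] -/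
theorem velu_two_X_sq_mul_sq_subst_eq {e f t : ℚ_[p]}
    (hQ : f ^ 2 + V.a₁ * e * f + V.a₃ * f = e ^ 3 + V.a₂ * e ^ 2 + V.a₄ * e + V.a₆)
    (h2 : 2 * f + V.a₁ * e + V.a₃ = 0) (ht : t = 3 * e ^ 2 + 2 * V.a₂ * e + V.a₄ - V.a₁ * f)
    {A M Dn u τ P : ℚ_[p]⟦X⟧} (hA : A = V.formalXMulSq - C e * X ^ 2) (hM : M = V.formalXMulSq * A + C t * X ^ 4)
    (hDn : Dn = V.formalXMulSq * A ^ 2 + C t * X ^ 4 * (C V.a₁ * X * A - V.formalXMulSq - C f * X ^ 3))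
    (hu : Dn * u = 1) (hτ : τ = X * A * M * u) (hP : P = A * M ^ 3 * u ^ 2)
    (V' : WeierstrassCurve ℚ_[p]) (h1' : V'.a₁ = V.a₁) (h2' : V'.a₂ = V.a₂) (h3' : V'.a₃ = V.a₃)
    (h4' : V'.a₄ = V.a₄ - 5 * t) (h6' : V'.a₆ = V.a₆ - V.b₂ * t - 7 * e * t)
    (vc : VariableChange ℚ_[p]) {T : ℚ_[p]⟦X⟧} (hT : T = (V'.formalVariableChange vc).subst τ)
    {σ σ'' : ℚ_[p]⟦X⟧} {c c'' : ℚ_[p]}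
    (hσ0 : constantCoeff σ = 0) (hσ1 : coeff 1 σ = 1) (hodd : V.IsFormallyOdd σ) (hODE : V.SatisfiesSigmaODE σ c)
    (hσ0'' : constantCoeff σ'' = 0) (hσ1'' : coeff 1 σ'' = 1) (hodd'' : (vc • V').IsFormallyOdd σ'')
    (hODE'' : (vc • V').SatisfiesSigmaODE σ'' c'')
    (hκ : -vc.r + (vc.u : ℚ_[p]) ^ 2 * c'' - 2 * c - e = 0) :
    X ^ 2 * σ''.subst T ^ 2 = C (vc.u : ℚ_[p]) ^ 2 * σ ^ 4 * (V.formalXMulSq - C e * X ^ 2) := by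
  have he := twoTorsionPolynomial_eq_zero_of_point V hQ h2
  have ht2 := two_mul_velu_t V h2 ht
  have hlog := velu_two_formalLog_transport V hQ h2 ht hA hM hDn hu hτ hP V' h1' h2' h3' h4' h6' vc hT
  have hx := velu_two_x_transport V hQ h2 ht hA hM hDn hu hτ V' h1' h2' h3' h4' h6' vc hT
  have hT0 : constantCoeff T = 0 := by
    have hτ0 : constantCoeff τ = 0 := by
      rw [hτ, map_mul, map_mul, map_mul, constantCoeff_X]; ring
    rw [hT, Literature.RingTheory.FormalGroups.constantCoeff_subst_of_constantCoeff_eq_zero hτ0,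
      constantCoeff_formalVariableChange]
  have hπ : (vc.u : ℚ_[p]) ≠ 0 := vc.u.ne_zero
  exact X_sq_mul_sq_subst_eq_of_twoIsogeny V (vc • V') hσ0 hσ1 hodd hODE hσ0'' hσ1'' hodd'' hODE'' hT0 hlog hπ he ht2 hx hκ

/-- **Sigma-squared currency**: `Σ''(T)·z² = u²·Σ²·(X − ez²)` for `Σ = σ²`, `Σ'' = σ''²` — «`Σ''(ψP) = u²Σ(P)²(x(P) − x(Q))`»; with the
Frobenius-compatible model at an ordinary `2` (`u = 2`), `H''(T) = H²·V` for `H = Σ/z²`, `V = 4z⁴(x − e)/T²`.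
[cite: Silverman2005DivPoly, §5 Rem. 2] [cite: BlakestadGrant2023, Prop. 13] -/
theorem velu_two_sq_subst_mul_X_sq_eq {e f t : ℚ_[p]}
    (hQ : f ^ 2 + V.a₁ * e * f + V.a₃ * f = e ^ 3 + V.a₂ * e ^ 2 + V.a₄ * e + V.a₆)
    (h2 : 2 * f + V.a₁ * e + V.a₃ = 0) (ht : t = 3 * e ^ 2 + 2 * V.a₂ * e + V.a₄ - V.a₁ * f)
    {A M Dn u τ P : ℚ_[p]⟦X⟧} (hA : A = V.formalXMulSq - C e * X ^ 2) (hM : M = V.formalXMulSq * A + C t * X ^ 4)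
    (hDn : Dn = V.formalXMulSq * A ^ 2 + C t * X ^ 4 * (C V.a₁ * X * A - V.formalXMulSq - C f * X ^ 3))
    (hu : Dn * u = 1) (hτ : τ = X * A * M * u) (hP : P = A * M ^ 3 * u ^ 2)
    (V' : WeierstrassCurve ℚ_[p]) (h1' : V'.a₁ = V.a₁) (h2' : V'.a₂ = V.a₂) (h3' : V'.a₃ = V.a₃)
    (h4' : V'.a₄ = V.a₄ - 5 * t) (h6' : V'.a₆ = V.a₆ - V.b₂ * t - 7 * e * t)
    (vc : VariableChange ℚ_[p]) {T : ℚ_[p]⟦X⟧} (hT : T = (V'.formalVariableChange vc).subst τ)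
    {σ σ'' : ℚ_[p]⟦X⟧} {c c'' : ℚ_[p]}
    (hσ0 : constantCoeff σ = 0) (hσ1 : coeff 1 σ = 1) (hodd : V.IsFormallyOdd σ) (hODE : V.SatisfiesSigmaODE σ c)
    (hσ0'' : constantCoeff σ'' = 0) (hσ1'' : coeff 1 σ'' = 1) (hodd'' : (vc • V').IsFormallyOdd σ'')
    (hODE'' : (vc • V').SatisfiesSigmaODE σ'' c'')
    (hκ : -vc.r + (vc.u : ℚ_[p]) ^ 2 * c'' - 2 * c - e = 0) :
    (σ'' ^ 2).subst T * X ^ 2 = C (vc.u : ℚ_[p]) ^ 2 * (σ ^ 2) ^ 2 * (V.formalXMulSq - C e * X ^ 2) := by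
  have h := velu_two_X_sq_mul_sq_subst_eq V hQ h2 ht hA hM hDn hu hτ hP V' h1' h2' h3' h4' h6' vc hT hσ0 hσ1 hodd hODE
    hσ0'' hσ1'' hodd'' hODE'' hκ
  have hT0 : constantCoeff T = 0 := by
    have hτ0 : constantCoeff τ = 0 := by
      rw [hτ, map_mul, map_mul, map_mul, constantCoeff_X]; ring
    rw [hT, Literature.RingTheory.FormalGroups.constantCoeff_subst_of_constantCoeff_eq_zero hτ0,
      constantCoeff_formalVariableChange]
  rw [subst_pow (HasSubst.of_constantCoeff_zero' hT0)]
  linear_combination h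

end Literature.NumberTheory.EllipticCurves.PadicSigmaSqTwo.MazurTate

end Part2

/-!
## Part 3 — port of `Summits/BirchSwinnertonDyer/BirchSwinnertonDyer/Theorems/AlignedTransportAtTwoBSDOfMainConjectureRankOneAtTwoSigmaSqTwoODEFamily.lean`

# The family of normalised odd formal solutions `σ_c` of the Mazur–Tate sigma equation over an ARBITRARY `ℚ`-algebra,
# and its functoriality under base change (step S6 glue of the discharge plan for the PRINT stub `stub_sigmaSqTwo`)

Cell `bsd-f1-sign2`, WIDTH-5 attach seat `bsd-line-att-p3` g8 (`--supports stmt-BirchSwinnertonDyer-23008`; plan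
`Cruxes/BSDOfMainConjectureRankOneAtTwo/SIGMASQ-AT-TWO-att-p3.md`, §7/S6). THEOREMS ONLY; route-independent. BSD is not proved by any of this.

WHY. The universal Dwork argument (S6) needs, over `K₂ = R̂₂[1/2]` (a `ℚ`-algebra DOMAIN, not a field, `Literature…PadicSigmaSqTwo.Universal.
completeRingQ`): (i) for the fixed-point constant `c ∈ R̂₂` (`…SigmaSqTwoConstantFixedPoint.lean`) a normalised odd solution `σ_c ∈ K₂⟦z⟧` of
`x + c = −D(Dσ/σ)` on the universal chart curve; (ii) that its base change along the Frobenius-type endomorphism `α` is the solution of the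
`α`-twisted curve with constant `α(c)`. The tree has (i) over `ℚ_p` only (`exists_isFormallyOdd_satisfiesSigmaODE[_zero|_const]`,
`SigmaSqDivisionBridgeProofs` / `X049CMSigmaSqTwoProofs` / `PerrinRiouCMSigma`); the ingredients (Blakestad–Grant's `σ = z·exp ∫(Λω − 1)/z` for a zeta
series, `PadicSigmaOfZetaProofs`, `PadicWeierstrassZetaProofs`, `PadicSigmaVariableChangeProofs`) are already stated over a `ℚ`-algebra. This file
re-runs the `ℚ_p` proofs verbatim over ANY `ℚ`-algebra `[CommRing K] [Algebra ℚ K]` and adds the (missing) base-change lemmas.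

* §1 base change (any rings): `map_formalInvariantDerivation`, `map_logDeriv₂Num`, `isFormallyOdd_map_ringHom`; (`ℚ`-algebras)
  `satisfiesSigmaODE_map_ringHom` — **`(σ, c)` a normalised solution on `V` ⇒ `(σ^φ, φ c)` one on `V^φ`.**
* §2 existence over a `ℚ`-algebra: `exists_isFormallyOdd_satisfiesSigmaODE_ratAlgebra` (some `c`), the twist
  `satisfiesSigmaODE_mul_exp_subst_ratAlgebra` / `isFormallyOdd_mul_exp_subst_ratAlgebra` (`σ·exp(ε log²)` has constant `c − 2ε`), and
  **`exists_isFormallyOdd_satisfiesSigmaODE_const_ratAlgebra : ∀ c, ∃ σ, σ(0) = 0 ∧ σ'(0) = 1 ∧ odd ∧ ODE(σ, c)`.**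

## Sources
B. Mazur, J. Tate, Duke Math. J. 62 (1991) §3; B. Mazur, W. Stein, J. Tate, Doc. Math. Extra Vol. Coates (2006), Thm. 1.3, §3.1 (the one-parameter
family of formal solutions) [cite: MazurSteinTate2006, Thm. 1.3]; C. Blakestad, D. Grant, J. Number Theory 249 (2023), Thm. 1, Thm. 2
[cite: BlakestadGrant2023, Thm. 1].
-/

section Part3


set_option autoImplicit false

open scoped _root_.Classical
open _root_.PowerSeries _root_.WeierstrassCurve _root_.Literature.NumberTheory.EllipticCurves _root_.Literature.RingTheory.FormalGroups

namespace Literature.NumberTheory.EllipticCurves.PadicSigmaSqTwo.MazurTate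

/-! ## §1 Base change -/

section BaseChange

variable {R S : Type*} [CommRing R] [CommRing S] (φ : R →+* S) (W : WeierstrassCurve R)

/-- `D = η·d/dz` commutes with base change. [folklore] -/
private theorem map_formalInvariantDerivation (g : R⟦X⟧) :
    PowerSeries.map φ (W.formalInvariantDerivation g) = (W.map φ).formalInvariantDerivation (PowerSeries.map φ g) := by
  rw [formalInvariantDerivation_apply, formalInvariantDerivation_apply, map_mul, map_formalEta, powerSeries_map_derivative]

/-- `N_D(g) = g·D²g − (Dg)²` commutes with base change. [folklore] -/
private theorem map_logDeriv₂Num (g : R⟦X⟧) :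
    PowerSeries.map φ (logDeriv₂Num W.formalInvariantDerivation g) =
      logDeriv₂Num (W.map φ).formalInvariantDerivation (PowerSeries.map φ g) := by
  rw [logDeriv₂Num_def, logDeriv₂Num_def, map_sub, map_mul, map_pow, map_formalInvariantDerivation,
    map_formalInvariantDerivation]

variable {W} in
/-- **Mazur–Tate oddness is preserved by base change** (`i_{W^φ} = i_W^φ`). [cite: MazurSteinTate2006, Thm. 1.3] -/
theorem isFormallyOdd_map_ringHom {σ : R⟦X⟧} (h : W.IsFormallyOdd σ) :
    (W.map φ).IsFormallyOdd (PowerSeries.map φ σ) := by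
  unfold WeierstrassCurve.IsFormallyOdd at h ⊢
  rw [← map_formalNeg, ← Literature.NumberTheory.EllipticCurves.powerSeries_map_subst W.hasSubst_formalNeg φ σ, h,
    map_neg]

end BaseChange

section BaseChangeRat

variable {A B : Type*} [CommRing A] [CommRing B] [Algebra ℚ A] [Algebra ℚ B] (φ : A →+* B) (V : WeierstrassCurve A)

variable {V} in
/-- **The sigma equation is preserved by base change**: if `σ = z + ⋯` satisfies `x + c = −D(Dσ/σ)` on `V`, then `σ^φ` satisfies it on
`V^φ` with constant `φ(c)` (through the cleared form `z²·N_D(σ) = −(X + cz²)σ²`). [cite: MazurSteinTate2006, Thm. 1.3] -/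
theorem satisfiesSigmaODE_map_ringHom {σ : A⟦X⟧} {c : A} (hσ0 : constantCoeff σ = 0) (hσ1 : coeff 1 σ = 1)
    (h : V.SatisfiesSigmaODE σ c) : (V.map φ).SatisfiesSigmaODE (PowerSeries.map φ σ) (φ c) := by
  have h0 : constantCoeff (PowerSeries.map φ σ) = 0 := by
    rw [← coeff_zero_eq_constantCoeff_apply, coeff_map, coeff_zero_eq_constantCoeff_apply, hσ0, map_zero]
  have h1 : coeff 1 (PowerSeries.map φ σ) = 1 := by rw [coeff_map, hσ1, map_one]
  have hN := (satisfiesSigmaODE_iff_X_sq_mul_logDeriv₂Num hσ0 hσ1).mp h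
  rw [satisfiesSigmaODE_iff_X_sq_mul_logDeriv₂Num h0 h1, ← map_logDeriv₂Num, ← map_formalXMulSq]
  have e := congrArg (PowerSeries.map φ) hN
  rw [map_mul, map_pow, map_X, map_mul, map_neg, map_add, map_pow, map_mul, map_C, map_pow, map_X] at e
  exact e

end BaseChangeRat

/-! ## §2 Existence of the family `σ_c` over a `ℚ`-algebra -/

section Existence

variable {K : Type*} [CommRing K] [Algebra ℚ K] (V : WeierstrassCurve K)

/-- Positive integers are units of a `ℚ`-algebra. [folklore] -/
private theorem isUnit_natCast_succ (k : ℕ) : IsUnit ((k + 1 : ℕ) : K) := by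
  have h : IsUnit ((k + 1 : ℕ) : ℚ) := isUnit_iff_ne_zero.mpr (Nat.cast_ne_zero.mpr k.succ_ne_zero)
  have := h.map (algebraMap ℚ K)
  rwa [map_natCast] at this

/-- The differential `x·ω` is formally exact over a `ℚ`-algebra: `k ∣ [z^{k+1}](X·W)` (for `k = 0`: `[z¹](X·W) = a₁ − a₁ = 0`). [folklore] -/
private theorem natCast_dvd_coeff_succ_ratAlgebra (W : WeierstrassCurve K) (k : ℕ) :
    (k : K) ∣ coeff (k + 1) ((W.formalXMulSq - C (0 : K) * X ^ 2) * W.formalInvDiff) := by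
  rcases k with _ | k
  · rw [Nat.cast_zero, zero_dvd_iff, zero_add, map_zero, zero_mul, sub_zero, coeff_one_mul_eq,
      coeff_zero_eq_constantCoeff_apply, constantCoeff_formalXMulSq, coeff_one_formalInvDiff,
      coeff_one_formalXMulSq, coeff_zero_eq_constantCoeff_apply, constantCoeff_formalInvDiff]
    ring
  · exact (isUnit_natCast_succ k).dvd

/-- `2` is invertible in a `ℚ`-algebra. [folklore] -/
private theorem isUnit_two_ratAlgebra : IsUnit (2 : K) := by
  have := isUnit_natCast_succ (K := K) 1
  norm_num at this
  exact this

/-- **Over a `ℚ`-algebra, every Weierstrass curve has, for SOME constant `c`, a normalised odd formal solution `σ = z + ⋯` of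
the sigma equation** (Blakestad–Grant's `σ = z·exp∫(Λω − 1)/z` on the `a₁ = a₃ = 0` model with an even zeta series, `β = 0`, transported back;
the tree's `exists_isFormallyOdd_satisfiesSigmaODE` verbatim with `ℚ_p` replaced by `K`). [cite: BlakestadGrant2023, Thm. 1] -/
theorem exists_isFormallyOdd_satisfiesSigmaODE_ratAlgebra :
    ∃ σ : K⟦X⟧, ∃ c : K, constantCoeff σ = 0 ∧ coeff 1 σ = 1 ∧ V.IsFormallyOdd σ ∧ V.SatisfiesSigmaODE σ c := by
  obtain ⟨u2, hu2⟩ := (isUnit_two_ratAlgebra (K := K)).exists_right_inv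
  haveI : Invertible (2 : K) := ⟨u2, by rw [mul_comm]; exact hu2, hu2⟩
  haveI := IsAddTorsionFree.of_module_rat (M := K)
  set V' := V.toCharNeTwoNF • V with hV'
  haveI : V'.IsCharNeTwoNF := V.toCharNeTwoNF_spec
  obtain ⟨Λ₀, h00, hΛ₀, -⟩ := V'.exists_padicWeierstrassZetaSeries (natCast_dvd_coeff_succ_ratAlgebra V')
  obtain ⟨hΛ, hc⟩ := zetaSeries_sub_C_mul_X hΛ₀ (coeff 1 Λ₀)
  set Λ := Λ₀ - C (coeff 1 Λ₀) * X with hΛdef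
  have h0 : constantCoeff Λ = 1 := hc.trans h00
  have h1 : coeff 1 Λ = 0 := by
    rw [hΛdef, map_sub, coeff_C_mul, coeff_one_X, mul_one, sub_self]
  have hΦ : rescale (-1 : K) ((V'.formalXMulSq - C (0 : K) * X ^ 2) * V'.formalInvDiff) =
      (V'.formalXMulSq - C (0 : K) * X ^ 2) * V'.formalInvDiff := by
    rw [map_zero, zero_mul, sub_zero, map_mul, V'.rescale_neg_one_formalXMulSq, V'.rescale_neg_one_formalInvDiff]
  have hev : rescale (-1 : K) Λ = Λ := rescale_neg_one_eq_self_of_zetaSeries hΛ hΦ h1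
  have hΛω : X * d⁄dX K Λ - Λ = -((V'.formalXMulSq - C (0 : K) * X ^ 2) * V'.formalOmega) := by
    rw [← formalInvDiff_eq_formalOmega]; exact hΛ
  have hσ'0 : constantCoeff (V'.sigmaOfZeta Λ) = 0 := V'.constantCoeff_sigmaOfZeta Λ
  have hσ'1 : coeff 1 (V'.sigmaOfZeta Λ) = 1 := V'.coeff_one_sigmaOfZeta Λ
  have hodd' : V'.IsFormallyOdd (V'.sigmaOfZeta Λ) := V'.isFormallyOdd_sigmaOfZeta hev
  have hODE' : V'.SatisfiesSigmaODE (V'.sigmaOfZeta Λ) (-0) := V'.satisfiesSigmaODE_sigmaOfZeta h0 hΛω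
  rw [hV'] at hodd' hODE' hσ'0 hσ'1
  refine ⟨C ((V.toCharNeTwoNF.u⁻¹ : Kˣ) : K) *
      ((V.toCharNeTwoNF • V).sigmaOfZeta Λ).subst (V.formalVariableChange V.toCharNeTwoNF),
    (V.toCharNeTwoNF.u : K) ^ 2 * (-0) - V.toCharNeTwoNF.r, ?_, ?_,
    hodd'.variableChange_subst _, hODE'.variableChange_subst hσ'0 hσ'1⟩
  · rw [map_mul, V.constantCoeff_subst_formalVariableChange V.toCharNeTwoNF hσ'0, mul_zero]
  · rw [coeff_C_mul, V.coeff_one_subst_formalVariableChange V.toCharNeTwoNF hσ'1, Units.inv_mul]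

/-- `ε·log_W²` has no constant term. [folklore] -/
private theorem constantCoeff_C_mul_formalLog_sq_ratAlgebra (ε : K) : constantCoeff (C ε * V.formalLog ^ 2) = 0 := by
  rw [map_mul, map_pow, constantCoeff_formalLog, zero_pow two_ne_zero, mul_zero]

/-- `D exp(ε·log_W²) = 2ε·log_W·exp(ε·log_W²)`. [folklore] -/
private theorem formalInvariantDerivation_exp_subst_ratAlgebra (ε : K) :
    V.formalInvariantDerivation ((exp K).subst (C ε * V.formalLog ^ 2)) =
      2 * C ε * V.formalLog * (exp K).subst (C ε * V.formalLog ^ 2) := by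
  have hg0 := constantCoeff_C_mul_formalLog_sq_ratAlgebra V ε
  have hηω : V.formalEta * V.formalOmega = 1 := V.formalEta_mul_formalOmega
  rw [formalInvariantDerivation_apply, derivative_exp_subst hg0, Derivation.leibniz, Derivation.leibniz_pow,
    derivative_C, derivative_formalLog, smul_zero, add_zero, smul_eq_mul, nsmul_eq_mul, Nat.cast_ofNat,
    Nat.add_one_sub_one, pow_one]
  linear_combination (2 * C ε * V.formalLog * (exp K).subst (C ε * V.formalLog ^ 2)) * hηω

/-- `exp(ε·log_W²)` is even: invariant under `z ↦ i(z)` (`log_W ∘ i = −log_W`). [folklore] -/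
private theorem exp_subst_subst_formalNeg_ratAlgebra (ε : K) :
    PowerSeries.subst V.formalNeg ((exp K).subst (C ε * V.formalLog ^ 2)) = (exp K).subst (C ε * V.formalLog ^ 2) := by
  have hg0 := constantCoeff_C_mul_formalLog_sq_ratAlgebra V ε
  have hi := V.hasSubst_formalNeg
  rw [PowerSeries.subst_comp_subst_apply (PowerSeries.HasSubst.of_constantCoeff_zero' hg0) hi,
    subst_mul hi, subst_C, subst_pow hi, formalLog_subst_formalNeg, neg_sq]
  rfl

variable {V} in
/-- **Twist**: `(σ·exp(ε log_W²), c − 2ε)` is again a normalised solution when `(σ, c)` is (the tree's `SatisfiesSigmaODE.mul_exp_subst`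
over a `ℚ`-algebra). [cite: MazurSteinTate2006, Thm. 1.3] -/
theorem satisfiesSigmaODE_mul_exp_subst_ratAlgebra {σ : K⟦X⟧} {c : K} (hσ0 : constantCoeff σ = 0)
    (hσ1 : coeff 1 σ = 1) (h : V.SatisfiesSigmaODE σ c) (ε : K) :
    constantCoeff (σ * (exp K).subst (C ε * V.formalLog ^ 2)) = 0 ∧
      coeff 1 (σ * (exp K).subst (C ε * V.formalLog ^ 2)) = 1 ∧
      V.SatisfiesSigmaODE (σ * (exp K).subst (C ε * V.formalLog ^ 2)) (c - 2 * ε) := by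
  set E := (exp K).subst (C ε * V.formalLog ^ 2) with hE
  have hg0 := constantCoeff_C_mul_formalLog_sq_ratAlgebra V ε
  have hE0 : constantCoeff E = 1 := constantCoeff_exp_subst hg0
  have h0 : constantCoeff (σ * E) = 0 := by rw [map_mul, hσ0, zero_mul]
  have h1 : coeff 1 (σ * E) = 1 := by
    rw [coeff_one_mul_eq, coeff_zero_eq_constantCoeff_apply, hσ0, zero_mul, zero_add, hσ1,
      coeff_zero_eq_constantCoeff_apply, hE0, mul_one]
  refine ⟨h0, h1, ?_⟩
  have hN := (satisfiesSigmaODE_iff_X_sq_mul_logDeriv₂Num hσ0 hσ1).mp h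
  rw [satisfiesSigmaODE_iff_X_sq_mul_logDeriv₂Num h0 h1, logDeriv₂Num_mul, logDeriv₂Num_def _ E]
  have hDE : V.formalInvariantDerivation E = 2 * C ε * V.formalLog * E := formalInvariantDerivation_exp_subst_ratAlgebra V ε
  have hDlog : V.formalInvariantDerivation V.formalLog = 1 := by
    rw [formalInvariantDerivation_apply, derivative_formalLog, V.formalEta_mul_formalOmega]
  have hD2 : V.formalInvariantDerivation (2 : K⟦X⟧) = 0 := by
    rw [show (2 : K⟦X⟧) = ((2 : ℕ) : K⟦X⟧) by norm_cast]; exact Derivation.map_natCast _ 2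
  have hDDE : V.formalInvariantDerivation (V.formalInvariantDerivation E) =
      2 * C ε * E + (2 * C ε * V.formalLog) ^ 2 * E := by
    rw [hDE]
    simp only [Derivation.leibniz, smul_eq_mul, formalInvariantDerivation_C, hD2, hDlog, hDE]
    ring
  rw [hDDE, hDE, map_sub, map_mul, map_ofNat]
  linear_combination E ^ 2 * hN

variable {V} in
/-- Parity of the twist: `σ` odd ⇒ `σ·exp(ε log_W²)` odd. [cite: MazurSteinTate2006, Thm. 1.3] -/
theorem isFormallyOdd_mul_exp_subst_ratAlgebra {σ : K⟦X⟧} (h : V.IsFormallyOdd σ) (ε : K) :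
    V.IsFormallyOdd (σ * (exp K).subst (C ε * V.formalLog ^ 2)) := by
  unfold WeierstrassCurve.IsFormallyOdd at h ⊢
  rw [subst_mul V.hasSubst_formalNeg, h, exp_subst_subst_formalNeg_ratAlgebra V ε, neg_mul]

/-- **Over a `ℚ`-algebra the sigma equation `x + c = −D(Dσ/σ)` has a normalised ODD formal solution for EVERY constant `c`**
(twist the solution with constant `c₀` by `exp(((c₀ − c)/2)·log_W²)`). Applies to `K₂ = R̂₂[1/2]`.
[cite: MazurSteinTate2006, Thm. 1.3] -/
theorem exists_isFormallyOdd_satisfiesSigmaODE_const_ratAlgebra (c : K) :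
    ∃ σ : K⟦X⟧, constantCoeff σ = 0 ∧ coeff 1 σ = 1 ∧ V.IsFormallyOdd σ ∧ V.SatisfiesSigmaODE σ c := by
  obtain ⟨σ₀, c₀, h0, h1, hodd, hODE⟩ := exists_isFormallyOdd_satisfiesSigmaODE_ratAlgebra V
  obtain ⟨u2, hu2⟩ := (isUnit_two_ratAlgebra (K := K)).exists_right_inv
  obtain ⟨h0', h1', hODE'⟩ := satisfiesSigmaODE_mul_exp_subst_ratAlgebra h0 h1 hODE (u2 * (c₀ - c))
  refine ⟨_, h0', h1', isFormallyOdd_mul_exp_subst_ratAlgebra hodd (u2 * (c₀ - c)), ?_⟩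
  convert hODE' using 2
  linear_combination (c₀ - c) * hu2

end Existence

end Literature.NumberTheory.EllipticCurves.PadicSigmaSqTwo.MazurTate

end Part3

/-!
## Part 4 — port of `Summits/BirchSwinnertonDyer/BirchSwinnertonDyer/Theorems/AlignedTransportAtTwoBSDOfMainConjectureRankOneAtTwoSigmaSqTwoFieldVeluFE.lean`

# The squared `2`-isogeny functional equation for Vélu's quotient, ALL GEOMETRIC INPUTS DISCHARGED: for every model `vc • V'` of
# `V/⟨Q⟩` (`Q` a `2`-torsion point) and normalised odd formal solutions `σ` on `V`, `σ''` on `vc • V'` whose constants satisfy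
# `u²c'' − 2c − e − r = 0`:  `z²·σ''(T)² = u²·σ⁴·(X − ez²)`, i.e. `Σ''(ψP) = u²·Σ(P)²·(x(P) − x(Q))` — the per-curve residue of the
# PRINT stub `stub_sigmaSqTwo` of crux C3′ is now ONLY the constant relation + integrality (route-independent)

Cell `bsd-f1-sign2`, WIDTH-5 attach seat `bsd-line-att-p3` g8 (`--supports stmt-BirchSwinnertonDyer-23008`; plan
`Cruxes/BSDOfMainConjectureRankOneAtTwo/SIGMASQ-AT-TWO-att-p3.md`). THEOREMS ONLY. BSD is not proved by any of this. FIELD-GENERAL RE-ISSUE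
(any field `F` of characteristic `0`, namespace `….SigmaSqTwo.Field`) of `…SigmaSqTwoVeluFE.lean` (stated over `ℚ_p` only): the universal
Dwork argument (plan S6/§7) runs the functional equation in `Frac(R̂₂)⟦z⟧ ⊇ K₂⟦z⟧`; the constants relation `hκ` is supplied there by
`…SigmaSqTwoConstantFixedPoint.lean` with `c'' = α(c)`. Proofs verbatim.
Assembly of `X_sq_mul_sq_subst_eq_of_twoIsogeny` (IsogenyFE) with the Vélu files (Velu, VeluFormal, VeluDifferential, VeluTransport):
the hypotheses `he`, `ht`, `hx`, `hlog`, `hπ` of the functional equation are theorems for `T = θ_vc(τ)`, `τ = zAM/Dn` the parameter of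
Vélu's isogeny; at an ordinary `2` with the Frobenius-compatible model `vc = [2; r, ½, −r/2]` (recon R5/R6) this is `H''(T) = H²·V`,
`V = 4z⁴(x − e)/T²`, the input of Dwork's lemma.

## Sources
* J. Vélu, C. R. Acad. Sci. Paris 273 (1971). [cite: SilvermanAEC2009, III.4]
* B. Perrin-Riou, Mém. SMF 17 (1984), Ch. III §1.2. [cite: Perrinriou1984, Ch. III §1.2 Lemme 3 (ii)]
* C. Blakestad, D. Grant, J. Number Theory 249 (2023), Prop. 13. [cite: BlakestadGrant2023, Prop. 13]
* J. H. Silverman, Math. Ann. 332 (2005), §5 Rem. 2. [cite: Silverman2005DivPoly, §5 Rem. 2]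
-/

section Part4


set_option autoImplicit false

open scoped _root_.Classical
open _root_.PowerSeries _root_.WeierstrassCurve _root_.Literature.NumberTheory.EllipticCurves

namespace Literature.NumberTheory.EllipticCurves.PadicSigmaSqTwo.MazurTate.Field

variable {F : Type*} [Field F] [CharZero F] (V : WeierstrassCurve F)

/-- **The squared `2`-isogeny functional equation for Vélu's quotient, geometric inputs discharged.** `V/F` (`F` a field of characteristic `0`), `Q = (e, f) ∈ V[2]`,
`t = 3e² + 2a₂e + a₄ − a₁f`, Vélu's `V'` and ANY model `vc • V'` (`vc = (u; r, s, t₀)`), `T = θ_vc(τ)` the isogeny parameter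
(`τ = zAM/Dn`); `σ` a normalised odd formal solution of `x + c = −D(Dσ/σ)` on `V`, `σ''` one on `vc • V'` with constant `c''`, and
**`−r + u²c'' − 2c − e = 0`**. Then `z²·σ''(T)² = u²·σ⁴·(X − ez²)`. [cite: Perrinriou1984, Ch. III §1.2 Lemme 3 (ii)]
[cite: BlakestadGrant2023, Prop. 13] [cite: Silverman2005DivPoly, §5 Rem. 2] -/
theorem velu_two_X_sq_mul_sq_subst_eq {e f t : F}
    (hQ : f ^ 2 + V.a₁ * e * f + V.a₃ * f = e ^ 3 + V.a₂ * e ^ 2 + V.a₄ * e + V.a₆)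
    (h2 : 2 * f + V.a₁ * e + V.a₃ = 0) (ht : t = 3 * e ^ 2 + 2 * V.a₂ * e + V.a₄ - V.a₁ * f)
    {A M Dn u τ P : F⟦X⟧} (hA : A = V.formalXMulSq - C e * X ^ 2) (hM : M = V.formalXMulSq * A + C t * X ^ 4)
    (hDn : Dn = V.formalXMulSq * A ^ 2 + C t * X ^ 4 * (C V.a₁ * X * A - V.formalXMulSq - C f * X ^ 3))
    (hu : Dn * u = 1) (hτ : τ = X * A * M * u) (hP : P = A * M ^ 3 * u ^ 2)
    (V' : WeierstrassCurve F) (h1' : V'.a₁ = V.a₁) (h2' : V'.a₂ = V.a₂) (h3' : V'.a₃ = V.a₃)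
    (h4' : V'.a₄ = V.a₄ - 5 * t) (h6' : V'.a₆ = V.a₆ - V.b₂ * t - 7 * e * t)
    (vc : VariableChange F) {T : F⟦X⟧} (hT : T = (V'.formalVariableChange vc).subst τ)
    {σ σ'' : F⟦X⟧} {c c'' : F}
    (hσ0 : constantCoeff σ = 0) (hσ1 : coeff 1 σ = 1) (hodd : V.IsFormallyOdd σ) (hODE : V.SatisfiesSigmaODE σ c)
    (hσ0'' : constantCoeff σ'' = 0) (hσ1'' : coeff 1 σ'' = 1) (hodd'' : (vc • V').IsFormallyOdd σ'')
    (hODE'' : (vc • V').SatisfiesSigmaODE σ'' c'')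
    (hκ : -vc.r + (vc.u : F) ^ 2 * c'' - 2 * c - e = 0) :
    X ^ 2 * σ''.subst T ^ 2 = C (vc.u : F) ^ 2 * σ ^ 4 * (V.formalXMulSq - C e * X ^ 2) := by
  have he := twoTorsionPolynomial_eq_zero_of_point V hQ h2
  have ht2 := two_mul_velu_t V h2 ht
  have hlog := velu_two_formalLog_transport V hQ h2 ht hA hM hDn hu hτ hP V' h1' h2' h3' h4' h6' vc hT
  have hx := velu_two_x_transport V hQ h2 ht hA hM hDn hu hτ V' h1' h2' h3' h4' h6' vc hT
  have hT0 : constantCoeff T = 0 := by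
    have hτ0 : constantCoeff τ = 0 := by
      rw [hτ, map_mul, map_mul, map_mul, constantCoeff_X]; ring
    rw [hT, Literature.RingTheory.FormalGroups.constantCoeff_subst_of_constantCoeff_eq_zero hτ0,
      constantCoeff_formalVariableChange]
  have hπ : (vc.u : F) ≠ 0 := vc.u.ne_zero
  exact X_sq_mul_sq_subst_eq_of_twoIsogeny V (vc • V') hσ0 hσ1 hodd hODE hσ0'' hσ1'' hodd'' hODE'' hT0 hlog hπ he ht2 hx hκ

/-- **Sigma-squared currency**: `Σ''(T)·z² = u²·Σ²·(X − ez²)` for `Σ = σ²`, `Σ'' = σ''²` — «`Σ''(ψP) = u²Σ(P)²(x(P) − x(Q))`»; with the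
Frobenius-compatible model at an ordinary `2` (`u = 2`), `H''(T) = H²·V` for `H = Σ/z²`, `V = 4z⁴(x − e)/T²`.
[cite: Silverman2005DivPoly, §5 Rem. 2] [cite: BlakestadGrant2023, Prop. 13] -/
theorem velu_two_sq_subst_mul_X_sq_eq {e f t : F}
    (hQ : f ^ 2 + V.a₁ * e * f + V.a₃ * f = e ^ 3 + V.a₂ * e ^ 2 + V.a₄ * e + V.a₆)
    (h2 : 2 * f + V.a₁ * e + V.a₃ = 0) (ht : t = 3 * e ^ 2 + 2 * V.a₂ * e + V.a₄ - V.a₁ * f)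
    {A M Dn u τ P : F⟦X⟧} (hA : A = V.formalXMulSq - C e * X ^ 2) (hM : M = V.formalXMulSq * A + C t * X ^ 4)
    (hDn : Dn = V.formalXMulSq * A ^ 2 + C t * X ^ 4 * (C V.a₁ * X * A - V.formalXMulSq - C f * X ^ 3))
    (hu : Dn * u = 1) (hτ : τ = X * A * M * u) (hP : P = A * M ^ 3 * u ^ 2)
    (V' : WeierstrassCurve F) (h1' : V'.a₁ = V.a₁) (h2' : V'.a₂ = V.a₂) (h3' : V'.a₃ = V.a₃)
    (h4' : V'.a₄ = V.a₄ - 5 * t) (h6' : V'.a₆ = V.a₆ - V.b₂ * t - 7 * e * t)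
    (vc : VariableChange F) {T : F⟦X⟧} (hT : T = (V'.formalVariableChange vc).subst τ)
    {σ σ'' : F⟦X⟧} {c c'' : F}
    (hσ0 : constantCoeff σ = 0) (hσ1 : coeff 1 σ = 1) (hodd : V.IsFormallyOdd σ) (hODE : V.SatisfiesSigmaODE σ c)
    (hσ0'' : constantCoeff σ'' = 0) (hσ1'' : coeff 1 σ'' = 1) (hodd'' : (vc • V').IsFormallyOdd σ'')
    (hODE'' : (vc • V').SatisfiesSigmaODE σ'' c'')
    (hκ : -vc.r + (vc.u : F) ^ 2 * c'' - 2 * c - e = 0) :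
    (σ'' ^ 2).subst T * X ^ 2 = C (vc.u : F) ^ 2 * (σ ^ 2) ^ 2 * (V.formalXMulSq - C e * X ^ 2) := by
  have h := velu_two_X_sq_mul_sq_subst_eq V hQ h2 ht hA hM hDn hu hτ hP V' h1' h2' h3' h4' h6' vc hT hσ0 hσ1 hodd hODE
    hσ0'' hσ1'' hodd'' hODE'' hκ
  have hT0 : constantCoeff T = 0 := by
    have hτ0 : constantCoeff τ = 0 := by
      rw [hτ, map_mul, map_mul, map_mul, constantCoeff_X]; ring
    rw [hT, Literature.RingTheory.FormalGroups.constantCoeff_subst_of_constantCoeff_eq_zero hτ0,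
      constantCoeff_formalVariableChange]
  rw [subst_pow (HasSubst.of_constantCoeff_zero' hT0)]
  linear_combination h

end Literature.NumberTheory.EllipticCurves.PadicSigmaSqTwo.MazurTate.Field

end Part4

/-!
## Part 5 — port of `Summits/BirchSwinnertonDyer/BirchSwinnertonDyer/Theorems/AlignedTransportAtTwoBSDOfMainConjectureRankOneAtTwoSigmaSqTwoUniversalSpecialization.lean`

# Specialisation: an integral odd sigma solution of the UNIVERSAL `a₁`-chart curve over `K₂ = R̂₂[1/2]` gives the PRINT fact
# `mazurTate_sigmaSq_existsUnique_two` (the last step, S6-end, of the discharge plan for the PRINT stub `stub_sigmaSqTwo`)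

Cell `bsd-f1-sign2`, WIDTH-5 attach seat `bsd-line-att-p3` g8 (`--supports stmt-BirchSwinnertonDyer-23008`; plan
`Cruxes/BSDOfMainConjectureRankOneAtTwo/SIGMASQ-AT-TWO-att-p3.md`, §7/S6). THEOREMS ONLY; route-independent. BSD is not proved by any of this,
and the PRINT fact is NOT discharged here: this file reduces it to ONE statement about the universal curve.

**`mazurTate_sigmaSq_existsUnique_two_of_universal`.** Let `𝓔 = universalCurve = y² + xy = x³ + B₂x² + B₆` over `R̂₂`
(`Literature…PadicSigmaSqTwo.Universal`), `K₂ = completeRingQ`. IF there are `σ ∈ K₂⟦z⟧`, `c ∈ K₂` with `σ = z + ⋯` a normalised ODD formal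
solution of the sigma equation of `𝓔_{K₂}` with constant `c` whose SQUARE has all coefficients in `R̂₂ = intSubring` (this is what the Dwork
step S6 is to deliver, for the fixed-point constant `c` of `…ConstantFixedPoint.lean`), THEN `mazurTate_sigmaSq_existsUnique_two` holds:
for every chart curve `⟨1, b₂, 0, 0, b₆⟩/ℤ₂` with `b₆` a unit, `D(b₂, b₆) = b₆((1 + 4b₂)³ + 432b₆)` is a unit, `ρ = specialize b₂ b₆ : R̂₂ → ℤ₂`
maps `𝓔` to it (`universalCurve_map_specialize`), `ρ_K : K₂ → ℚ₂` over `ρ` exists (`exists_ringHom_completeRingQ_padic`), `σ^{ρ_K}` is a normalised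
odd solution over `ℚ₂` (`isFormallyOdd_map_ringHom`, `satisfiesSigmaODE_map_ringHom`) with `‖[zⁿ](σ^{ρ_K})²‖ ≤ 1` (`norm_le_one_of_mem_intSubring`),
so `((σ^{ρ_K})², ρ_K c)` is a Mazur–Tate sigma-squared pair (`isMazurTateSigmaSqPair_sq_of_norm_coeff_sq_le`), and
`mazurTate_sigmaSq_existsUnique_two_of_forall_chart` (S0, `…SigmaSqTwoChart.lean`) concludes. (Blakestad–Grant's Thm. 15 at `p = 2`, squared.)

## Sources
C. Blakestad, D. Grant, J. Number Theory 249 (2023), Thm. 15 (specialisation of the universal sigma function) [cite: BlakestadGrant2023, Thm. 15];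
B. Mazur, J. Tate, Duke Math. J. 62 (1991), Thm. 3.1 [cite: MazurTate1991, Thm. 3.1].
-/

section Part5


set_option autoImplicit false

open scoped _root_.Classical
open _root_.PowerSeries _root_.WeierstrassCurve _root_.Literature.NumberTheory.EllipticCurves
open _root_.Literature.NumberTheory.EllipticCurves.PadicSigmaSqTwo.Universal

namespace Literature.NumberTheory.EllipticCurves.PadicSigmaSqTwo.MazurTate

/-- For a unit `b₆ ∈ ℤ₂`, `D(b₂, b₆) = b₆((1 + 4b₂)³ + 432b₆)` is a unit (the second factor is `≡ 1 (mod 2)`). [cite: BlakestadGrant2023, Thm. 15] -/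
theorem isUnit_D_of_isUnit (b₂ b₆ : ℤ_[2]) (hb₆ : IsUnit b₆) : IsUnit (b₆ * ((1 + 4 * b₂) ^ 3 + 432 * b₆)) := by
  haveI : IsAdicComplete (Ideal.span {(2 : ℤ_[2])}) ℤ_[2] := by
    have h := padicInt_isAdicComplete_span_p 2
    rwa [Nat.cast_ofNat] at h
  refine hb₆.mul (isUnit_of_sub_mem isUnit_one ?_)
  exact Ideal.mem_span_singleton'.mpr ⟨6 * b₂ + 24 * b₂ ^ 2 + 32 * b₂ ^ 3 + 216 * b₆, by ring⟩

/-- **The PRINT fact from an integral odd sigma solution of the universal chart curve** (Blakestad–Grant's Thm. 15 at `p = 2`, squared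
currency): see the module docstring. [cite: BlakestadGrant2023, Thm. 15] [cite: MazurTate1991, Thm. 3.1] -/
theorem mazurTate_sigmaSq_existsUnique_two_of_universal {σ : PowerSeries completeRingQ} {c : completeRingQ}
    (h0 : constantCoeff σ = 0) (h1 : coeff 1 σ = 1)
    (hodd : (universalCurve.map (algebraMap completeRing completeRingQ)).IsFormallyOdd σ)
    (hODE : (universalCurve.map (algebraMap completeRing completeRingQ)).SatisfiesSigmaODE σ c)
    (hint : ∀ n, coeff n (σ ^ 2) ∈ intSubring) :
    mazurTate_sigmaSq_existsUnique_two := by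
  refine mazurTate_sigmaSq_existsUnique_two_of_forall_chart fun b₂ b₆ hb₆ => ?_
  haveI : IsAdicComplete (Ideal.span {((2 : ℕ) : ℤ_[2])}) ℤ_[2] := padicInt_isAdicComplete_span_p 2
  have hD := isUnit_D_of_isUnit b₂ b₆ hb₆
  set ρ : completeRing →+* ℤ_[2] := specialize b₂ b₆ hD with hρdef
  have hρ : universalCurve.map ρ = ⟨1, b₂, 0, 0, b₆⟩ := universalCurve_map_specialize b₂ b₆ hD
  obtain ⟨ρK, hρK⟩ := exists_ringHom_completeRingQ_padic ρ
  have hcomp : ρK.comp (algebraMap completeRing completeRingQ) = (algebraMap ℤ_[2] ℚ_[2]).comp ρ :=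
    RingHom.ext fun x => by rw [RingHom.comp_apply, RingHom.comp_apply, hρK x]; rfl
  set V : WeierstrassCurve ℚ_[2] := (⟨1, b₂, 0, 0, b₆⟩ : WeierstrassCurve ℤ_[2]).baseChange ℚ_[2] with hV
  have hcurve : (universalCurve.map (algebraMap completeRing completeRingQ)).map ρK = V := by
    rw [map_map, hcomp, ← map_map, hρ, hV, WeierstrassCurve.baseChange]
  -- the specialised solution
  set σ' : ℚ_[2]⟦X⟧ := PowerSeries.map ρK σ with hσ'
  have h0' : constantCoeff σ' = 0 := by
    rw [hσ', ← coeff_zero_eq_constantCoeff_apply, coeff_map, coeff_zero_eq_constantCoeff_apply, h0, map_zero]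
  have h1' : coeff 1 σ' = 1 := by rw [hσ', coeff_map, h1, map_one]
  have hodd' : V.IsFormallyOdd σ' := by rw [← hcurve]; exact isFormallyOdd_map_ringHom ρK hodd
  have hODE' : V.SatisfiesSigmaODE σ' (ρK c) := by rw [← hcurve]; exact satisfiesSigmaODE_map_ringHom ρK h0 h1 hODE
  have hint' : ∀ n, ‖coeff n (σ' ^ 2)‖ ≤ 1 := fun n => by
    rw [hσ', ← map_pow, coeff_map]
    exact norm_le_one_of_mem_intSubring hρK (hint n)
  exact ⟨σ' ^ 2, ρK c, isMazurTateSigmaSqPair_sq_of_norm_coeff_sq_le h0' h1' hodd' hODE' hint'⟩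

end Literature.NumberTheory.EllipticCurves.PadicSigmaSqTwo.MazurTate

end Part5

/-!
## Part 6 — port of `Summits/BirchSwinnertonDyer/BirchSwinnertonDyer/Theorems/AlignedTransportAtTwoBSDOfMainConjectureRankOneAtTwoSigmaSqTwoConstantFixedPoint.lean`

# The Mazur–Tate constant at `2` as a CONTRACTION FIXED POINT: `c = 2·α(c) + d` in a `2`-adically complete ring
# (step S5′ of the discharge plan for the PRINT stub `stub_sigmaSqTwo`, replacing Blakestad–Grant's Thm. 2 / Lemma 4 at `p = 2`)

Cell `bsd-f1-sign2`, WIDTH-5 attach seat `bsd-line-att-p3` g8 (`--supports stmt-BirchSwinnertonDyer-23008`; plan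
`Cruxes/BSDOfMainConjectureRankOneAtTwo/SIGMASQ-AT-TWO-att-p3.md`, S5′/§7). THEOREMS ONLY; route-independent. BSD is not proved by any of this.

WHY. The squared functional equation along the Vélu `2`-isogeny (`…SigmaSqTwoVeluFE.lean`, `velu_two_X_sq_mul_sq_subst_eq`) holds for the
odd normalised sigma solutions with constants `c` (of `E`) and `c″` (of the Frobenius model `E″ = vc • (E/⟨Q⟩)`, `vc = [2; r, ½, −r/2]`) EXACTLY
when `−r + 4c″ − 2c − e = 0`. In the universal setting (`E` = the `a₁`-chart over `R̂₂`, `E″ = E^α` for the Frobenius-type specialisation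
`α : R̂₂ → R̂₂`) Dwork's lemma needs `c″ = α(c)`; so the constant is pinned by `4α(c) − 2c = r + e`, i.e. — with `ρ := (r + e)/2 ∈ R̂₂`
(recon: `v₂(r + e) ≥ 3`) — by the fixed-point equation **`c = 2α(c) − ρ`**, whose right-hand side is a `2`-ADIC CONTRACTION. Hence `c` exists and
is unique in ANY `2`-adically complete ring, for ANY ring endomorphism `α` — no `p = 2` analogue of Blakestad–Grant's Thm. 2 (exactness of
`(x − β)ω`, odd levels `2B + 3`) is needed to pin the constant.

* `sub_iterate_mem_span_two_pow` — the iterates `cₙ = (c ↦ 2α(c) + d)ⁿ(0)` satisfy `cₙ₊₁ − cₙ ∈ (2ⁿ)`;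
* `exists_eq_two_mul_map_add` / `eq_two_mul_map_add_unique` / `existsUnique_eq_two_mul_map_add` — **`∃! c, c = 2α(c) + d`**;
* `exists_four_mul_map_sub_two_mul_eq` — the form used by the functional equation: `∃ c, 4α(c) − 2c = 2ρ`.

## Sources
Banach/Hensel contraction in an adically complete ring [folklore]; the role of the constant: B. Mazur, J. Tate, *The `p`-adic sigma function*,
Duke Math. J. 62 (1991) §3; C. Blakestad, D. Grant, J. Number Theory 249 (2023) Thm. 2 (the constant `β = −c`). [cite: BlakestadGrant2023, Thm. 2]
-/

section Part6


set_option autoImplicit false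

open _root_.Literature.NumberTheory.EllipticCurves

namespace Literature.NumberTheory.EllipticCurves.PadicSigmaSqTwo.MazurTate

section FixedPoint

variable {A : Type*} [CommRing A] (α : A →+* A) (d : A)

/-- A ring endomorphism maps `(2ⁿ)` into itself. [folklore] -/
private theorem map_mem_span_two_pow {x : A} {n : ℕ} (hx : x ∈ Ideal.span {(2 : A) ^ n}) : α x ∈ Ideal.span {(2 : A) ^ n} := by
  obtain ⟨g, hg⟩ := Ideal.mem_span_singleton'.mp hx
  rw [← hg, map_mul, map_pow, map_ofNat]
  exact Ideal.mem_span_singleton'.mpr ⟨α g, rfl⟩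

/-- The iterates `cₙ = (c ↦ 2α(c) + d)ⁿ(0)` of the contraction satisfy `cₙ₊₁ − cₙ ∈ (2ⁿ)`. [folklore] -/
private theorem sub_iterate_mem_span_two_pow (n : ℕ) :
    (fun c => 2 * α c + d)^[n + 1] 0 - (fun c => 2 * α c + d)^[n] 0 ∈ Ideal.span {(2 : A) ^ n} := by
  induction n with
  | zero => rw [pow_zero, Ideal.span_singleton_one]; exact Submodule.mem_top
  | succ n ih =>
    have e : (fun c => 2 * α c + d)^[n + 1 + 1] 0 - (fun c => 2 * α c + d)^[n + 1] 0 =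
        2 * α ((fun c => 2 * α c + d)^[n + 1] 0 - (fun c => 2 * α c + d)^[n] 0) := by
      simp only [Function.iterate_succ_apply', map_sub, map_add, map_mul, map_ofNat]; ring
    rw [e]
    obtain ⟨g, hg⟩ := Ideal.mem_span_singleton'.mp (map_mem_span_two_pow α ih)
    rw [← hg, pow_succ]
    exact Ideal.mem_span_singleton'.mpr ⟨g, by ring⟩

/-- `cₘ − cₙ ∈ (2ⁿ)` for `n ≤ m`. [folklore] -/
private theorem sub_iterate_mem_span_two_pow_of_le {n m : ℕ} (h : n ≤ m) :
    (fun c => 2 * α c + d)^[m] 0 - (fun c => 2 * α c + d)^[n] 0 ∈ Ideal.span {(2 : A) ^ n} := by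
  induction m, h using Nat.le_induction with
  | base => rw [sub_self]; exact Ideal.zero_mem _
  | succ m hnm ih =>
    have hle : Ideal.span {(2 : A) ^ m} ≤ Ideal.span {(2 : A) ^ n} := by
      rw [Ideal.span_singleton_le_span_singleton]; exact pow_dvd_pow _ hnm
    have := Ideal.add_mem _ (hle (sub_iterate_mem_span_two_pow α d m)) ih
    rwa [sub_add_sub_cancel] at this

variable [IsAdicComplete (Ideal.span {(2 : A)}) A]

/-- **Existence of the fixed point** `c = 2α(c) + d` in a `2`-adically complete ring (`c = Σ 2ⁱ·αⁱ-twisted terms = lim cₙ`). [folklore] -/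
private theorem exists_eq_two_mul_map_add : ∃ c : A, c = 2 * α c + d := by
  set f : ℕ → A := fun n => (fun c => 2 * α c + d)^[n] 0 with hf
  obtain ⟨L, hL⟩ : ∃ L : A, ∀ n, f n - L ∈ Ideal.span {(2 : A) ^ n} := by
    obtain ⟨L, hL⟩ := IsPrecomplete.prec' (I := Ideal.span {(2 : A)}) (M := A) f
      (fun {m n} hmn => by
        rw [Ideal.span_singleton_pow, smodEq_smul_top_iff_sub_mem]
        have h := (Ideal.span {(2 : A) ^ m}).neg_mem (sub_iterate_mem_span_two_pow_of_le α d hmn)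
        rwa [neg_sub] at h)
    refine ⟨L, fun n => ?_⟩
    have h := hL n
    rwa [Ideal.span_singleton_pow, smodEq_smul_top_iff_sub_mem] at h
  refine ⟨L, ?_⟩
  rw [← sub_eq_zero]
  refine IsHausdorff.haus' (I := Ideal.span {(2 : A)}) _ fun n => ?_
  rw [Ideal.span_singleton_pow, smodEq_smul_top_iff_sub_mem, sub_zero]
  have hstep : f (n + 1) = 2 * α (f n) + d := by
    rw [hf]; exact Function.iterate_succ_apply' (f := fun c => 2 * α c + d) n 0
  have e : L - (2 * α L + d) = (L - f (n + 1)) + 2 * α (f n - L) := by rw [hstep, map_sub]; ring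
  rw [e]
  refine Ideal.add_mem _ ?_ ?_
  · have h := (Ideal.span {(2 : A) ^ (n + 1)}).neg_mem (hL (n + 1))
    rw [neg_sub] at h
    have hle : Ideal.span {(2 : A) ^ (n + 1)} ≤ Ideal.span {(2 : A) ^ n} := by
      rw [Ideal.span_singleton_le_span_singleton]; exact pow_dvd_pow _ (Nat.le_succ n)
    exact hle h
  · exact Ideal.mul_mem_left _ _ (map_mem_span_two_pow α (hL n))

omit [IsAdicComplete (Ideal.span {(2 : A)}) A] in
/-- **Uniqueness of the fixed point** in a `2`-adically separated ring. [folklore] -/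
private theorem eq_two_mul_map_add_unique [IsHausdorff (Ideal.span {(2 : A)}) A] {c c' : A} (hc : c = 2 * α c + d)
    (hc' : c' = 2 * α c' + d) : c = c' := by
  have hrel : c - c' = 2 * α (c - c') := by rw [map_sub]; linear_combination hc - hc'
  have hmem : ∀ n : ℕ, c - c' ∈ Ideal.span {(2 : A) ^ n} := by
    intro n
    induction n with
    | zero => rw [pow_zero, Ideal.span_singleton_one]; exact Submodule.mem_top
    | succ n ih =>
      obtain ⟨g, hg⟩ := Ideal.mem_span_singleton'.mp (map_mem_span_two_pow α ih)
      rw [hrel, ← hg, pow_succ]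
      exact Ideal.mem_span_singleton'.mpr ⟨g, by ring⟩
  rw [← sub_eq_zero]
  refine IsHausdorff.haus' (I := Ideal.span {(2 : A)}) _ fun n => ?_
  rw [Ideal.span_singleton_pow, smodEq_smul_top_iff_sub_mem, sub_zero]
  exact hmem n

/-- **`∃! c, c = 2α(c) + d`** in a `2`-adically complete ring, for any ring endomorphism `α` and any `d`. [folklore] -/
private theorem existsUnique_eq_two_mul_map_add : ∃! c : A, c = 2 * α c + d := by
  obtain ⟨c, hc⟩ := exists_eq_two_mul_map_add α d
  exact ⟨c, hc, fun c' hc' => eq_two_mul_map_add_unique α d hc' hc⟩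

/-- **The constants relation of the squared functional equation is solvable**: for every `ρ` there is `c` with `4α(c) − 2c = 2ρ`
(take the fixed point of `c ↦ 2α(c) − ρ`); with `2ρ = r + e` this is `−r + 4α(c) − 2c − e = 0`, hypothesis `hκ` of
`velu_two_X_sq_mul_sq_subst_eq` with `c″ = α(c)`. [cite: BlakestadGrant2023, Thm. 2] -/
theorem exists_four_mul_map_sub_two_mul_eq (ρ : A) : ∃ c : A, 4 * α c - 2 * c = 2 * ρ := by
  obtain ⟨c, hc⟩ := exists_eq_two_mul_map_add α (-ρ)
  exact ⟨c, by linear_combination (-2 : A) * hc⟩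

end FixedPoint

/-! ## The affine contraction `c ↦ 2m·α(c) + d` (any multiplier `m`): the form needed when the Frobenius model has `u = 2μ`, `μ` a unit
(`hκ : −r + 4μ²α(c) − 2c − e = 0` ⟺ `c = 2μ²·α(c) − (r + e)/2`; plan §8 (S3.3)) -/

section FixedPointMul

variable {A : Type*} [CommRing A] (α : A →+* A) (κ d : A)

/-- The iterates of `c ↦ 2κ·α(c) + d` satisfy `cₙ₊₁ − cₙ ∈ (2ⁿ)`. [folklore] -/
private theorem sub_iterate_mul_mem_span_two_pow (n : ℕ) :
    (fun c => 2 * κ * α c + d)^[n + 1] 0 - (fun c => 2 * κ * α c + d)^[n] 0 ∈ Ideal.span {(2 : A) ^ n} := by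
  induction n with
  | zero => rw [pow_zero, Ideal.span_singleton_one]; exact Submodule.mem_top
  | succ n ih =>
    have e : (fun c => 2 * κ * α c + d)^[n + 1 + 1] 0 - (fun c => 2 * κ * α c + d)^[n + 1] 0 =
        2 * κ * α ((fun c => 2 * κ * α c + d)^[n + 1] 0 - (fun c => 2 * κ * α c + d)^[n] 0) := by
      simp only [Function.iterate_succ_apply', map_sub, map_add, map_mul, map_ofNat]; ring
    rw [e]
    obtain ⟨g, hg⟩ := Ideal.mem_span_singleton'.mp (map_mem_span_two_pow α ih)
    rw [← hg, pow_succ]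
    exact Ideal.mem_span_singleton'.mpr ⟨κ * g, by ring⟩

/-- `cₘ − cₙ ∈ (2ⁿ)` for `n ≤ m`. [folklore] -/
private theorem sub_iterate_mul_mem_span_two_pow_of_le {n k : ℕ} (h : n ≤ k) :
    (fun c => 2 * κ * α c + d)^[k] 0 - (fun c => 2 * κ * α c + d)^[n] 0 ∈ Ideal.span {(2 : A) ^ n} := by
  induction k, h using Nat.le_induction with
  | base => rw [sub_self]; exact Ideal.zero_mem _
  | succ k hnk ih =>
    have hle : Ideal.span {(2 : A) ^ k} ≤ Ideal.span {(2 : A) ^ n} := by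
      rw [Ideal.span_singleton_le_span_singleton]; exact pow_dvd_pow _ hnk
    have := Ideal.add_mem _ (hle (sub_iterate_mul_mem_span_two_pow α κ d k)) ih
    rwa [sub_add_sub_cancel] at this

variable [IsAdicComplete (Ideal.span {(2 : A)}) A]

/-- **Existence of the fixed point `c = 2κ·α(c) + d`** in a `2`-adically complete ring, any `κ`. [folklore] -/
private theorem exists_eq_two_mul_mul_map_add : ∃ c : A, c = 2 * κ * α c + d := by
  set f : ℕ → A := fun n => (fun c => 2 * κ * α c + d)^[n] 0 with hf
  obtain ⟨L, hL⟩ : ∃ L : A, ∀ n, f n - L ∈ Ideal.span {(2 : A) ^ n} := by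
    obtain ⟨L, hL⟩ := IsPrecomplete.prec' (I := Ideal.span {(2 : A)}) (M := A) f
      (fun {m n} hmn => by
        rw [Ideal.span_singleton_pow, smodEq_smul_top_iff_sub_mem]
        have h := (Ideal.span {(2 : A) ^ m}).neg_mem (sub_iterate_mul_mem_span_two_pow_of_le α κ d hmn)
        rwa [neg_sub] at h)
    refine ⟨L, fun n => ?_⟩
    have h := hL n
    rwa [Ideal.span_singleton_pow, smodEq_smul_top_iff_sub_mem] at h
  refine ⟨L, ?_⟩
  rw [← sub_eq_zero]
  refine IsHausdorff.haus' (I := Ideal.span {(2 : A)}) _ fun n => ?_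
  rw [Ideal.span_singleton_pow, smodEq_smul_top_iff_sub_mem, sub_zero]
  have hstep : f (n + 1) = 2 * κ * α (f n) + d := by
    rw [hf]; exact Function.iterate_succ_apply' (f := fun c => 2 * κ * α c + d) n 0
  have e : L - (2 * κ * α L + d) = (L - f (n + 1)) + 2 * κ * α (f n - L) := by rw [hstep, map_sub]; ring
  rw [e]
  refine Ideal.add_mem _ ?_ ?_
  · have h := (Ideal.span {(2 : A) ^ (n + 1)}).neg_mem (hL (n + 1))
    rw [neg_sub] at h
    have hle : Ideal.span {(2 : A) ^ (n + 1)} ≤ Ideal.span {(2 : A) ^ n} := by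
      rw [Ideal.span_singleton_le_span_singleton]; exact pow_dvd_pow _ (Nat.le_succ n)
    exact hle h
  · exact Ideal.mul_mem_left _ _ (map_mem_span_two_pow α (hL n))

omit [IsAdicComplete (Ideal.span {(2 : A)}) A] in
/-- **Uniqueness of the fixed point `c = 2κ·α(c) + d`** in a `2`-adically separated ring. [folklore] -/
private theorem eq_two_mul_mul_map_add_unique [IsHausdorff (Ideal.span {(2 : A)}) A] {c c' : A} (hc : c = 2 * κ * α c + d)
    (hc' : c' = 2 * κ * α c' + d) : c = c' := by
  have hrel : c - c' = 2 * κ * α (c - c') := by rw [map_sub]; linear_combination hc - hc'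
  have hmem : ∀ n : ℕ, c - c' ∈ Ideal.span {(2 : A) ^ n} := by
    intro n
    induction n with
    | zero => rw [pow_zero, Ideal.span_singleton_one]; exact Submodule.mem_top
    | succ n ih =>
      obtain ⟨g, hg⟩ := Ideal.mem_span_singleton'.mp (map_mem_span_two_pow α ih)
      rw [hrel, ← hg, pow_succ]
      exact Ideal.mem_span_singleton'.mpr ⟨κ * g, by ring⟩
  rw [← sub_eq_zero]
  refine IsHausdorff.haus' (I := Ideal.span {(2 : A)}) _ fun n => ?_
  rw [Ideal.span_singleton_pow, smodEq_smul_top_iff_sub_mem, sub_zero]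
  exact hmem n

/-- **`∃! c, c = 2m·α(c) + d`**. [folklore] -/
private theorem existsUnique_eq_two_mul_mul_map_add : ∃! c : A, c = 2 * κ * α c + d := by
  obtain ⟨c, hc⟩ := exists_eq_two_mul_mul_map_add α κ d
  exact ⟨c, hc, fun c' hc' => eq_two_mul_mul_map_add_unique α κ d hc' hc⟩

/-- **The constants relation for the Frobenius model with `u = 2μ`**: for every unit-or-not `μ` and every `ρ` there is `c` with
`4μ²·α(c) − 2c = 2ρ`, i.e. `−r + (2μ)²·α(c) − 2c − e = 0` with `2ρ = r + e` (hypothesis `hκ` of `velu_two_X_sq_mul_sq_subst_eq_domain` with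
`vc.u = 2μ`, `c'' = α(c)`). [cite: BlakestadGrant2023, Thm. 2] -/
theorem exists_four_mul_sq_mul_map_sub_two_mul_eq (μ ρ : A) : ∃ c : A, 4 * μ ^ 2 * α c - 2 * c = 2 * ρ := by
  obtain ⟨c, hc⟩ := exists_eq_two_mul_mul_map_add α (μ ^ 2) (-ρ)
  exact ⟨c, by linear_combination (-2 : A) * hc⟩

end FixedPointMul

end Literature.NumberTheory.EllipticCurves.PadicSigmaSqTwo.MazurTate

end Part6

/-!
## Part 7 — port of `Summits/BirchSwinnertonDyer/BirchSwinnertonDyer/Theorems/AlignedTransportAtTwoBSDOfMainConjectureRankOneAtTwoSigmaSqTwoDomainFE.lean`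

# The squared `2`-isogeny functional equation over a `ℚ`-ALGEBRA DOMAIN (e.g. `K₂ = R̂₂[1/2]`), by passage to the fraction field
# (step S6 glue of the discharge plan for the PRINT stub `stub_sigmaSqTwo`)

Cell `bsd-f1-sign2`, WIDTH-5 attach seat `bsd-line-att-p3` g8 (`--supports stmt-BirchSwinnertonDyer-23008`; plan
`Cruxes/BSDOfMainConjectureRankOneAtTwo/SIGMASQ-AT-TWO-att-p3.md`, §7/S6). THEOREMS ONLY; route-independent. BSD is not proved by any of this.

The field-general functional equation (`….SigmaSqTwo.Field.X_sq_mul_sq_subst_eq_of_twoIsogeny`, `…FieldIsogenyFE.lean`; its proof divides by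
series with non-zero constant term and uses rigidity, hence wants a field) is transported to any `ℚ`-algebra DOMAIN `K`: map every datum along
`ι : K → Frac(K)` (`isFormallyOdd_map_ringHom`, `satisfiesSigmaODE_map_ringHom` of `…ODEFamily.lean`; `map_formalLog`, `map_formalXMulSq`,
`powerSeries_map_subst`), apply the field version in `Frac(K)⟦z⟧`, and pull the identity back along the injection `K⟦z⟧ → Frac(K)⟦z⟧`. The universal
Dwork step runs over `K₂ = completeRingQ` (`Literature…PadicSigmaSqTwo.Universal.isDomain_completeRingQ`), where this is the form needed.

* `X_sq_mul_sq_subst_eq_of_twoIsogeny_domain` — two curves `V, V'` over a `ℚ`-algebra domain, `log_{V'}(T) = π log_V`, …, `r₀ + π²c' − 2c − e = 0`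
  ⟹ `z²·σ'(T)² = π²σ⁴(X − ez²)`;
* `velu_two_X_sq_mul_sq_subst_eq_domain` — Vélu's quotient by a `2`-torsion point and ANY model `vc • V'`, all geometric inputs discharged
  (`velu_two_formalLog_transport`, `velu_two_x_transport` are already ring-general), remaining hypothesis `−r + u²c'' − 2c − e = 0`;
* `velu_two_sq_subst_mul_X_sq_eq_domain` — the same in sigma-squared currency.

## Sources
B. Perrin-Riou, Mém. SMF 17 (1984) Ch. III §1.2 Lemme 3 (ii) [cite: Perrinriou1984, Ch. III §1.2 Lemme 3 (ii)]; C. Blakestad, D. Grant,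
J. Number Theory 249 (2023) Prop. 13 [cite: BlakestadGrant2023, Prop. 13]; J. H. Silverman, Math. Ann. 332 (2005) §5 Rem. 2
[cite: Silverman2005DivPoly, §5 Rem. 2].
-/

section Part7


set_option autoImplicit false

open scoped _root_.Classical
open _root_.PowerSeries _root_.WeierstrassCurve _root_.Literature.NumberTheory.EllipticCurves _root_.Literature.RingTheory.FormalGroups

namespace Literature.NumberTheory.EllipticCurves.PadicSigmaSqTwo.MazurTate

section Domain

variable {K : Type*} [CommRing K] [Algebra ℚ K] [IsDomain K] (V V' : WeierstrassCurve K)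

/-- **The squared `2`-isogeny functional equation (two curves) over a `ℚ`-algebra domain**: hypotheses and conclusion as in
`Field.X_sq_mul_sq_subst_eq_of_twoIsogeny`, base ring any `ℚ`-algebra domain (proof: base change to the fraction field and back).
[cite: Perrinriou1984, Ch. III §1.2 Lemme 3 (ii)] [cite: BlakestadGrant2023, Prop. 13] -/
theorem X_sq_mul_sq_subst_eq_of_twoIsogeny_domain {σ σ' T : K⟦X⟧} {c c' π e t r₀ : K}
    (hσ0 : constantCoeff σ = 0) (hσ1 : coeff 1 σ = 1) (hodd : V.IsFormallyOdd σ) (hODE : V.SatisfiesSigmaODE σ c)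
    (hσ0' : constantCoeff σ' = 0) (hσ1' : coeff 1 σ' = 1) (hodd' : V'.IsFormallyOdd σ')
    (hODE' : V'.SatisfiesSigmaODE σ' c') (hT0 : constantCoeff T = 0)
    (hlog : V'.formalLog.subst T = C π * V.formalLog) (hπ : π ≠ 0)
    (he : 4 * e ^ 3 + V.b₂ * e ^ 2 + 2 * V.b₄ * e + V.b₆ = 0) (ht : 2 * t = 6 * e ^ 2 + V.b₂ * e + V.b₄)
    (hx : C π ^ 2 * V'.formalXMulSq.subst T * (X ^ 2 * (V.formalXMulSq - C e * X ^ 2)) =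
      T ^ 2 * (V.formalXMulSq * (V.formalXMulSq - C e * X ^ 2) + C t * X ^ 4 +
        C r₀ * X ^ 2 * (V.formalXMulSq - C e * X ^ 2)))
    (hκ : r₀ + π ^ 2 * c' - 2 * c - e = 0) :
    X ^ 2 * σ'.subst T ^ 2 = C π ^ 2 * σ ^ 4 * (V.formalXMulSq - C e * X ^ 2) := by
  let L := FractionRing K
  let ι : K →+* L := algebraMap K L
  have hι : Function.Injective ι := IsFractionRing.injective K L
  haveI : CharZero K := algebraRat.charZero K
  haveI : CharZero L := charZero_of_injective_algebraMap hι
  have hs : HasSubst T := HasSubst.of_constantCoeff_zero' hT0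
  have hm0 : ∀ {g : K⟦X⟧}, constantCoeff g = 0 → constantCoeff (PowerSeries.map ι g) = 0 := fun {g} hg => by
    rw [← coeff_zero_eq_constantCoeff_apply, coeff_map, coeff_zero_eq_constantCoeff_apply, hg, map_zero]
  have hm1 : ∀ {g : K⟦X⟧}, coeff 1 g = 1 → coeff 1 (PowerSeries.map ι g) = 1 := fun {g} hg => by
    rw [coeff_map, hg, map_one]
  have hlog' : (V'.map ι).formalLog.subst (PowerSeries.map ι T) = C (ι π) * (V.map ι).formalLog := by
    have h := congrArg (PowerSeries.map ι) hlog
    rwa [Literature.NumberTheory.EllipticCurves.powerSeries_map_subst hs ι, map_formalLog, map_mul, map_C,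
      map_formalLog] at h
  have hπ' : ι π ≠ 0 := (map_ne_zero_iff ι hι).mpr hπ
  have he' : 4 * ι e ^ 3 + (V.map ι).b₂ * ι e ^ 2 + 2 * (V.map ι).b₄ * ι e + (V.map ι).b₆ = 0 := by
    have h := congrArg ι he
    simp only [map_add, map_mul, map_pow, map_ofNat, map_zero] at h
    simpa only [map_b₂, map_b₄, map_b₆] using h
  have ht' : 2 * ι t = 6 * ι e ^ 2 + (V.map ι).b₂ * ι e + (V.map ι).b₄ := by
    have h := congrArg ι ht
    simp only [map_add, map_mul, map_pow, map_ofNat] at h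
    simpa only [map_b₂, map_b₄] using h
  have hx' : C (ι π) ^ 2 * (V'.map ι).formalXMulSq.subst (PowerSeries.map ι T) *
      (X ^ 2 * ((V.map ι).formalXMulSq - C (ι e) * X ^ 2)) =
      PowerSeries.map ι T ^ 2 * ((V.map ι).formalXMulSq * ((V.map ι).formalXMulSq - C (ι e) * X ^ 2) + C (ι t) * X ^ 4 +
        C (ι r₀) * X ^ 2 * ((V.map ι).formalXMulSq - C (ι e) * X ^ 2)) := by
    have h := congrArg (PowerSeries.map ι) hx
    simp only [map_mul, map_pow, map_sub, map_add, map_C, map_X, map_formalXMulSq,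
      Literature.NumberTheory.EllipticCurves.powerSeries_map_subst hs ι] at h
    exact h
  have hκ' : ι r₀ + ι π ^ 2 * ι c' - 2 * ι c - ι e = 0 := by
    have h := congrArg ι hκ
    simp only [map_add, map_sub, map_mul, map_pow, map_ofNat, map_zero] at h
    exact h
  have key := Field.X_sq_mul_sq_subst_eq_of_twoIsogeny (V.map ι) (V'.map ι) (hm0 hσ0) (hm1 hσ1)
    (isFormallyOdd_map_ringHom ι hodd) (satisfiesSigmaODE_map_ringHom ι hσ0 hσ1 hODE) (hm0 hσ0') (hm1 hσ1')
    (isFormallyOdd_map_ringHom ι hodd') (satisfiesSigmaODE_map_ringHom ι hσ0' hσ1' hODE') (hm0 hT0) hlog' hπ' he' ht' hx' hκ'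
  apply PowerSeries.map_injective ι hι
  simp only [map_mul, map_pow, map_sub, map_C, map_X, map_formalXMulSq,
    Literature.NumberTheory.EllipticCurves.powerSeries_map_subst hs ι]
  exact key

/-- **The squared `2`-isogeny functional equation for Vélu's quotient over a `ℚ`-algebra domain**, geometric inputs discharged:
hypotheses and conclusion as in `velu_two_X_sq_mul_sq_subst_eq` (`ℚ_p`) / `Field.velu_two_X_sq_mul_sq_subst_eq`, base ring any
`ℚ`-algebra domain. [cite: BlakestadGrant2023, Prop. 13] [cite: Silverman2005DivPoly, §5 Rem. 2] -/
theorem velu_two_X_sq_mul_sq_subst_eq_domain {e f t : K}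
    (hQ : f ^ 2 + V.a₁ * e * f + V.a₃ * f = e ^ 3 + V.a₂ * e ^ 2 + V.a₄ * e + V.a₆)
    (h2 : 2 * f + V.a₁ * e + V.a₃ = 0) (ht : t = 3 * e ^ 2 + 2 * V.a₂ * e + V.a₄ - V.a₁ * f)
    {A M Dn u τ P : K⟦X⟧} (hA : A = V.formalXMulSq - C e * X ^ 2) (hM : M = V.formalXMulSq * A + C t * X ^ 4)
    (hDn : Dn = V.formalXMulSq * A ^ 2 + C t * X ^ 4 * (C V.a₁ * X * A - V.formalXMulSq - C f * X ^ 3))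
    (hu : Dn * u = 1) (hτ : τ = X * A * M * u) (hP : P = A * M ^ 3 * u ^ 2)
    (V' : WeierstrassCurve K) (h1' : V'.a₁ = V.a₁) (h2' : V'.a₂ = V.a₂) (h3' : V'.a₃ = V.a₃)
    (h4' : V'.a₄ = V.a₄ - 5 * t) (h6' : V'.a₆ = V.a₆ - V.b₂ * t - 7 * e * t)
    (vc : VariableChange K) {T : K⟦X⟧} (hT : T = (V'.formalVariableChange vc).subst τ)
    {σ σ'' : K⟦X⟧} {c c'' : K}
    (hσ0 : constantCoeff σ = 0) (hσ1 : coeff 1 σ = 1) (hodd : V.IsFormallyOdd σ) (hODE : V.SatisfiesSigmaODE σ c)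
    (hσ0'' : constantCoeff σ'' = 0) (hσ1'' : coeff 1 σ'' = 1) (hodd'' : (vc • V').IsFormallyOdd σ'')
    (hODE'' : (vc • V').SatisfiesSigmaODE σ'' c'')
    (hκ : -vc.r + (vc.u : K) ^ 2 * c'' - 2 * c - e = 0) :
    X ^ 2 * σ''.subst T ^ 2 = C (vc.u : K) ^ 2 * σ ^ 4 * (V.formalXMulSq - C e * X ^ 2) := by
  haveI : CharZero K := algebraRat.charZero K
  have he := twoTorsionPolynomial_eq_zero_of_point V hQ h2
  have ht2 := two_mul_velu_t V h2 ht
  have hlog := velu_two_formalLog_transport V hQ h2 ht hA hM hDn hu hτ hP V' h1' h2' h3' h4' h6' vc hT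
  have hx := velu_two_x_transport V hQ h2 ht hA hM hDn hu hτ V' h1' h2' h3' h4' h6' vc hT
  have hT0 : constantCoeff T = 0 := by
    have hτ0 : constantCoeff τ = 0 := by
      rw [hτ, map_mul, map_mul, map_mul, constantCoeff_X]; ring
    rw [hT, Literature.RingTheory.FormalGroups.constantCoeff_subst_of_constantCoeff_eq_zero hτ0,
      constantCoeff_formalVariableChange]
  have hπ : (vc.u : K) ≠ 0 := vc.u.ne_zero
  exact X_sq_mul_sq_subst_eq_of_twoIsogeny_domain V (vc • V') hσ0 hσ1 hodd hODE hσ0'' hσ1'' hodd'' hODE'' hT0 hlog hπ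
    he ht2 hx hκ

/-- Sigma-squared currency over a `ℚ`-algebra domain: `Σ''(T)·z² = u²·Σ²·(X − ez²)`. [cite: Silverman2005DivPoly, §5 Rem. 2] -/
theorem velu_two_sq_subst_mul_X_sq_eq_domain {e f t : K}
    (hQ : f ^ 2 + V.a₁ * e * f + V.a₃ * f = e ^ 3 + V.a₂ * e ^ 2 + V.a₄ * e + V.a₆)
    (h2 : 2 * f + V.a₁ * e + V.a₃ = 0) (ht : t = 3 * e ^ 2 + 2 * V.a₂ * e + V.a₄ - V.a₁ * f)
    {A M Dn u τ P : K⟦X⟧} (hA : A = V.formalXMulSq - C e * X ^ 2) (hM : M = V.formalXMulSq * A + C t * X ^ 4)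
    (hDn : Dn = V.formalXMulSq * A ^ 2 + C t * X ^ 4 * (C V.a₁ * X * A - V.formalXMulSq - C f * X ^ 3))
    (hu : Dn * u = 1) (hτ : τ = X * A * M * u) (hP : P = A * M ^ 3 * u ^ 2)
    (V' : WeierstrassCurve K) (h1' : V'.a₁ = V.a₁) (h2' : V'.a₂ = V.a₂) (h3' : V'.a₃ = V.a₃)
    (h4' : V'.a₄ = V.a₄ - 5 * t) (h6' : V'.a₆ = V.a₆ - V.b₂ * t - 7 * e * t)
    (vc : VariableChange K) {T : K⟦X⟧} (hT : T = (V'.formalVariableChange vc).subst τ)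
    {σ σ'' : K⟦X⟧} {c c'' : K}
    (hσ0 : constantCoeff σ = 0) (hσ1 : coeff 1 σ = 1) (hodd : V.IsFormallyOdd σ) (hODE : V.SatisfiesSigmaODE σ c)
    (hσ0'' : constantCoeff σ'' = 0) (hσ1'' : coeff 1 σ'' = 1) (hodd'' : (vc • V').IsFormallyOdd σ'')
    (hODE'' : (vc • V').SatisfiesSigmaODE σ'' c'')
    (hκ : -vc.r + (vc.u : K) ^ 2 * c'' - 2 * c - e = 0) :
    (σ'' ^ 2).subst T * X ^ 2 = C (vc.u : K) ^ 2 * (σ ^ 2) ^ 2 * (V.formalXMulSq - C e * X ^ 2) := by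
  have h := velu_two_X_sq_mul_sq_subst_eq_domain V hQ h2 ht hA hM hDn hu hτ hP V' h1' h2' h3' h4' h6' vc hT hσ0 hσ1 hodd
    hODE hσ0'' hσ1'' hodd'' hODE'' hκ
  have hT0 : constantCoeff T = 0 := by
    have hτ0 : constantCoeff τ = 0 := by
      rw [hτ, map_mul, map_mul, map_mul, constantCoeff_X]; ring
    rw [hT, Literature.RingTheory.FormalGroups.constantCoeff_subst_of_constantCoeff_eq_zero hτ0,
      constantCoeff_formalVariableChange]
  rw [subst_pow (HasSubst.of_constantCoeff_zero' hT0)]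
  linear_combination h

end Domain

end Literature.NumberTheory.EllipticCurves.PadicSigmaSqTwo.MazurTate

end Part7

/-!
## Part 8 — port of `Summits/BirchSwinnertonDyer/BirchSwinnertonDyer/Theorems/AlignedTransportAtTwoBSDOfMainConjectureRankOneAtTwoSigmaSqTwoFrobeniusModel.lean`

# The Frobenius model of the universal ordinary `a₁`-chart at `p = 2`, III: the isogeny parameter `T = θ_vc(τ)` satisfies
# `T·𝔇 = (1 + 2B₂)·z(2 − z)·Xs·𝒰`, the model is the chart curve `⟨1, b₂′, 0, 0, b₆′⟩`, and Dwork's `V = 𝔇²/(𝒬𝒰²)`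
# (step S3 of the discharge plan for the PRINT stub `stub_sigmaSqTwo` of crux C3′; route-independent, any `ℚ`-algebra domain)

Cell `bsd-f1-sign2`, WIDTH-5 attach seat `bsd-line-att-p3` g9 (`--supports stmt-BirchSwinnertonDyer-23008`; plan
`Cruxes/BSDOfMainConjectureRankOneAtTwo/SIGMASQ-AT-TWO-att-p3.md` §8 (S3.2)–(S3.5)). THEOREMS ONLY, over a `ℚ`-algebra domain `K` (applied to
`K₂ = R̂₂[1/2]` in `…SigmaSqTwoExistence.lean`). BSD is not proved by any of this.

Data (hypothesis-definitions): the chart curve `V = ⟨1, B₂, 0, 0, g₂X₀²⟩`, `X₀ = −1 − 4B₂ − 64g₂` (so `Q = (e, f) = (X₀/4, −X₀/8) ∈ V[2]`),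
Vélu's data `t = t₁₆/16`, `A = Xs − ez²`, `M`, `Dn`, `u_D = Dn⁻¹`, `τ = zAM·u_D` (`…SigmaSqTwoVeluFormal.lean`), Vélu's curve `V′`, and the
FROBENIUS MODEL `vc • V′`, `vc = [u = 2u₂; r = R₁/4, s = u₂ − ½, t = −r/2]`, `u₂ = 1 + 2B₂`, `R₁ = −X₀ + 32δ` (`½ = i₂`). Results:
* `frobModel_T_mul_E1` — `T·(Dn + s·zAM + (t − sr)z³A²) = u·zA(M − r z²A)` for `T = θ_vc(τ)` (from `θ·den = u(z − r w)`, `X′(τ)w′(τ) = τ³`,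
  `X′(τ) = AM³u_D²`);
* **`frobModel_T_mul_calD` — `T·𝔇 = (1 + 2B₂)·z·(2 − z)·Xs·𝒰`** (via `ℳ − R₁z²𝒜 = 16𝒰`, `ℰ₀ = 64𝔇₁`, `𝒬𝔇₁ = (2 − z)Xs𝔇`, `𝒜𝒬 = (2 − z)²Xs²`
  of `…FrobeniusSeries.lean`): since `𝔇(0) = 1` this exhibits `T` as a series with coefficients in any subring containing the data, and
  `T ≡ z² (mod 2)` there (`frob_coeff_N2_sub_mem`);
* `frobModel_constantCoeff_T`, `frobModel_coeff_one_T` (`T = 2u₂z + ⋯`);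
* **`frobModel_curve` — `vc • V′ = ⟨1, b₂′, 0, 0, b₆′⟩`, `b₂′ = a2num·q⁻¹u₂⁻²`, `b₆′ = a6num·q⁻³u₂⁻⁶`** in the parametrisation `δ = −(1 + 4ν)g₂`,
  `g₂ = (1 + 4B₂)(1 + ν)q⁻¹` of `…FrobeniusParam.lean`;
* **`frobModel_V_eq` — Dwork's `V = u₂²·A·Tₙ⁻²` (`T/z = 2Tₙ`) equals `𝔇²·(𝒬𝒰²)⁻¹`**, so `V ≡ 1 (mod 2)` (`frob_coeff_calD_sq_sub_mem`).

## Sources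
J. Vélu, C. R. Acad. Sci. Paris 273 (1971) [cite: SilvermanAEC2009, III.4]; J. H. Silverman, *AEC* 2nd ed., III.1 Table 3.1, IV.1
[cite: SilvermanAEC2009, IV.1.1]; C. Blakestad, D. Grant, J. Number Theory 249 (2023), Prop. 7, Lemma 12, Prop. 13 [cite: BlakestadGrant2023, Prop. 7].
-/

section Part8


set_option autoImplicit false

open scoped _root_.Classical
open _root_.PowerSeries _root_.WeierstrassCurve _root_.Literature.NumberTheory.EllipticCurves

namespace Literature.NumberTheory.EllipticCurves.PadicSigmaSqTwo.MazurTate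

section FrobeniusModel

variable {K : Type*} [CommRing K] (V : WeierstrassCurve K)

/-! ## §1 The isogeny parameter of a general model `vc • V′` of Vélu's quotient -/

/-- **`T·(Dn + s·zAM + (t − sr)·z³A²) = u·zA·(M − r·z²A)`** for `T = θ_vc(τ)`, `τ = zAM·u_D`, `vc = [u; r, s, t]` ANY change of variables
(from `θ·den = u(z − rw)`, `den = 1 + sz + (t − sr)w`, `X_{V′}(τ)·w_{V′}(τ) = τ³`, `X_{V′}(τ) = AM³u_D²`). [cite: SilvermanAEC2009, IV.1.1] -/
theorem frobModel_T_mul_E1 {e f t : K}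
    (hQ : f ^ 2 + V.a₁ * e * f + V.a₃ * f = e ^ 3 + V.a₂ * e ^ 2 + V.a₄ * e + V.a₆)
    (h2 : 2 * f + V.a₁ * e + V.a₃ = 0) (ht : t = 3 * e ^ 2 + 2 * V.a₂ * e + V.a₄ - V.a₁ * f)
    {A M Dn uD τ : K⟦X⟧} (hA : A = V.formalXMulSq - C e * X ^ 2) (hM : M = V.formalXMulSq * A + C t * X ^ 4)
    (hDn : Dn = V.formalXMulSq * A ^ 2 + C t * X ^ 4 * (C V.a₁ * X * A - V.formalXMulSq - C f * X ^ 3))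
    (hu : Dn * uD = 1) (hτ : τ = X * A * M * uD)
    (V' : WeierstrassCurve K) (h1' : V'.a₁ = V.a₁) (h2' : V'.a₂ = V.a₂) (h3' : V'.a₃ = V.a₃)
    (h4' : V'.a₄ = V.a₄ - 5 * t) (h6' : V'.a₆ = V.a₆ - V.b₂ * t - 7 * e * t)
    (vc : VariableChange K) {T : K⟦X⟧} (hT : T = (V'.formalVariableChange vc).subst τ) :
    T * (Dn + C vc.s * X * A * M + C (vc.t - vc.s * vc.r) * X ^ 3 * A ^ 2) =
      C (vc.u : K) * X * A * (M - C vc.r * X ^ 2 * A) := by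
  -- constant terms
  have hA0 : constantCoeff A = 1 := by
    rw [hA, map_sub, map_mul, map_pow, constantCoeff_X, constantCoeff_formalXMulSq]; ring
  have hM0 : constantCoeff M = 1 := by
    rw [hM, map_add, map_mul, map_mul, map_pow, constantCoeff_X, constantCoeff_formalXMulSq, hA0]; ring
  have hDn0 : constantCoeff Dn = 1 := by
    rw [hDn, map_add, map_mul, map_mul, map_mul, map_pow, map_pow, constantCoeff_X, constantCoeff_formalXMulSq, hA0]
    ring
  have hu0 : constantCoeff uD = 1 := by
    have e1 := congrArg constantCoeff hu
    rw [map_mul, hDn0, one_mul, map_one] at e1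
    exact e1
  have hτ0 : constantCoeff τ = 0 := by
    rw [hτ, map_mul, map_mul, map_mul, constantCoeff_X]; ring
  have hsτ : HasSubst τ := HasSubst.of_constantCoeff_zero' hτ0
  -- the ingredients read through `τ`
  set Xτ := V'.formalXMulSq.subst τ with hXτ
  set wτ := V'.formalW.subst τ with hwτ
  have hX' : Xτ = A * M ^ 3 * uD ^ 2 := by
    rw [hXτ, hτ]; exact velu_two_formalXMulSq_subst V hQ h2 ht hA hM hDn hu V' h1' h2' h3' h4' h6'
  have hw : Xτ * wτ = τ ^ 3 := by
    have h := congrArg (PowerSeries.subst τ) V'.formalXMulSq_mul_formalW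
    rw [subst_mul hsτ, subst_pow hsτ, subst_X hsτ] at h
    exact h
  have hw' : A * M ^ 3 * uD ^ 2 * wτ = X ^ 3 * A ^ 3 * M ^ 3 * uD ^ 3 := by
    rw [← hX', hw, hτ]; ring
  have hθ : T * (1 + C vc.s * τ + C (vc.t - vc.s * vc.r) * wτ) = C (vc.u : K) * (τ - C vc.r * wτ) := by
    have h := congrArg (PowerSeries.subst τ) (V'.formalVariableChange_mul_denom vc)
    rw [subst_mul hsτ, ← hT, WeierstrassCurve.formalVariableChangeDenom, subst_add hsτ, subst_add hsτ, subst_mul hsτ,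
      subst_mul hsτ, Literature.NumberTheory.EllipticCurves.C_subst, Literature.NumberTheory.EllipticCurves.C_subst, subst_X hsτ,
      ← hwτ, subst_mul hsτ, Literature.NumberTheory.EllipticCurves.C_subst, subst_sub hsτ, subst_X hsτ, subst_mul hsτ,
      Literature.NumberTheory.EllipticCurves.C_subst, ← hwτ, ← map_one (C (R := K)), Literature.NumberTheory.EllipticCurves.C_subst,
      map_one] at h
    exact h
  -- the key identity, multiplied by the unit `u_D · X_{V′}(τ)`
  have key : (T * (Dn + C vc.s * X * A * M + C (vc.t - vc.s * vc.r) * X ^ 3 * A ^ 2) -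
      C (vc.u : K) * X * A * (M - C vc.r * X ^ 2 * A)) * (uD * Xτ) = 0 := by
    linear_combination Xτ * hθ +
      (A ^ 2 * uD * X ^ 3 * C (vc.u : K) * C vc.r + T * A ^ 2 * uD * X ^ 3 * C (vc.t - vc.s * vc.r) +
        T * A * M * uD * X * C vc.s - A * M * uD * X * C (vc.u : K) - wτ * C (vc.u : K) * C vc.r + T * uD * Dn -
        T * τ * C vc.s - T * wτ * C (vc.t - vc.s * vc.r) + τ * C (vc.u : K) - T) * hX' +
      (-(T * A * M ^ 3 * uD ^ 2 * C vc.s) + A * M ^ 3 * uD ^ 2 * C (vc.u : K)) * hτ +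
      (-(C (vc.u : K) * C vc.r) - T * C (vc.t - vc.s * vc.r)) * hw' + (T * A * M ^ 3 * uD ^ 2) * hu
  have hunit : IsUnit (uD * Xτ) := by
    rw [PowerSeries.isUnit_iff_constantCoeff, map_mul, hu0, one_mul, hX', map_mul, map_mul, map_pow, map_pow, hA0, hM0, hu0]
    simp
  exact sub_eq_zero.mp ((hunit.mul_left_eq_zero).mp key)

/-- `T(0) = 0` for `T = θ_vc(τ)`. [cite: SilvermanAEC2009, IV.1.1] -/
theorem frobModel_constantCoeff_T {τ : K⟦X⟧} (hτ0 : constantCoeff τ = 0) (V' : WeierstrassCurve K) (vc : VariableChange K) {T : K⟦X⟧}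
    (hT : T = (V'.formalVariableChange vc).subst τ) : constantCoeff T = 0 := by
  rw [hT, Literature.RingTheory.FormalGroups.constantCoeff_subst_of_constantCoeff_eq_zero hτ0, constantCoeff_formalVariableChange]

/-- `[z¹]T = u` for `T = θ_vc(τ)`, `τ = z + ⋯`. [cite: SilvermanAEC2009, IV.1.1] -/
theorem frobModel_coeff_one_T {τ : K⟦X⟧} (hτ0 : constantCoeff τ = 0) (hτ1 : coeff 1 τ = 1) (V' : WeierstrassCurve K)
    (vc : VariableChange K) {T : K⟦X⟧} (hT : T = (V'.formalVariableChange vc).subst τ) : coeff 1 T = (vc.u : K) := by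
  rw [hT, WeierstrassCurve.coeff_one_subst_eq_mul _ hτ0, coeff_one_formalVariableChange, hτ1, mul_one]

/-- `τ = zAM·u_D` has `τ(0) = 0` and `[z¹]τ = 1`. [cite: BlakestadGrant2023, Lemma 12] -/
theorem frobModel_tau_coeff {e f t : K} {A M Dn uD τ : K⟦X⟧} (hA : A = V.formalXMulSq - C e * X ^ 2)
    (hM : M = V.formalXMulSq * A + C t * X ^ 4)
    (hDn : Dn = V.formalXMulSq * A ^ 2 + C t * X ^ 4 * (C V.a₁ * X * A - V.formalXMulSq - C f * X ^ 3))
    (hu : Dn * uD = 1) (hτ : τ = X * A * M * uD) : constantCoeff τ = 0 ∧ coeff 1 τ = 1 := by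
  have hA0 : constantCoeff A = 1 := by
    rw [hA, map_sub, map_mul, map_pow, constantCoeff_X, constantCoeff_formalXMulSq]; ring
  have hM0 : constantCoeff M = 1 := by
    rw [hM, map_add, map_mul, map_mul, map_pow, constantCoeff_X, constantCoeff_formalXMulSq, hA0]; ring
  have hDn0 : constantCoeff Dn = 1 := by
    rw [hDn, map_add, map_mul, map_mul, map_mul, map_pow, map_pow, constantCoeff_X, constantCoeff_formalXMulSq, hA0]
    ring
  have hu0 : constantCoeff uD = 1 := by
    have e1 := congrArg constantCoeff hu
    rw [map_mul, hDn0, one_mul, map_one] at e1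
    exact e1
  refine ⟨by rw [hτ, map_mul, map_mul, map_mul, constantCoeff_X]; ring, ?_⟩
  rw [hτ, mul_assoc, mul_assoc, coeff_succ_X_mul, coeff_zero_eq_constantCoeff, map_mul, map_mul, hA0, hM0, hu0]
  ring


/-! ## §2 The Frobenius model: `T·𝔇 = (1 + 2B₂)·z·(2 − z)·Xs·𝒰` -/

section Frobenius

variable [Algebra ℚ K] {X0 B2 g2 d i2 e f t : K} {A M Dn uD τ T cA cU cQ cG cD cM E0 D1 : K⟦X⟧}
  (V' : WeierstrassCurve K) (vc : VariableChange K)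

omit [Algebra ℚ K] in
/-- The canonical `2`-torsion point `Q = (X₀/4, −X₀/8)` lies on `V = ⟨1, B₂, 0, 0, g₂X₀²⟩` (the cubic of `X₀`). [cite: SilvermanAEC2009, III.4] -/
theorem frobModel_point (h1 : V.a₁ = 1) (h2 : V.a₂ = B2) (h3 : V.a₃ = 0) (h4 : V.a₄ = 0) (h6 : V.a₆ = g2 * X0 ^ 2)
    (hX0 : X0 = -1 - 4 * B2 - 64 * g2) (hi2 : (2 : K) * i2 = 1) (he : e = X0 * i2 ^ 2) (hf : f = -(X0 * i2 ^ 3))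
    (ht : t = (3 * X0 ^ 2 + 8 * B2 * X0 + 2 * X0) * i2 ^ 4) :
    (f ^ 2 + V.a₁ * e * f + V.a₃ * f = e ^ 3 + V.a₂ * e ^ 2 + V.a₄ * e + V.a₆) ∧ (2 * f + V.a₁ * e + V.a₃ = 0) ∧
      (t = 3 * e ^ 2 + 2 * V.a₂ * e + V.a₄ - V.a₁ * f) := by
  rw [h1, h2, h3, h4, h6, he, hf, ht]
  refine ⟨?_, ?_, ?_⟩
  · linear_combination (-(X0 ^ 2 * i2 ^ 6)) * hX0 +
      (X0 ^ 2 * i2 ^ 5 + B2 * X0 ^ 2 * i2 ^ 4 * (2 * i2 + 1) + g2 * X0 ^ 2 * (32 * i2 ^ 5 + 16 * i2 ^ 4 + 8 * i2 ^ 3 + 4 * i2 ^ 2 + 2 * i2 + 1)) * hi2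
  · linear_combination (-(X0 * i2 ^ 2)) * hi2
  · linear_combination ((4 : K) * X0 * B2 * i2 ^ 3 + X0 * i2 ^ 3 + (2 : K) * X0 * B2 * i2 ^ 2) * hi2

/-- **`T·𝔇 = (1 + 2B₂)·z·(2 − z)·Xs·𝒰` for the Frobenius model** `vc = [2(1 + 2B₂); R₁/4, (1 + 2B₂) − ½, −R₁/8]`, `R₁ = −X₀ + 32δ`
(any `δ`): with `𝔇` a unit series this is the closed form of the isogeny parameter `T = θ_vc(τ)`. [cite: BlakestadGrant2023, Lemma 12] -/
theorem frobModel_T_mul_calD [IsDomain K] (h1 : V.a₁ = 1) (h2 : V.a₂ = B2) (h3 : V.a₃ = 0) (h4 : V.a₄ = 0)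
    (h6 : V.a₆ = g2 * X0 ^ 2) (hX0 : X0 = -1 - 4 * B2 - 64 * g2) (hi2 : (2 : K) * i2 = 1) (he : e = X0 * i2 ^ 2)
    (hf : f = -(X0 * i2 ^ 3)) (ht : t = (3 * X0 ^ 2 + 8 * B2 * X0 + 2 * X0) * i2 ^ 4)
    (hA : A = V.formalXMulSq - C e * X ^ 2) (hM : M = V.formalXMulSq * A + C t * X ^ 4)
    (hDn : Dn = V.formalXMulSq * A ^ 2 + C t * X ^ 4 * (C V.a₁ * X * A - V.formalXMulSq - C f * X ^ 3))
    (hu : Dn * uD = 1) (hτ : τ = X * A * M * uD)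
    (h1' : V'.a₁ = V.a₁) (h2' : V'.a₂ = V.a₂) (h3' : V'.a₃ = V.a₃) (h4' : V'.a₄ = V.a₄ - 5 * t)
    (h6' : V'.a₆ = V.a₆ - V.b₂ * t - 7 * e * t)
    (hvu : (vc.u : K) = 2 * (1 + 2 * B2)) (hvr : vc.r = (-X0 + 32 * d) * i2 ^ 2) (hvs : vc.s = (1 + 2 * B2) - i2)
    (hvt : vc.t = -((-X0 + 32 * d) * i2 ^ 2) * i2) (hT : T = (V'.formalVariableChange vc).subst τ)
    (hcA : cA = 4 * V.formalXMulSq - C X0 * X ^ 2)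
    (hcU : cU = V.formalXMulSq ^ 2 - 8 * C d * V.formalXMulSq * X ^ 2 + 2 * (C d * C X0 - 4 * C g2 * C X0) * X ^ 4)
    (hcQ : cQ = V.formalXMulSq ^ 2 - 16 * C g2 * V.formalXMulSq * X ^ 2 - 4 * C g2 * C X0 * X ^ 4)
    (hcG : cG = (-C B2 - 32 * C g2) * V.formalXMulSq ^ 2 - 4 * (1 + 2 * C B2) * C d * V.formalXMulSq * X ^ 2 +
        (1 + 2 * C B2) * (C d * C X0 - 4 * C g2 * C X0) * X ^ 4 - 8 * C g2 * C X0 * V.formalXMulSq * X ^ 2 -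
        2 * C g2 * C X0 ^ 2 * X ^ 4)
    (hcD : cD = (1 + 2 * C B2) * X * V.formalXMulSq * cU + V.formalXMulSq ^ 2 * cQ + 8 * C g2 * C X0 * X ^ 4 * cQ -
        X ^ 2 * V.formalXMulSq * cG) :
    T * cD = (1 + 2 * C B2) * X * (2 - X) * V.formalXMulSq * cU := by
  obtain ⟨hQ, h2t, ht'⟩ := frobModel_point V h1 h2 h3 h4 h6 hX0 hi2 he hf ht
  have hE1 := frobModel_T_mul_E1 V hQ h2t ht' hA hM hDn hu hτ V' h1' h2' h3' h4' h6' vc hT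
  have hC2 : (2 : K⟦X⟧) * C i2 = 1 := by rw [← map_ofNat (C (R := K)) 2, ← map_mul, hi2, map_one]
  have hX0C := frob_C_X0 (K := K) hX0
  have hcurve := frob_curve_eq V h1 h2 h3 h4 h6
  -- the auxiliary series `ℳ`, `ℰ₀`, `𝔇₁` of `…FrobeniusSeries.lean`
  set cM' : K⟦X⟧ := 4 * V.formalXMulSq * cA + (3 * C X0 ^ 2 + 8 * C B2 * C X0 + 2 * C X0) * X ^ 4 with hcM'
  set E0' : K⟦X⟧ := 8 * V.formalXMulSq * cA ^ 2 + (3 * C X0 ^ 2 + 8 * C B2 * C X0 + 2 * C X0) * X ^ 4 *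
      (2 * X * cA - 8 * V.formalXMulSq + C X0 * X ^ 3) + (1 + 4 * C B2) * X * cA * cM' -
      2 * (1 + 2 * C B2) * (-C X0 + 32 * C d) * X ^ 3 * cA ^ 2 with hE0'
  set D1' : K⟦X⟧ := V.formalXMulSq ^ 3 * (2 + (1 + 4 * C B2) * X) - C X0 * V.formalXMulSq ^ 2 * X ^ 2 -
      (C B2 * C X0 + 16 * (1 + 2 * C B2) * C d) * V.formalXMulSq ^ 2 * X ^ 3 + 16 * C g2 * C X0 * V.formalXMulSq * X ^ 4 +
      (4 * (C d * C X0 - 4 * C g2 * C X0) + (1 + 4 * C B2) * (2 * C d * C X0 + 2 * (C d * C X0 - 4 * C g2 * C X0))) *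
        V.formalXMulSq * X ^ 5 - (1 + 2 * C B2) * (C d * C X0 - 4 * C g2 * C X0) * C X0 * X ^ 7 with hD1'
  have ha := frob_cM_sub_eq V hX0 hcA hcU hcM'
  have hb := frob_E0_eq V h1 h2 h3 h4 h6 hX0 hcA hcM' hE0' hD1'
  have hc := frob_calQ_mul_D1 V h1 h2 h3 h4 h6 hX0 hcU hcQ hcG hcD hD1'
  have hT2 := frob_calA_mul_calQ V h1 h2 h3 h4 h6 hX0 hcA hcQ
  -- rewrite the data of the model in closed form
  rw [hvu, hvs, hvt, hvr] at hE1
  rw [h1] at hDn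
  rw [he] at hA
  rw [ht] at hM hDn
  rw [hf] at hDn
  simp only [map_sub, map_add, map_neg, map_mul, map_pow, map_one, map_ofNat, one_mul] at hE1 hA hM hDn
  set Xs := V.formalXMulSq with hXs
  -- step 1: `64·(T·𝔇₁ − u₂·z·𝒜·𝒰) = 0`
  have step1 : (64 : K⟦X⟧) * (T * D1' - (1 + 2 * C B2) * X * cA * cU) = 0 := by
    subst hA hM hDn
    rw [hcM'] at ha
    rw [hE0', hcM', hD1'] at hb
    subst hcA hcU
    linear_combination (128 : K⟦X⟧) * hE1 + (-T) * hb + ((128 : K⟦X⟧) * ((-2 : K⟦X⟧) * X ^ 3 * C X0 * C B2 * C i2 ^ 5 + (-1 : K⟦X⟧) * X ^ 3 * C X0 * C i2 ^ 5 + (2 : K⟦X⟧) * Xs * X * C B2 * C i2 ^ 3 + Xs * X * C i2 ^ 3)) * ha +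
      ((-T) * ((1024 : K⟦X⟧) * X ^ 7 * C X0 ^ 2 * C B2 * C i2 ^ 6 + (-4096 : K⟦X⟧) * X ^ 7 * C X0 ^ 2 * C B2 * C d * C i2 ^ 5 + (-1024 : K⟦X⟧) * X ^ 7 * C X0 ^ 2 * C B2 ^ 2 * C i2 ^ 5 + (384 : K⟦X⟧) * X ^ 7 * C X0 ^ 3 * C i2 ^ 6 + (-256 : K⟦X⟧) * X ^ 7 * C X0 ^ 3 * C B2 * C i2 ^ 5 + (256 : K⟦X⟧) * X ^ 7 * C X0 ^ 2 * C i2 ^ 6 + (-2048 : K⟦X⟧) * X ^ 7 * C X0 ^ 2 * C d * C i2 ^ 5 + (-768 : K⟦X⟧) * X ^ 7 * C X0 ^ 2 * C B2 * C i2 ^ 5 + (-2048 : K⟦X⟧) * X ^ 7 * C X0 ^ 2 * C B2 * C d * C i2 ^ 4 + (-512 : K⟦X⟧) * X ^ 7 * C X0 ^ 2 * C B2 ^ 2 * C i2 ^ 4 + (-128 : K⟦X⟧) * X ^ 7 * C X0 ^ 3 * C i2 ^ 5 + (-128 : K⟦X⟧) * X ^ 7 * C X0 ^ 3 * C B2 *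 C i2 ^ 4 + (-128 : K⟦X⟧) * X ^ 7 * C X0 ^ 2 * C i2 ^ 5 + (-1024 : K⟦X⟧) * X ^ 7 * C X0 ^ 2 * C d * C i2 ^ 4 + (-384 : K⟦X⟧) * X ^ 7 * C X0 ^ 2 * C B2 * C i2 ^ 4 + (-1024 : K⟦X⟧) * X ^ 7 * C X0 ^ 2 * C B2 * C d * C i2 ^ 3 + (-256 : K⟦X⟧) * X ^ 7 * C X0 ^ 2 * C B2 ^ 2 * C i2 ^ 3 + (-64 : K⟦X⟧) * X ^ 7 * C X0 ^ 3 * C i2 ^ 4 + (-64 : K⟦X⟧) * X ^ 7 * C X0 ^ 3 * C B2 * C i2 ^ 3 + (-64 : K⟦X⟧) * X ^ 7 * C X0 ^ 2 * C i2 ^ 4 + (-512 : K⟦X⟧) * X ^ 7 * C X0 ^ 2 * C d * C i2 ^ 3 + (-192 : K⟦X⟧) * X ^ 7 * C X0 ^ 2 * C B2 * C i2 ^ 3 + (-512 : K⟦X⟧) * X ^ 7 * C X0 ^ 2 * C B2 * C d * C i2 ^ 2 + (-128 : K⟦X⟧) * X ^ 7 * C X0 ^ 2 * C B2 ^ 2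 * C i2 ^ 2 + (-32 : K⟦X⟧) * X ^ 7 * C X0 ^ 3 * C i2 ^ 3 + (-32 : K⟦X⟧) * X ^ 7 * C X0 ^ 3 * C B2 * C i2 ^ 2 + (-32 : K⟦X⟧) * X ^ 7 * C X0 ^ 2 * C i2 ^ 3 + (-256 : K⟦X⟧) * X ^ 7 * C X0 ^ 2 * C d * C i2 ^ 2 + (-96 : K⟦X⟧) * X ^ 7 * C X0 ^ 2 * C B2 * C i2 ^ 2 + (-256 : K⟦X⟧) * X ^ 7 * C X0 ^ 2 * C B2 * C d * C i2 + (-64 : K⟦X⟧) * X ^ 7 * C X0 ^ 2 * C B2 ^ 2 * C i2 + (-16 : K⟦X⟧) * X ^ 7 * C X0 ^ 3 * C i2 ^ 2 + (-16 : K⟦X⟧) * X ^ 7 * C X0 ^ 3 * C B2 * C i2 + (-512 : K⟦X⟧) * Xs * X ^ 5 * C X0 * C B2 * C i2 ^ 4 + (8192 : K⟦X⟧) * Xs * X ^ 5 * C X0 * C B2 * C d * C i2 ^ 3 + (1024 : K⟦X⟧) * Xs * X ^ 5 * C X0 * C B2 ^ 2 * C i2 ^ 3 + (-256 : K⟦X⟧)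 * Xs * X ^ 5 * C X0 ^ 2 * C i2 ^ 4 + (256 : K⟦X⟧) * Xs * X ^ 5 * C X0 ^ 2 * C B2 * C i2 ^ 3 + (-16 : K⟦X⟧) * X ^ 7 * C X0 ^ 2 * C i2 ^ 2 + (-128 : K⟦X⟧) * X ^ 7 * C X0 ^ 2 * C d * C i2 + (-48 : K⟦X⟧) * X ^ 7 * C X0 ^ 2 * C B2 * C i2 + (-128 : K⟦X⟧) * X ^ 7 * C X0 ^ 2 * C B2 * C d + (-32 : K⟦X⟧) * X ^ 7 * C X0 ^ 2 * C B2 ^ 2 + (-8 : K⟦X⟧) * X ^ 7 * C X0 ^ 3 * C i2 + (-8 : K⟦X⟧) * X ^ 7 * C X0 ^ 3 * C B2 + (-128 : K⟦X⟧) * Xs * X ^ 5 * C X0 * C i2 ^ 4 + (4096 : K⟦X⟧) * Xs * X ^ 5 * C X0 * C d * C i2 ^ 3 + (1024 : K⟦X⟧) * Xs * X ^ 5 * C X0 * C B2 * C i2 ^ 3 + (4096 : K⟦X⟧) * Xs * X ^ 5 * C X0 * C B2 * C d * C i2 ^ 2 + (512 : K⟦X⟧) * Xs * X ^ 5 * C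 X0 * C B2 ^ 2 * C i2 ^ 2 + (192 : K⟦X⟧) * Xs * X ^ 5 * C X0 ^ 2 * C i2 ^ 3 + (128 : K⟦X⟧) * Xs * X ^ 5 * C X0 ^ 2 * C B2 * C i2 ^ 2 + (-8 : K⟦X⟧) * X ^ 7 * C X0 ^ 2 * C i2 + (-64 : K⟦X⟧) * X ^ 7 * C X0 ^ 2 * C d + (-24 : K⟦X⟧) * X ^ 7 * C X0 ^ 2 * C B2 + (-4 : K⟦X⟧) * X ^ 7 * C X0 ^ 3 + (-512 : K⟦X⟧) * Xs * X ^ 4 * C X0 * C B2 * C i2 ^ 3 + (-128 : K⟦X⟧) * Xs * X ^ 4 * C X0 ^ 2 * C i2 ^ 3 + (192 : K⟦X⟧) * Xs * X ^ 5 * C X0 * C i2 ^ 3 + (2048 : K⟦X⟧) * Xs * X ^ 5 * C X0 * C d * C i2 ^ 2 + (512 : K⟦X⟧) * Xs * X ^ 5 * C X0 * C B2 * C i2 ^ 2 + (2048 : K⟦X⟧) * Xs * X ^ 5 * C X0 * C B2 * C d * C i2 + (256 : K⟦X⟧) * Xs * X ^ 5 * C X0 * C B2 ^ 2 * C i2 +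 (96 : K⟦X⟧) * Xs * X ^ 5 * C X0 ^ 2 * C i2 ^ 2 + (64 : K⟦X⟧) * Xs * X ^ 5 * C X0 ^ 2 * C B2 * C i2 + (-4 : K⟦X⟧) * X ^ 7 * C X0 ^ 2 + (-128 : K⟦X⟧) * Xs * X ^ 4 * C X0 * C i2 ^ 3 + (-256 : K⟦X⟧) * Xs * X ^ 4 * C X0 * C B2 * C i2 ^ 2 + (-64 : K⟦X⟧) * Xs * X ^ 4 * C X0 ^ 2 * C i2 ^ 2 + (96 : K⟦X⟧) * Xs * X ^ 5 * C X0 * C i2 ^ 2 + (1024 : K⟦X⟧) * Xs * X ^ 5 * C X0 * C d * C i2 + (256 : K⟦X⟧) * Xs * X ^ 5 * C X0 * C B2 * C i2 + (1024 : K⟦X⟧) * Xs * X ^ 5 * C X0 * C B2 * C d + (128 : K⟦X⟧) * Xs * X ^ 5 * C X0 * C B2 ^ 2 + (48 : K⟦X⟧) * Xs * X ^ 5 * C X0 ^ 2 * C i2 + (32 : K⟦X⟧) * Xs * X ^ 5 * C X0 ^ 2 * C B2 + (-64 : K⟦X⟧) * Xs * X ^ 4 * C X0 * C i2 ^ 2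 + (-128 : K⟦X⟧) * Xs * X ^ 4 * C X0 * C B2 * C i2 + (-32 : K⟦X⟧) * Xs * X ^ 4 * C X0 ^ 2 * C i2 + (48 : K⟦X⟧) * Xs * X ^ 5 * C X0 * C i2 + (512 : K⟦X⟧) * Xs * X ^ 5 * C X0 * C d + (128 : K⟦X⟧) * Xs * X ^ 5 * C X0 * C B2 + (24 : K⟦X⟧) * Xs * X ^ 5 * C X0 ^ 2 + (-4096 : K⟦X⟧) * Xs ^ 2 * X ^ 3 * C B2 * C d * C i2 + (128 : K⟦X⟧) * Xs ^ 2 * X ^ 3 * C X0 * C i2 ^ 2 + (-128 : K⟦X⟧) * Xs ^ 2 * X ^ 3 * C X0 * C B2 * C i2 + (-32 : K⟦X⟧) * Xs * X ^ 4 * C X0 * C i2 + (-64 : K⟦X⟧) * Xs * X ^ 4 * C X0 * C B2 + (-16 : K⟦X⟧) * Xs * X ^ 4 * C X0 ^ 2 + (24 : K⟦X⟧) * Xs * X ^ 5 * C X0 + (-2048 : K⟦X⟧) * Xs ^ 2 * X ^ 3 * C d * C i2 + (-2048 : K⟦X⟧) * Xs ^ 2 * X ^ 3 * C B2 * C d +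 (-64 : K⟦X⟧) * Xs ^ 2 * X ^ 3 * C X0 * C B2 + (-16 : K⟦X⟧) * Xs * X ^ 4 * C X0 + (-128 : K⟦X⟧) * Xs ^ 2 * X ^ 2 * C X0 * C i2 + (-1024 : K⟦X⟧) * Xs ^ 2 * X ^ 3 * C d + (-64 : K⟦X⟧) * Xs ^ 2 * X ^ 2 * C X0 + (-64 : K⟦X⟧) * Xs ^ 3 * X) + (128 : K⟦X⟧) * ((-64 : K⟦X⟧) * X ^ 7 * C X0 ^ 2 * C B2 * C d * C i2 ^ 5 + (-16 : K⟦X⟧) * X ^ 7 * C X0 ^ 2 * C B2 ^ 2 * C i2 ^ 5 + (-4 : K⟦X⟧) * X ^ 7 * C X0 ^ 3 * C B2 * C i2 ^ 5 + (-32 : K⟦X⟧) * X ^ 7 * C X0 ^ 2 * C d * C i2 ^ 5 + (-12 : K⟦X⟧) * X ^ 7 * C X0 ^ 2 * C B2 * C i2 ^ 5 + (-32 : K⟦X⟧) * X ^ 7 * C X0 ^ 2 * C B2 * C d * C i2 ^ 4 + (128 : K⟦X⟧) * X ^ 7 * C X0 ^ 2 * C B2 * C g2 * C i2 ^ 4 +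 (-2 : K⟦X⟧) * X ^ 7 * C X0 ^ 3 * C i2 ^ 5 + (-2 : K⟦X⟧) * X ^ 7 * C X0 ^ 2 * C i2 ^ 5 + (-16 : K⟦X⟧) * X ^ 7 * C X0 ^ 2 * C d * C i2 ^ 4 + (64 : K⟦X⟧) * X ^ 7 * C X0 ^ 2 * C g2 * C i2 ^ 4 + (-16 : K⟦X⟧) * X ^ 7 * C X0 ^ 2 * C B2 * C d * C i2 ^ 3 + (64 : K⟦X⟧) * X ^ 7 * C X0 ^ 2 * C B2 * C g2 * C i2 ^ 3 + (-8 : K⟦X⟧) * X ^ 7 * C X0 ^ 2 * C d * C i2 ^ 3 + (32 : K⟦X⟧) * X ^ 7 * C X0 ^ 2 * C g2 * C i2 ^ 3 + (-8 : K⟦X⟧) * X ^ 7 * C X0 ^ 2 * C B2 * C d * C i2 ^ 2 + (32 : K⟦X⟧) * X ^ 7 * C X0 ^ 2 * C B2 * C g2 * C i2 ^ 2 + (-4 : K⟦X⟧) * X ^ 7 * C X0 ^ 2 * C d * C i2 ^ 2 + (16 : K⟦X⟧) * X ^ 7 * C X0 ^ 2 * C g2 * C i2 ^ 2 + (-4 :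 K⟦X⟧) * X ^ 7 * C X0 ^ 2 * C B2 * C d * C i2 + (16 : K⟦X⟧) * X ^ 7 * C X0 ^ 2 * C B2 * C g2 * C i2 + (128 : K⟦X⟧) * Xs * X ^ 5 * C X0 * C B2 * C d * C i2 ^ 3 + (16 : K⟦X⟧) * Xs * X ^ 5 * C X0 * C B2 ^ 2 * C i2 ^ 3 + (4 : K⟦X⟧) * Xs * X ^ 5 * C X0 ^ 2 * C B2 * C i2 ^ 3 + (-2 : K⟦X⟧) * X ^ 7 * C X0 ^ 2 * C d * C i2 + (8 : K⟦X⟧) * X ^ 7 * C X0 ^ 2 * C g2 * C i2 + (64 : K⟦X⟧) * Xs * X ^ 5 * C X0 * C d * C i2 ^ 3 + (12 : K⟦X⟧) * Xs * X ^ 5 * C X0 * C B2 * C i2 ^ 3 + (64 : K⟦X⟧) * Xs * X ^ 5 * C X0 * C B2 * C d * C i2 ^ 2 + (-128 : K⟦X⟧) * Xs * X ^ 5 * C X0 * C B2 * C g2 * C i2 ^ 2 + (2 : K⟦X⟧) * Xs * X ^ 5 * C X0 ^ 2 * C i2 ^ 3 + (2 : K⟦X⟧) * Xs * X ^ 5 *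 C X0 * C i2 ^ 3 + (32 : K⟦X⟧) * Xs * X ^ 5 * C X0 * C d * C i2 ^ 2 + (-64 : K⟦X⟧) * Xs * X ^ 5 * C X0 * C g2 * C i2 ^ 2 + (32 : K⟦X⟧) * Xs * X ^ 5 * C X0 * C B2 * C d * C i2 + (-64 : K⟦X⟧) * Xs * X ^ 5 * C X0 * C B2 * C g2 * C i2 + (16 : K⟦X⟧) * Xs * X ^ 5 * C X0 * C d * C i2 + (-32 : K⟦X⟧) * Xs * X ^ 5 * C X0 * C g2 * C i2 + (-64 : K⟦X⟧) * Xs ^ 2 * X ^ 3 * C B2 * C d * C i2 + (-2 : K⟦X⟧) * Xs ^ 2 * X ^ 3 * C X0 * C B2 * C i2 + (-32 : K⟦X⟧) * Xs ^ 2 * X ^ 3 * C d * C i2 + (-1 : K⟦X⟧) * Xs ^ 2 * X ^ 3 * C X0 * C i2 + (-4 : K⟦X⟧) * Xs ^ 3 * X * C B2 + (-2 : K⟦X⟧) * Xs ^ 3 * X) +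
        (64 : K⟦X⟧) * (1 + 2 * C B2) * X * (4 * Xs - C X0 * X ^ 2) *
          (Xs ^ 2 - 8 * C d * Xs * X ^ 2 + 2 * (C d * C X0 - 4 * C g2 * C X0) * X ^ 4)) * hC2
  have h64 : IsUnit (64 : K⟦X⟧) := by
    rw [show (64 : K⟦X⟧) = C (((63 : ℕ) + 1 : ℕ) : K) by rw [map_natCast]; norm_num]
    exact (isUnit_natCast_succ (K := K) 63).map C
  have step1' : T * D1' = (1 + 2 * C B2) * X * cA * cU := sub_eq_zero.mp ((h64.mul_right_eq_zero).mp step1)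
  -- step 2: multiply by `𝒬` and use `𝒬𝔇₁ = (2 − z)Xs𝔇`, `𝒜𝒬 = (2 − z)²Xs²`
  have step2 : ((2 - X) * Xs) * (T * cD - (1 + 2 * C B2) * X * (2 - X) * Xs * cU) = 0 := by
    linear_combination cQ * step1' + (-T) * hc + ((1 + 2 * C B2) * X * cU) * hT2
  have hunit : IsUnit ((2 - X : K⟦X⟧) * Xs) := by
    rw [PowerSeries.isUnit_iff_constantCoeff, map_mul, map_sub, constantCoeff_X, sub_zero, hXs, constantCoeff_formalXMulSq, mul_one,
      show constantCoeff (2 : K⟦X⟧) = (2 : K) from map_ofNat _ 2]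
    exact isUnit_two_ratAlgebra
  exact sub_eq_zero.mp ((hunit.mul_right_eq_zero).mp step2)

end Frobenius


/-! ## §3 The Frobenius model is the chart curve `⟨1, b₂′, 0, 0, b₆′⟩` -/

section Curve

variable [Algebra ℚ K] {X0 B2 g2 d i2 iq iu2 nu e t : K} (V' : WeierstrassCurve K) (vc : VariableChange K)

/-- **`vc • V′ = ⟨1, b₂′, 0, 0, b₆′⟩` with `b₂′ = a2num·q⁻¹u₂⁻²`, `b₆′ = a6num·q⁻³u₂⁻⁶`** for the Frobenius model of Vélu's quotient in the
parametrisation `δ = −(1 + 4ν)g₂`, `g₂ = (1 + 4B₂)(1 + ν)q⁻¹` (so `b₂′ ≡ B₂²`, `b₆′ ≡ B₆² (mod 2)` by `frobParam_beta2/6_sub_mem`).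
[cite: SilvermanAEC2009, III.1] [cite: BlakestadGrant2023, Prop. 7] -/
theorem frobModel_curve (h1 : V.a₁ = 1) (h2 : V.a₂ = B2) (h3 : V.a₃ = 0) (h4 : V.a₄ = 0) (h6 : V.a₆ = g2 * X0 ^ 2)
    (hX0 : X0 = -1 - 4 * B2 - 64 * g2) (hi2 : (2 : K) * i2 = 1)
    (hiq : 3 * ((1 + 4 * nu) ^ 2 - 4 * (1 + 4 * nu) - 16) * iq = 1) (hiu2 : (1 + 2 * B2) * iu2 = 1)
    (hg2 : g2 = (1 + 4 * B2) * (1 + nu) * iq) (hd : d = -(1 + 4 * nu) * g2)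
    (he : e = X0 * i2 ^ 2) (ht : t = (3 * X0 ^ 2 + 8 * B2 * X0 + 2 * X0) * i2 ^ 4)
    (h1' : V'.a₁ = V.a₁) (h2' : V'.a₂ = V.a₂) (h3' : V'.a₃ = V.a₃) (h4' : V'.a₄ = V.a₄ - 5 * t)
    (h6' : V'.a₆ = V.a₆ - V.b₂ * t - 7 * e * t)
    (hvu : (vc.u : K) = 2 * (1 + 2 * B2)) (hvr : vc.r = (-X0 + 32 * d) * i2 ^ 2) (hvs : vc.s = (1 + 2 * B2) - i2)
    (hvt : vc.t = -((-X0 + 32 * d) * i2 ^ 2) * i2) :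
    vc • V' = ⟨1, ((-48 : K) * B2 ^ 2 * nu ^ 2 + (-96 : K) * B2 * nu ^ 2 + (24 : K) * B2 ^ 2 * nu + (-24 : K) * nu ^ 2 + (-72 : K) * B2 * nu + (57 : K) * B2 ^ 2 + (-18 : K) * nu + (24 : K) * B2 + (6 : K)) * iq * iu2 ^ 2, 0, 0, ((16384 : K) * B2 ^ 3 * nu ^ 6 + (12288 : K) * B2 ^ 2 * nu ^ 6 + (98304 : K) * B2 ^ 3 * nu ^ 5 + (3072 : K) * B2 * nu ^ 6 + (73728 : K) * B2 ^ 2 * nu ^ 5 + (227328 : K) * B2 ^ 3 * nu ^ 4 + (256 : K) * nu ^ 6 + (18432 : K) * B2 * nu ^ 5 + (170496 : K) * B2 ^ 2 * nu ^ 4 + (262144 : K) * B2 ^ 3 * nu ^ 3 + (1536 : K) * nu ^ 5 + (42624 : K) * B2 * nu ^ 4 + (196608 : K) * B2 ^ 2 * nu ^ 3 + (158784 : K) * B2 ^ 3 * nu ^ 2 + (3552 : K) * nu ^ 4 + (49152 : K) * B2 * nu ^ 3 + (119088 : K) * B2 ^ 2 * nu ^ 2 + (47232 : K) * B2 ^ 3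 * nu + (4096 : K) * nu ^ 3 + (29772 : K) * B2 * nu ^ 2 + (35424 : K) * B2 ^ 2 * nu + (5184 : K) * B2 ^ 3 + (2481 : K) * nu ^ 2 + (8856 : K) * B2 * nu + (3888 : K) * B2 ^ 2 + (738 : K) * nu + (972 : K) * B2 + (81 : K)) * iq ^ 3 * iu2 ^ 6⟩ := by
  -- `u⁻¹ = i₂·u₂⁻¹`
  have hui : ((vc.u⁻¹ : Kˣ) : K) = i2 * iu2 := by
    have hinv : ((vc.u⁻¹ : Kˣ) : K) * (vc.u : K) = 1 := by rw [← Units.val_mul, inv_mul_cancel, Units.val_one]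
    have h2 : (vc.u : K) * (i2 * iu2) = 1 := by rw [hvu]; linear_combination ((1 + 2 * B2) * iu2) * hi2 + hiu2
    calc ((vc.u⁻¹ : Kˣ) : K) = ((vc.u⁻¹ : Kˣ) : K) * ((vc.u : K) * (i2 * iu2)) := by rw [h2, mul_one]
      _ = i2 * iu2 := by rw [← mul_assoc, hinv, one_mul]
  have hB6 : g2 * X0 ^ 2 = g2 * X0 ^ 2 := rfl
  have hR1 : -X0 + 32 * d = -X0 + 32 * d := rfl
  have hF := frobParam_F_R1 (A := K) hiq hg2 hX0 hd hR1
  have hpar2 := frobParam_S2_mul_q (A := K) hiq hg2 hX0 hd hR1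
  have hpar6 := frobParam_S6_mul_q_cube (A := K) hiq hg2 hX0 hB6 hd hR1
  have haux1 := frobModel_a₁_aux (i2 := i2) B2 hi2
  have haux2 := frobModel_a₂_aux (i2 := i2) B2 (-X0 + 32 * d) hi2
  have haux3 := frobModel_a₃_aux (i2 := i2) (-X0 + 32 * d) hi2
  have haux4 := frobModel_a₄_aux (i2 := i2) X0 B2 (-X0 + 32 * d) hi2
  have haux6 := frobModel_a₆_aux (i2 := i2) X0 B2 (g2 * X0 ^ 2) (-X0 + 32 * d) hi2
  have h16 : IsUnit (16 : K) := by
    rw [show (16 : K) = (((15 : ℕ) + 1 : ℕ) : K) by norm_num]; exact isUnit_natCast_succ (K := K) 15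
  ext
  · rw [variableChange_a₁, hui, h1', h1, hvs]
    linear_combination (i2 * iu2) * haux1 + ((1 + 2 * B2) * iu2) * hi2 + hiu2
  · rw [variableChange_a₂, hui, h2', h1', h1, h2, hvs, hvr]
    have hS2 : (-3 - 12 * B2 - 16 * B2 ^ 2 + 3 * (-X0 + 32 * d)) = 16 * ((-48 : K) * B2 ^ 2 * nu ^ 2 + (-96 : K) * B2 * nu ^ 2 + (24 : K) * B2 ^ 2 * nu + (-24 : K) * nu ^ 2 + (-72 : K) * B2 * nu + (57 : K) * B2 ^ 2 + (-18 : K) * nu + (24 : K) * B2 + (6 : K)) * iq := by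
      linear_combination iq * hpar2 + ((16 : K) * B2 ^ 2 + (-96 : K) * d + (12 : K) * B2 + (3 : K) * X0 + (3 : K)) * hiq
    linear_combination ((-384 : K) * B2 ^ 2 * i2 ^ 3 * iq * iu2 ^ 2 * nu ^ 2 + (-768 : K) * B2 * i2 ^ 3 * iq * iu2 ^ 2 * nu ^ 2 + (-192 : K) * B2 ^ 2 * i2 ^ 2 * iq * iu2 ^ 2 * nu ^ 2 + (192 : K) * B2 ^ 2 * i2 ^ 3 * iq * iu2 ^ 2 * nu + (-192 : K) * i2 ^ 3 * iq * iu2 ^ 2 * nu ^ 2 + (-192 : K) * d * i2 ^ 5 * iu2 ^ 2 + (-384 : K) * B2 * i2 ^ 2 * iq * iu2 ^ 2 * nu ^ 2 + (-576 : K) * B2 * i2 ^ 3 * iq * iu2 ^ 2 * nu + (-96 : K) * B2 ^ 2 * i2 * iq * iu2 ^ 2 * nu ^ 2 + (96 : K) * B2 ^ 2 * i2 ^ 2 * iq * iu2 ^ 2 * nu + (456 : K) * B2 ^ 2 * i2 ^ 3 * iq * iu2 ^ 2 + (6 : K) * X0 * i2 ^ 5 * iu2 ^ 2 + (-96 : K)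 * i2 ^ 2 * iq * iu2 ^ 2 * nu ^ 2 + (-144 : K) * i2 ^ 3 * iq * iu2 ^ 2 * nu + (2 : K) * i2 ^ 5 * iu2 ^ 2 + (-96 : K) * d * i2 ^ 4 * iu2 ^ 2 + (-192 : K) * B2 * i2 * iq * iu2 ^ 2 * nu ^ 2 + (-288 : K) * B2 * i2 ^ 2 * iq * iu2 ^ 2 * nu + (192 : K) * B2 * i2 ^ 3 * iq * iu2 ^ 2 + (-8 : K) * B2 * i2 ^ 4 * iu2 ^ 2 + (-48 : K) * B2 ^ 2 * iq * iu2 ^ 2 * nu ^ 2 + (48 : K) * B2 ^ 2 * i2 * iq * iu2 ^ 2 * nu + (228 : K) * B2 ^ 2 * i2 ^ 2 * iq * iu2 ^ 2 + (8 : K) * B2 ^ 2 * i2 ^ 3 * iu2 ^ 2 + (3 : K) * X0 * i2 ^ 4 * iu2 ^ 2 + (-48 : K) * i2 * iq * iu2 ^ 2 * nu ^ 2 + (-72 : K) * i2 ^ 2 * iq * iu2 ^ 2 * nu + (48 : K) * i2 ^ 3 * iq * iu2 ^ 2 + (-5 : K) * i2 ^ 4 * iu2 ^ 2 + (-96 :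 K) * B2 * iq * iu2 ^ 2 * nu ^ 2 + (-144 : K) * B2 * i2 * iq * iu2 ^ 2 * nu + (96 : K) * B2 * i2 ^ 2 * iq * iu2 ^ 2 + (6 : K) * B2 * i2 ^ 3 * iu2 ^ 2 + (24 : K) * B2 ^ 2 * iq * iu2 ^ 2 * nu + (114 : K) * B2 ^ 2 * i2 * iq * iu2 ^ 2 + (4 : K) * B2 ^ 2 * i2 ^ 2 * iu2 ^ 2 + (-24 : K) * iq * iu2 ^ 2 * nu ^ 2 + (-36 : K) * i2 * iq * iu2 ^ 2 * nu + (24 : K) * i2 ^ 2 * iq * iu2 ^ 2 + i2 ^ 3 * iu2 ^ 2 + (-72 : K) * B2 * iq * iu2 ^ 2 * nu + (48 : K) * B2 * i2 * iq * iu2 ^ 2 + (5 : K) * B2 * i2 ^ 2 * iu2 ^ 2 + (57 : K) * B2 ^ 2 * iq * iu2 ^ 2 + (-18 : K) * iq * iu2 ^ 2 * nu + (12 : K) * i2 * iq * iu2 ^ 2 + (2 : K) * i2 ^ 2 * iu2 ^ 2 + (24 : K) * B2 * iq * iu2 ^ 2 + (6 : K) * iq * iu2 ^ 2) * hi2 +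 (i2 ^ 4 * iu2 ^ 2) * haux2 + (i2 ^ 4 * iu2 ^ 2) * hS2
  · rw [variableChange_a₃, hui, h3', h1', h1, h3, hvr, hvt]
    linear_combination (i2 * iu2) ^ 3 * haux3
  · rw [variableChange_a₄, hui, h4', h3', h2', h1', h1, h2, h3, h4, hvs, hvr, hvt, ht]
    have hbr : (16 : K) * ((3072 : K) * d ^ 2 * i2 ^ 4 + (-192 : K) * X0 * d * i2 ^ 4 + (-40 : K) * X0 * B2 * i2 ^ 4 + (-12 : K) * X0 ^ 2 * i2 ^ 4 + (-64 : K) * d * i2 ^ 4 + (128 : K) * B2 * d * i2 ^ 3 + (-8 : K) * X0 * i2 ^ 4 + (-4 : K) * X0 * B2 * i2 ^ 3 + (128 : K) * d * i2 ^ 3 + (-4 : K) * X0 * i2 ^ 3 + (-32 : K) * d * i2 ^ 2 + X0 * i2 ^ 2) = 0 := by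
        linear_combination haux4 + hF
    have hbr' := (h16.mul_right_eq_zero).mp hbr
    linear_combination (i2 * iu2) ^ 4 * hbr'
  · rw [variableChange_a₆, hui, h6', h4', h3', h2', h1', WeierstrassCurve.b₂, h1, h2, h3, h4, h6, hvr, hvt, he, ht]
    have hS6 : ((32768 : K) * d ^ 3 + (4096 : K) * B2 * d ^ 2 + (-3072 : K) * X0 * d ^ 2 + (-1536 : K) * X0 * B2 * d + (-128 : K) * X0 * B2 ^ 2 + (-384 : K) * X0 ^ 2 * d + (-60 : K) * X0 ^ 2 * B2 + (-7 : K) * X0 ^ 3 + (1024 : K) * d ^ 2 + (-384 : K) * X0 * d + (-64 : K) * X0 * B2 + (-15 : K) * X0 ^ 2 + (64 : K) * (g2 * X0 ^ 2) + (-8 : K) * X0) = 4096 * ((16384 : K) * B2 ^ 3 * nu ^ 6 + (12288 : K) * B2 ^ 2 * nu ^ 6 + (98304 : K) * B2 ^ 3 * nu ^ 5 + (3072 : K) * B2 * nu ^ 6 + (73728 : K) * B2 ^ 2 * nu ^ 5 + (227328 : K) * B2 ^ 3 * nu ^ 4 + (256 : K) * nu ^ 6 + (18432 : K) * B2 * nu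 ^ 5 + (170496 : K) * B2 ^ 2 * nu ^ 4 + (262144 : K) * B2 ^ 3 * nu ^ 3 + (1536 : K) * nu ^ 5 + (42624 : K) * B2 * nu ^ 4 + (196608 : K) * B2 ^ 2 * nu ^ 3 + (158784 : K) * B2 ^ 3 * nu ^ 2 + (3552 : K) * nu ^ 4 + (49152 : K) * B2 * nu ^ 3 + (119088 : K) * B2 ^ 2 * nu ^ 2 + (47232 : K) * B2 ^ 3 * nu + (4096 : K) * nu ^ 3 + (29772 : K) * B2 * nu ^ 2 + (35424 : K) * B2 ^ 2 * nu + (5184 : K) * B2 ^ 3 + (2481 : K) * nu ^ 2 + (8856 : K) * B2 * nu + (3888 : K) * B2 ^ 2 + (738 : K) * nu + (972 : K) * B2 + (81 : K)) * iq ^ 3 := by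
        linear_combination (iq ^ 3) * hpar6 + ((-75497472 : K) * d ^ 3 * iq ^ 2 * nu ^ 4 + (-9437184 : K) * B2 * d ^ 2 * iq ^ 2 * nu ^ 4 + (7077888 : K) * X0 * d ^ 2 * iq ^ 2 * nu ^ 4 + (3538944 : K) * X0 * B2 * d * iq ^ 2 * nu ^ 4 + (294912 : K) * X0 * B2 ^ 2 * iq ^ 2 * nu ^ 4 + (884736 : K) * X0 ^ 2 * d * iq ^ 2 * nu ^ 4 + (138240 : K) * X0 ^ 2 * B2 * iq ^ 2 * nu ^ 4 + (16128 : K) * X0 ^ 3 * iq ^ 2 * nu ^ 4 + (-2359296 : K) * d ^ 2 * iq ^ 2 * nu ^ 4 + (75497472 : K) * d ^ 3 * iq ^ 2 * nu ^ 3 + (9437184 : K) * B2 * d ^ 2 * iq ^ 2 * nu ^ 3 + (884736 : K) * X0 * d * iq ^ 2 * nu ^ 4 + (-7077888 : K) * X0 * d ^ 2 * iq ^ 2 * nu ^ 3 + (147456 : K) * X0 * B2 * iq ^ 2 * nu ^ 4 + (-3538944 : K) * X0 * B2 * d * iq ^ 2 * nu ^ 3 + (-294912 : K) * X0 * B2 ^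 2 * iq ^ 2 * nu ^ 3 + (34560 : K) * X0 ^ 2 * iq ^ 2 * nu ^ 4 + (-884736 : K) * X0 ^ 2 * d * iq ^ 2 * nu ^ 3 + (-138240 : K) * X0 ^ 2 * B2 * iq ^ 2 * nu ^ 3 + (-16128 : K) * X0 ^ 3 * iq ^ 2 * nu ^ 3 + (-147456 : K) * iq ^ 2 * nu ^ 4 * (g2 * X0 ^ 2) + (2359296 : K) * d ^ 2 * iq ^ 2 * nu ^ 3 + (160432128 : K) * d ^ 3 * iq ^ 2 * nu ^ 2 + (20054016 : K) * B2 * d ^ 2 * iq ^ 2 * nu ^ 2 + (18432 : K) * X0 * iq ^ 2 * nu ^ 4 + (-884736 : K) * X0 * d * iq ^ 2 * nu ^ 3 + (-15040512 : K) * X0 * d ^ 2 * iq ^ 2 * nu ^ 2 + (-147456 : K) * X0 * B2 * iq ^ 2 * nu ^ 3 + (-7520256 : K) * X0 * B2 * d * iq ^ 2 * nu ^ 2 + (-626688 : K) * X0 * B2 ^ 2 * iq ^ 2 * nu ^ 2 + (-34560 : K) * X0 ^ 2 * iq ^ 2 * nu ^ 3 + (-1880064 : K) * X0 ^ 2 *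 d * iq ^ 2 * nu ^ 2 + (-293760 : K) * X0 ^ 2 * B2 * iq ^ 2 * nu ^ 2 + (-34272 : K) * X0 ^ 3 * iq ^ 2 * nu ^ 2 + (147456 : K) * iq ^ 2 * nu ^ 3 * (g2 * X0 ^ 2) + (5013504 : K) * d ^ 2 * iq ^ 2 * nu ^ 2 + (-1572864 : K) * d ^ 3 * iq * nu ^ 2 + (-89653248 : K) * d ^ 3 * iq ^ 2 * nu + (-196608 : K) * B2 * d ^ 2 * iq * nu ^ 2 + (-11206656 : K) * B2 * d ^ 2 * iq ^ 2 * nu + (-18432 : K) * X0 * iq ^ 2 * nu ^ 3 + (-1880064 : K) * X0 * d * iq ^ 2 * nu ^ 2 + (147456 : K) * X0 * d ^ 2 * iq * nu ^ 2 + (8404992 : K) * X0 * d ^ 2 * iq ^ 2 * nu + (-313344 : K) * X0 * B2 * iq ^ 2 * nu ^ 2 + (73728 : K) * X0 * B2 * d * iq * nu ^ 2 + (4202496 : K) * X0 * B2 * d * iq ^ 2 * nu + (6144 : K) * X0 * B2 ^ 2 * iq * nu ^ 2 + (350208 : K) * X0 * B2 ^ 2 * iq ^ 2 * nu + (-73440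 : K) * X0 ^ 2 * iq ^ 2 * nu ^ 2 + (18432 : K) * X0 ^ 2 * d * iq * nu ^ 2 + (1050624 : K) * X0 ^ 2 * d * iq ^ 2 * nu + (2880 : K) * X0 ^ 2 * B2 * iq * nu ^ 2 + (164160 : K) * X0 ^ 2 * B2 * iq ^ 2 * nu + (336 : K) * X0 ^ 3 * iq * nu ^ 2 + (19152 : K) * X0 ^ 3 * iq ^ 2 * nu + (313344 : K) * iq ^ 2 * nu ^ 2 * (g2 * X0 ^ 2) + (-49152 : K) * d ^ 2 * iq * nu ^ 2 + (-2801664 : K) * d ^ 2 * iq ^ 2 * nu + (786432 : K) * d ^ 3 * iq * nu + (-106463232 : K) * d ^ 3 * iq ^ 2 + (98304 : K) * B2 * d ^ 2 * iq * nu + (-13307904 : K) * B2 * d ^ 2 * iq ^ 2 + (-39168 : K) * X0 * iq ^ 2 * nu ^ 2 + (18432 : K) * X0 * d * iq * nu ^ 2 + (1050624 : K) * X0 * d * iq ^ 2 * nu + (-73728 : K) * X0 * d ^ 2 * iq * nu + (9980928 : K) * X0 * d ^ 2 * iq ^ 2 + (3072 : K) * X0 * B2 * iq * nu ^ 2 +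 (175104 : K) * X0 * B2 * iq ^ 2 * nu + (-36864 : K) * X0 * B2 * d * iq * nu + (4990464 : K) * X0 * B2 * d * iq ^ 2 + (-3072 : K) * X0 * B2 ^ 2 * iq * nu + (415872 : K) * X0 * B2 ^ 2 * iq ^ 2 + (720 : K) * X0 ^ 2 * iq * nu ^ 2 + (41040 : K) * X0 ^ 2 * iq ^ 2 * nu + (-9216 : K) * X0 ^ 2 * d * iq * nu + (1247616 : K) * X0 ^ 2 * d * iq ^ 2 + (-1440 : K) * X0 ^ 2 * B2 * iq * nu + (194940 : K) * X0 ^ 2 * B2 * iq ^ 2 + (-168 : K) * X0 ^ 3 * iq * nu + (22743 : K) * X0 ^ 3 * iq ^ 2 + (-3072 : K) * iq * nu ^ 2 * (g2 * X0 ^ 2) + (-175104 : K) * iq ^ 2 * nu * (g2 * X0 ^ 2) + (24576 : K) * d ^ 2 * iq * nu + (-3326976 : K) * d ^ 2 * iq ^ 2 + (1867776 : K) * d ^ 3 * iq + (233472 : K) * B2 * d ^ 2 * iq + (384 : K) * X0 * iq * nu ^ 2 + (21888 : K) * X0 * iq ^ 2 * nu + (-9216 : K) * X0 * d * iq * nu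 + (1247616 : K) * X0 * d * iq ^ 2 + (-175104 : K) * X0 * d ^ 2 * iq + (-1536 : K) * X0 * B2 * iq * nu + (207936 : K) * X0 * B2 * iq ^ 2 + (-87552 : K) * X0 * B2 * d * iq + (-7296 : K) * X0 * B2 ^ 2 * iq + (-360 : K) * X0 ^ 2 * iq * nu + (48735 : K) * X0 ^ 2 * iq ^ 2 + (-21888 : K) * X0 ^ 2 * d * iq + (-3420 : K) * X0 ^ 2 * B2 * iq + (-399 : K) * X0 ^ 3 * iq + (1536 : K) * iq * nu * (g2 * X0 ^ 2) + (-207936 : K) * iq ^ 2 * (g2 * X0 ^ 2) + (58368 : K) * d ^ 2 * iq + (-32768 : K) * d ^ 3 + (-4096 : K) * B2 * d ^ 2 + (-192 : K) * X0 * iq * nu + (25992 : K) * X0 * iq ^ 2 + (-21888 : K) * X0 * d * iq + (3072 : K) * X0 * d ^ 2 + (-3648 : K) * X0 * B2 * iq + (1536 : K) * X0 * B2 * d + (128 : K) * X0 * B2 ^ 2 + (-855 : K) * X0 ^ 2 * iq + (384 : K) * X0 ^ 2 * d + (60 : K) * X0 ^ 2 * B2 + (7 : K) * X0 ^ 3 +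 (3648 : K) * iq * (g2 * X0 ^ 2) + (-1024 : K) * d ^ 2 + (-456 : K) * X0 * iq + (384 : K) * X0 * d + (64 : K) * X0 * B2 + (15 : K) * X0 ^ 2 + (-64 : K) * (g2 * X0 ^ 2) + (8 : K) * X0) * hiq
    have hbr6 : ((32768 : K) * d ^ 3 * i2 ^ 6 + (-3072 : K) * X0 * d ^ 2 * i2 ^ 6 + (-1280 : K) * X0 * B2 * d * i2 ^ 6 + (-384 : K) * X0 ^ 2 * d * i2 ^ 6 + (-16 : K) * X0 ^ 2 * B2 * i2 ^ 6 + (-7 : K) * X0 ^ 3 * i2 ^ 6 + (-1024 : K) * d ^ 2 * i2 ^ 6 + (-256 : K) * X0 * d * i2 ^ 6 + (-5 : K) * X0 ^ 2 * i2 ^ 6 + (1024 : K) * d ^ 2 * i2 ^ 5 + (1024 : K) * B2 * d ^ 2 * i2 ^ 4 + (-64 : K) * X0 * d * i2 ^ 5 + (-64 : K) * X0 * B2 * d * i2 ^ 4 + (-32 : K) * X0 * B2 ^ 2 * i2 ^ 4 + X0 ^ 2 * i2 ^ 5 + (-11 : K) * X0 ^ 2 * B2 * i2 ^ 4 + (-16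 : K) * X0 * B2 * i2 ^ 4 + (-3 : K) * X0 ^ 2 * i2 ^ 4 + (-2 : K) * X0 * i2 ^ 4 + (g2 * X0 ^ 2)) = i2 ^ 6 * ((32768 : K) * d ^ 3 + (4096 : K) * B2 * d ^ 2 + (-3072 : K) * X0 * d ^ 2 + (-1536 : K) * X0 * B2 * d + (-128 : K) * X0 * B2 ^ 2 + (-384 : K) * X0 ^ 2 * d + (-60 : K) * X0 ^ 2 * B2 + (-7 : K) * X0 ^ 3 + (1024 : K) * d ^ 2 + (-384 : K) * X0 * d + (-64 : K) * X0 * B2 + (-15 : K) * X0 ^ 2 + (64 : K) * (g2 * X0 ^ 2) + (-8 : K) * X0) := by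
      linear_combination (i2 ^ 6) * haux6 + (-((32 : K) * i2 ^ 5 + (16 : K) * i2 ^ 4 + (8 : K) * i2 ^ 3 + (4 : K) * i2 ^ 2 + (2 : K) * i2 + (1 : K)) * ((32768 : K) * d ^ 3 * i2 ^ 6 + (-3072 : K) * X0 * d ^ 2 * i2 ^ 6 + (-1280 : K) * X0 * B2 * d * i2 ^ 6 + (-384 : K) * X0 ^ 2 * d * i2 ^ 6 + (-16 : K) * X0 ^ 2 * B2 * i2 ^ 6 + (-7 : K) * X0 ^ 3 * i2 ^ 6 + (-1024 : K) * d ^ 2 * i2 ^ 6 + (-256 : K) * X0 * d * i2 ^ 6 + (-5 : K) * X0 ^ 2 * i2 ^ 6 + (1024 : K) * d ^ 2 * i2 ^ 5 + (1024 : K) * B2 * d ^ 2 * i2 ^ 4 + (-64 : K) * X0 * d * i2 ^ 5 + (-64 : K) * X0 * B2 * d * i2 ^ 4 + (-32 : K) * X0 * B2 ^ 2 * i2 ^ 4 + X0 ^ 2 * i2 ^ 5 + (-11 : K) * X0 ^ 2 * B2 * i2 ^ 4 + (-16 : K) * X0 * B2 * i2 ^ 4 + (-3 : K) * X0 ^ 2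 * i2 ^ 4 + (-2 : K) * X0 * i2 ^ 4 + (g2 * X0 ^ 2))) * hi2
    linear_combination (i2 ^ 6 * iu2 ^ 6) * hbr6 + (i2 ^ 12 * iu2 ^ 6) * hS6 +
      (((16384 : K) * B2 ^ 3 * nu ^ 6 + (12288 : K) * B2 ^ 2 * nu ^ 6 + (98304 : K) * B2 ^ 3 * nu ^ 5 + (3072 : K) * B2 * nu ^ 6 + (73728 : K) * B2 ^ 2 * nu ^ 5 + (227328 : K) * B2 ^ 3 * nu ^ 4 + (256 : K) * nu ^ 6 + (18432 : K) * B2 * nu ^ 5 + (170496 : K) * B2 ^ 2 * nu ^ 4 + (262144 : K) * B2 ^ 3 * nu ^ 3 + (1536 : K) * nu ^ 5 + (42624 : K) * B2 * nu ^ 4 + (196608 : K) * B2 ^ 2 * nu ^ 3 + (158784 : K) * B2 ^ 3 * nu ^ 2 + (3552 : K) * nu ^ 4 + (49152 : K) * B2 * nu ^ 3 + (119088 : K) * B2 ^ 2 * nu ^ 2 + (47232 : K) * B2 ^ 3 * nu + (4096 : K) * nu ^ 3 + (29772 : K) * B2 * nu ^ 2 + (35424 : K) * B2 ^ 2 * nu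 + (5184 : K) * B2 ^ 3 + (2481 : K) * nu ^ 2 + (8856 : K) * B2 * nu + (3888 : K) * B2 ^ 2 + (738 : K) * nu + (972 : K) * B2 + (81 : K)) * iq ^ 3 * iu2 ^ 6 * ((2048 : K) * i2 ^ 11 + (1024 : K) * i2 ^ 10 + (512 : K) * i2 ^ 9 + (256 : K) * i2 ^ 8 + (128 : K) * i2 ^ 7 + (64 : K) * i2 ^ 6 + (32 : K) * i2 ^ 5 + (16 : K) * i2 ^ 4 + (8 : K) * i2 ^ 3 + (4 : K) * i2 ^ 2 + (2 : K) * i2 + (1 : K))) * hi2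

end Curve

/-! ## §4 Dwork's `V = u₂²·A·Tₙ⁻²` equals `𝔇²·(𝒬𝒰²)⁻¹` -/

section DworkV

variable [Algebra ℚ K] [IsDomain K] {X0 B2 g2 d i2 : K} {A T Tn cA cU cQ cD : K⟦X⟧} (μ : Kˣ)

/-- **`V = u₂²·A·Tₙ⁻² = 𝔇²·(𝒬𝒰²)⁻¹`** (`T = 2zTₙ`, `Tₙ(0) = u₂`, `T𝔇 = u₂z(2 − z)Xs𝒰`, `𝒜𝒬 = (2 − z)²Xs²`, `𝒜 = 4A`): Dwork's unit series of
`dworkShape_of_sq_functionalEquation_unit` in closed, manifestly integral form. [cite: BlakestadGrant2023, Prop. 13] -/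
theorem frobModel_V_eq (hi2 : (2 : K) * i2 = 1) (hμ : (μ : K) = 1 + 2 * B2) (hA : A = V.formalXMulSq - C X0 * C i2 ^ 2 * X ^ 2)
    (hcA : cA = 4 * V.formalXMulSq - C X0 * X ^ 2) (hT2 : cA * cQ = (2 - X) ^ 2 * V.formalXMulSq ^ 2)
    (hQ0 : constantCoeff cQ = 1) (hU0 : constantCoeff cU = 1)
    (hT0 : constantCoeff T = 0) (hT1 : coeff 1 T = 2 * (1 + 2 * B2)) (hTn : sigmaShift T = C (2 : K) * Tn)
    (hTD : T * cD = (1 + 2 * C B2) * X * (2 - X) * V.formalXMulSq * cU) :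
    C ((μ : K) ^ 2) * A * invOfUnit (Tn ^ 2) (μ ^ 2) = cD ^ 2 * invOfUnit (cQ * cU ^ 2) 1 := by
  have h2K : IsUnit (2 : K) := isUnit_two_ratAlgebra
  have hTn0 : constantCoeff Tn = μ := by
    have e := congrArg constantCoeff hTn
    rw [constantCoeff_sigmaShift, hT1, map_mul, constantCoeff_C] at e
    have e' : (2 : K) * (constantCoeff Tn - (1 + 2 * B2)) = 0 := by linear_combination -e
    rw [hμ]; exact (sub_eq_zero.mp ((h2K.mul_right_eq_zero).mp e'))
  have hinvT : Tn ^ 2 * invOfUnit (Tn ^ 2) (μ ^ 2) = 1 :=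
    mul_invOfUnit (Tn ^ 2) (μ ^ 2) (by rw [map_pow, hTn0, Units.val_pow_eq_pow_val])
  have hinvQ : (cQ * cU ^ 2) * invOfUnit (cQ * cU ^ 2) 1 = 1 :=
    mul_invOfUnit _ 1 (by rw [map_mul, map_pow, hQ0, hU0, Units.val_one]; ring)
  have hTX : T = C (2 : K) * X * Tn := by rw [← X_mul_sigmaShift hT0, hTn]; ring
  have hC2 : (2 : K⟦X⟧) * C i2 = 1 := by rw [← map_ofNat (C (R := K)) 2, ← map_mul, hi2, map_one]
  have hμC : (C ((μ : K) ^ 2) : K⟦X⟧) = (1 + 2 * C B2) ^ 2 := by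
    rw [hμ, map_pow, map_add, map_one, map_mul, map_ofNat]
  have h2C : (C (2 : K) : K⟦X⟧) = 2 := map_ofNat _ 2
  set Xs := V.formalXMulSq with hXs
  set W := Tn ^ 2 * (cQ * cU ^ 2) * X ^ 2 with hW
  have key : (C ((μ : K) ^ 2) * A * invOfUnit (Tn ^ 2) (μ ^ 2) - cD ^ 2 * invOfUnit (cQ * cU ^ 2) 1) * W = 0 := by
    rw [hW, hμC, hA]
    rw [h2C] at hTX
    subst hcA
    linear_combination ((1 + 2 * C B2) ^ 2 * (Xs - C X0 * C i2 ^ 2 * X ^ 2) * cQ * cU ^ 2 * X ^ 2) * hinvT +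
      (-(cD ^ 2 * Tn ^ 2 * X ^ 2)) * hinvQ +
      (-(C i2 ^ 2 * (T * cD + (1 + 2 * C B2) * X * (2 - X) * Xs * cU))) * hTD +
      (C i2 ^ 2 * cD ^ 2 * (T + 2 * X * Tn)) * hTX +
      (C i2 ^ 2 * (1 + 2 * C B2) ^ 2 * X ^ 2 * cU ^ 2) * hT2 +
      (-((1 + 2 * C B2) ^ 2 * X ^ 2 * cU ^ 2 * cQ * Xs * (2 * C i2 + 1)) + (2 * C i2 + 1) * cD ^ 2 * X ^ 2 * Tn ^ 2) * hC2
  have hW0 : W ≠ 0 := by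
    have hTn : Tn ≠ 0 := fun h => by
      have := hTn0; rw [h, map_zero] at this; exact μ.ne_zero this.symm
    have hQ : cQ ≠ 0 := fun h => by rw [h, map_zero] at hQ0; exact zero_ne_one hQ0
    have hU : cU ≠ 0 := fun h => by rw [h, map_zero] at hU0; exact zero_ne_one hU0
    exact mul_ne_zero (mul_ne_zero (pow_ne_zero 2 hTn) (mul_ne_zero hQ (pow_ne_zero 2 hU))) (pow_ne_zero 2 X_ne_zero)
  exact sub_eq_zero.mp ((mul_eq_zero.mp key).resolve_right hW0)

end DworkV

end FrobeniusModel

end Literature.NumberTheory.EllipticCurves.PadicSigmaSqTwo.MazurTate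

end Part8

/-!
## Part 9 — port of `Summits/BirchSwinnertonDyer/BirchSwinnertonDyer/Theorems/AlignedTransportAtTwoBSDOfMainConjectureRankOneAtTwoSigmaSqTwoDworkGlue.lean`

# Glue lemmas for the Dwork step of the `σ²`-at-`2` discharge: base change of the closed-form series, of the Frobenius model, and the
# coefficient bookkeeping `T ≡ z²`, `V ≡ 1 (mod 2)` read through a ring map (step S6 of the plan for the PRINT stub `stub_sigmaSqTwo`)

Cell `bsd-f1-sign2`, WIDTH-5 attach seat `bsd-line-att-p3` g9 (`--supports stmt-BirchSwinnertonDyer-23008`; plan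
`Cruxes/BSDOfMainConjectureRankOneAtTwo/SIGMASQ-AT-TWO-att-p3.md` §8). THEOREMS ONLY, over ABSTRACT commutative rings and a ring map `φ : A → B`
(instantiated with `R̂₂ → K₂ = R̂₂[1/2]` in `…SigmaSqTwoExistence.lean`; keeping these manipulations abstract keeps the elaboration of the concrete
`2`-adic completion cheap). BSD is not proved by any of this.

* `frob_map_series` — `𝒜, 𝒰, 𝒬, 𝒢, 𝔇, N₂` commute with `φ`;  `frobModel_curve_map` — the Frobenius model is `⟨1, b₂′, 0, 0, b₆′⟩^φ`;
* `frob_T_eq_map`, `frob_V_eq_map` — `T = φ_*(N₂·𝔇⁻¹)`, `V = φ_*(𝔇²·(𝒬𝒰²)⁻¹)`;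
* `frob_dwork_hφ`, `frob_dwork_hu`, `frob_dwork_hu0` — the hypotheses `hφ`, `hu`, `hu0` of the tree's Dwork lemma
  `Literature.RingTheory.FormalGroups.coeff_mem_of_map_subst_eq_pow_mul` from `frob_coeff_N2_sub_mem` / `frob_coeff_calD_sq_sub_mem`;
* small normal-form lemmas (`frob_sigmaShift_two`, `frob_map_sigmaShift_sq`, `frob_coeff_sq_mem`, `frob_coeff_one_sigmaShift_sq_eq_one`, …).

## Sources
C. Blakestad, D. Grant, J. Number Theory 249 (2023), Lemma 5, Cor. 6, Prop. 13 [cite: BlakestadGrant2023, Prop. 13]; N. Koblitz, GTM 58, Ch. IV §2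
Lemma 3 [cite: Koblitz1984, Ch. IV §2 Lemma 3].
-/

section Part9


set_option autoImplicit false

open scoped _root_.Classical
open _root_.PowerSeries _root_.WeierstrassCurve _root_.Literature.NumberTheory.EllipticCurves

namespace Literature.NumberTheory.EllipticCurves.PadicSigmaSqTwo.MazurTate

/-- Coefficients of `f·g` lie in an ideal containing all coefficients of `f`. [folklore] -/
private theorem coeff_mul_mem_of_coeff_mem {A : Type*} [CommRing A] (I : Ideal A) {f : A⟦X⟧} (hf : ∀ n, coeff n f ∈ I) (g : A⟦X⟧) (n : ℕ) :
    coeff n (f * g) ∈ I := by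
  refine coeff_mem_of_map_mk_eq_zero I ?_ n
  have h0 : PowerSeries.map (Ideal.Quotient.mk I) f = 0 := by
    ext k; rw [coeff_map, map_zero, Ideal.Quotient.eq_zero_iff_mem]; exact hf k
  rw [map_mul, h0, zero_mul]

/-- In a commutative ring two right inverses of the same element agree. [folklore] -/
private theorem inv_unique_aux {A : Type*} [CommRing A] {u a b : A} (ha : u * a = 1) (hb : u * b = 1) : a = b := by
  calc a = a * (u * b) := by rw [hb, mul_one]
    _ = (u * a) * b := by ring
    _ = b := by rw [ha, one_mul]

/-- The closed-form series `𝒜, 𝒰, 𝒬, 𝒢, 𝔇, N₂` commute with base change along a ring map `φ`. [folklore] -/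
private theorem frob_map_series {A B : Type*} [CommRing A] [CommRing B] (φ : A →+* B) (V : WeierstrassCurve A) (W : WeierstrassCurve B)
    (hW : W = V.map φ) {X0 B2 g2 d : A} {cA cU cQ cG cD : A⟦X⟧} {cA' cU' cQ' cG' cD' : B⟦X⟧}
    (hA : cA = 4 * V.formalXMulSq - C X0 * X ^ 2)
    (hU : cU = V.formalXMulSq ^ 2 - 8 * C d * V.formalXMulSq * X ^ 2 + 2 * (C d * C X0 - 4 * C g2 * C X0) * X ^ 4)
    (hQ : cQ = V.formalXMulSq ^ 2 - 16 * C g2 * V.formalXMulSq * X ^ 2 - 4 * C g2 * C X0 * X ^ 4)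
    (hG : cG = (-C B2 - 32 * C g2) * V.formalXMulSq ^ 2 - 4 * (1 + 2 * C B2) * C d * V.formalXMulSq * X ^ 2 +
        (1 + 2 * C B2) * (C d * C X0 - 4 * C g2 * C X0) * X ^ 4 - 8 * C g2 * C X0 * V.formalXMulSq * X ^ 2 -
        2 * C g2 * C X0 ^ 2 * X ^ 4)
    (hD : cD = (1 + 2 * C B2) * X * V.formalXMulSq * cU + V.formalXMulSq ^ 2 * cQ + 8 * C g2 * C X0 * X ^ 4 * cQ -
        X ^ 2 * V.formalXMulSq * cG)
    (hA' : cA' = 4 * W.formalXMulSq - C (φ X0) * X ^ 2)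
    (hU' : cU' = W.formalXMulSq ^ 2 - 8 * C (φ d) * W.formalXMulSq * X ^ 2 + 2 * (C (φ d) * C (φ X0) - 4 * C (φ g2) * C (φ X0)) * X ^ 4)
    (hQ' : cQ' = W.formalXMulSq ^ 2 - 16 * C (φ g2) * W.formalXMulSq * X ^ 2 - 4 * C (φ g2) * C (φ X0) * X ^ 4)
    (hG' : cG' = (-C (φ B2) - 32 * C (φ g2)) * W.formalXMulSq ^ 2 - 4 * (1 + 2 * C (φ B2)) * C (φ d) * W.formalXMulSq * X ^ 2 +
        (1 + 2 * C (φ B2)) * (C (φ d) * C (φ X0) - 4 * C (φ g2) * C (φ X0)) * X ^ 4 - 8 * C (φ g2) * C (φ X0) * W.formalXMulSq * X ^ 2 -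
        2 * C (φ g2) * C (φ X0) ^ 2 * X ^ 4)
    (hD' : cD' = (1 + 2 * C (φ B2)) * X * W.formalXMulSq * cU' + W.formalXMulSq ^ 2 * cQ' + 8 * C (φ g2) * C (φ X0) * X ^ 4 * cQ' -
        X ^ 2 * W.formalXMulSq * cG') :
    PowerSeries.map φ cA = cA' ∧ PowerSeries.map φ cU = cU' ∧ PowerSeries.map φ cQ = cQ' ∧ PowerSeries.map φ cG = cG' ∧
      PowerSeries.map φ cD = cD' ∧
      PowerSeries.map φ ((1 + 2 * C B2) * X * (2 - X) * V.formalXMulSq * cU) = (1 + 2 * C (φ B2)) * X * (2 - X) * W.formalXMulSq * cU' := by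
  subst hW hA hU hQ hG hD hA' hU' hQ' hG' hD'
  simp only [map_sub, map_add, map_neg, map_mul, map_pow, map_C, map_X, map_ofNat, map_one, map_formalXMulSq, and_self]

/-- **The Frobenius model is the base change of the chart curve `⟨1, b₂′, 0, 0, b₆′⟩` over the coefficient ring** (`frobModel_curve` read
through a ring map `φ : A → K`, with `b₂′, b₆′ ∈ A` in the normal form of `frobParam_beta2/6_sub_mem`). [cite: BlakestadGrant2023, Prop. 7] -/
theorem frobModel_curve_map {A K : Type*} [CommRing A] [CommRing K] [Algebra ℚ K] (φ : A →+* K) (V V' : WeierstrassCurve K)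
    (vc : VariableChange K) {B2 nu iq iu2 : A} {X0K B2K g2K dK i2 iqK iu2K nuK e t : K}
    (hB2 : φ B2 = B2K) (hnu : φ nu = nuK) (hiqφ : φ iq = iqK) (hiu2φ : φ iu2 = iu2K)
    (h1 : V.a₁ = 1) (h2 : V.a₂ = B2K) (h3 : V.a₃ = 0) (h4 : V.a₄ = 0) (h6 : V.a₆ = g2K * X0K ^ 2)
    (hX0 : X0K = -1 - 4 * B2K - 64 * g2K) (hi2 : (2 : K) * i2 = 1)
    (hiq : 3 * ((1 + 4 * nuK) ^ 2 - 4 * (1 + 4 * nuK) - 16) * iqK = 1) (hiu2 : (1 + 2 * B2K) * iu2K = 1)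
    (hg2 : g2K = (1 + 4 * B2K) * (1 + nuK) * iqK) (hd : dK = -(1 + 4 * nuK) * g2K)
    (he : e = X0K * i2 ^ 2) (ht : t = (3 * X0K ^ 2 + 8 * B2K * X0K + 2 * X0K) * i2 ^ 4)
    (h1' : V'.a₁ = V.a₁) (h2' : V'.a₂ = V.a₂) (h3' : V'.a₃ = V.a₃) (h4' : V'.a₄ = V.a₄ - 5 * t)
    (h6' : V'.a₆ = V.a₆ - V.b₂ * t - 7 * e * t)
    (hvu : (vc.u : K) = 2 * (1 + 2 * B2K)) (hvr : vc.r = (-X0K + 32 * dK) * i2 ^ 2) (hvs : vc.s = (1 + 2 * B2K) - i2)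
    (hvt : vc.t = -((-X0K + 32 * dK) * i2 ^ 2) * i2) :
    vc • V' = (⟨1, (-48 * B2 ^ 2 * nu ^ 2 - 96 * B2 * nu ^ 2 + 24 * B2 ^ 2 * nu - 24 * nu ^ 2 - 72 * B2 * nu + 57 * B2 ^ 2 - 18 * nu +
      24 * B2 + 6) * iq * iu2 ^ 2, 0, 0,
      (16384 * B2 ^ 3 * nu ^ 6 + 12288 * B2 ^ 2 * nu ^ 6 + 98304 * B2 ^ 3 * nu ^ 5 + 3072 * B2 * nu ^ 6 +
        73728 * B2 ^ 2 * nu ^ 5 + 227328 * B2 ^ 3 * nu ^ 4 + 256 * nu ^ 6 + 18432 * B2 * nu ^ 5 + 170496 * B2 ^ 2 * nu ^ 4 +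
        262144 * B2 ^ 3 * nu ^ 3 + 1536 * nu ^ 5 + 42624 * B2 * nu ^ 4 + 196608 * B2 ^ 2 * nu ^ 3 + 158784 * B2 ^ 3 * nu ^ 2 +
        3552 * nu ^ 4 + 49152 * B2 * nu ^ 3 + 119088 * B2 ^ 2 * nu ^ 2 + 47232 * B2 ^ 3 * nu + 4096 * nu ^ 3 + 29772 * B2 * nu ^ 2 +
        35424 * B2 ^ 2 * nu + 5184 * B2 ^ 3 + 2481 * nu ^ 2 + 8856 * B2 * nu + 3888 * B2 ^ 2 + 738 * nu + 972 * B2 + 81) *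
        iq ^ 3 * iu2 ^ 6⟩ : WeierstrassCurve A).map φ := by
  rw [frobModel_curve V V' vc h1 h2 h3 h4 h6 hX0 hi2 hiq hiu2 hg2 hd he ht h1' h2' h3' h4' h6' hvu hvr hvs hvt]
  ext
  · rw [map_a₁, map_one]
  · rw [map_a₂, ← hB2, ← hnu, ← hiqφ, ← hiu2φ]
    simp only [map_mul, map_add, map_sub, map_neg, map_pow, map_ofNat]
    ring
  · rw [map_a₃, map_zero]
  · rw [map_a₄, map_zero]
  · rw [map_a₆, ← hB2, ← hnu, ← hiqφ, ← hiu2φ]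
    simp only [map_mul, map_add, map_pow, map_ofNat]


section Glue

variable {A B : Type*} [CommRing A] [CommRing B] (φ : A →+* B)

/-- `A = Xs − e·z²` with `e = X₀·i₂²`, `C` distributed. [folklore] -/
private theorem frob_A_normalForm {Xs A' : B⟦X⟧} {e X0 i2 : B} (hA : A' = Xs - C e * X ^ 2) (he : e = X0 * i2 ^ 2) :
    A' = Xs - C X0 * C i2 ^ 2 * X ^ 2 := by rw [hA, he, map_mul, map_pow]

/-- `Dn(0) = 1` for Vélu's denominator. [cite: BlakestadGrant2023, Lemma 12] -/
theorem frob_constantCoeff_Dn (V : WeierstrassCurve B) {e f t : B} {A' Dn : B⟦X⟧} (hA : A' = V.formalXMulSq - C e * X ^ 2)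
    (hDn : Dn = V.formalXMulSq * A' ^ 2 + C t * X ^ 4 * (C V.a₁ * X * A' - V.formalXMulSq - C f * X ^ 3)) :
    constantCoeff Dn = 1 := by
  have hA0 : constantCoeff A' = 1 := by
    rw [hA, map_sub, map_mul, map_pow, constantCoeff_X, constantCoeff_formalXMulSq]; ring
  rw [hDn, map_add, map_mul, map_mul, map_mul, map_pow, map_pow, constantCoeff_X, constantCoeff_formalXMulSq, hA0]; ring

/-- Base change of a normalised series: `σ^φ(0) = 0`, `[z¹]σ^φ = 1`. [folklore] -/
private theorem frob_map_normalised (α : B →+* B) {σ σ'' : B⟦X⟧} (hσ'' : σ'' = PowerSeries.map α σ) (h0 : constantCoeff σ = 0)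
    (h1 : coeff 1 σ = 1) : constantCoeff σ'' = 0 ∧ coeff 1 σ'' = 1 := by
  subst hσ''
  refine ⟨?_, by rw [coeff_map, h1, map_one]⟩
  rw [← coeff_zero_eq_constantCoeff_apply, coeff_map, coeff_zero_eq_constantCoeff_apply, h0, map_zero]

/-- `T/z = 2·Tₙ` with `Tₙ = i₂·(T/z)`, `Tₙ(0) = u₂` when `[z¹]T = 2u₂`, `2i₂ = 1`. [folklore] -/
private theorem frob_sigmaShift_two {i2 u2 : B} (hi2 : (2 : B) * i2 = 1) {T Tn : B⟦X⟧} (hTn : Tn = C i2 * sigmaShift T)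
    (hT1 : coeff 1 T = 2 * u2) : sigmaShift T = C (2 : B) * Tn ∧ constantCoeff Tn = u2 := by
  subst hTn
  have hC2 : (C (2 : B) : B⟦X⟧) * C i2 = 1 := by rw [← map_mul, hi2, map_one]
  refine ⟨by rw [← mul_assoc, hC2, one_mul], ?_⟩
  rw [map_mul, constantCoeff_C, constantCoeff_sigmaShift, hT1]
  linear_combination u2 * hi2

/-- `(σ^α/z)² = (H)^α` for `H = (σ/z)²`. [folklore] -/
private theorem frob_map_sigmaShift_sq (α : B →+* B) {σ σ'' H : B⟦X⟧} (hσ'' : σ'' = PowerSeries.map α σ) (hH : H = sigmaShift σ ^ 2) :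
    PowerSeries.map α H = sigmaShift σ'' ^ 2 := by
  rw [hH, hσ'', map_pow, sigmaShift_map]

/-- `H(0) = 1` and `[z¹]H = a₁ = 1` for `H = (σ/z)²`, `σ` Mazur–Tate odd and normalised on an `a₁ = 1` curve.
[cite: MazurSteinTate2006, Thm. 1.3] -/
theorem frob_H_coeffs (W : WeierstrassCurve B) (h1 : W.a₁ = 1) {σ H : B⟦X⟧} (hH : H = sigmaShift σ ^ 2) (hσ0 : constantCoeff σ = 0)
    (hσ1 : coeff 1 σ = 1) (hodd : W.IsFormallyOdd σ) : constantCoeff H = 1 ∧ coeff 1 H = 1 := by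
  subst hH
  refine ⟨by rw [map_pow, constantCoeff_sigmaShift, hσ1, one_pow], ?_⟩
  rw [coeff_one_sigmaShift_sq hσ1, WeierstrassCurve.two_mul_coeff_two_of_isFormallyOdd W hodd hσ0 hσ1, h1]

/-- `σ² = z²·H ∈ S⟦z⟧` when `H ∈ S⟦z⟧`. [folklore] -/
private theorem frob_coeff_sq_mem (S : Subring B) {σ H : B⟦X⟧} (hH : H = sigmaShift σ ^ 2) (hσ0 : constantCoeff σ = 0)
    (hmem : ∀ n, coeff n H ∈ S) (n : ℕ) : coeff n (σ ^ 2) ∈ S := by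
  have hσsq : σ ^ 2 = X ^ 2 * H := by rw [hH, ← mul_pow X (sigmaShift σ) 2, X_mul_sigmaShift hσ0]
  rw [hσsq, coeff_X_pow_mul']
  split_ifs
  · exact hmem _
  · exact zero_mem _

/-- **`T = φ_*(N₂·𝔇⁻¹)`**: if `T·𝔇^φ = N₂^φ` over `B` and `𝔇·𝔇⁻¹ = 1` over `A`. [cite: BlakestadGrant2023, Lemma 12] -/
theorem frob_T_eq_map {T cDK N2K : B⟦X⟧} {cDR invD N2R TR : A⟦X⟧} (hTD : T * cDK = N2K) (hmapD : PowerSeries.map φ cDR = cDK)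
    (hmapN : PowerSeries.map φ N2R = N2K) (hinv : cDR * invD = 1) (hTR : TR = N2R * invD) : T = PowerSeries.map φ TR := by
  have e1 : PowerSeries.map φ cDR * PowerSeries.map φ invD = 1 := by rw [← map_mul, hinv, map_one]
  calc T = T * (PowerSeries.map φ cDR * PowerSeries.map φ invD) := by rw [e1, mul_one]
    _ = (T * cDK) * PowerSeries.map φ invD := by rw [hmapD]; ring
    _ = PowerSeries.map φ TR := by rw [hTD, ← hmapN, hTR, map_mul]

/-- **`V = φ_*(𝔇²·(𝒬𝒰²)⁻¹)`**. [cite: BlakestadGrant2023, Prop. 13] -/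
theorem frob_V_eq_map {VD cDK cQK cUK : B⟦X⟧} {cDR cQR cUR invQ VR : A⟦X⟧} (hVeq : VD = cDK ^ 2 * invOfUnit (cQK * cUK ^ 2) 1)
    (hmapD : PowerSeries.map φ cDR = cDK) (hmapQ : PowerSeries.map φ cQR = cQK) (hmapU : PowerSeries.map φ cUR = cUK)
    (hQ0 : constantCoeff cQR = 1) (hU0 : constantCoeff cUR = 1) (hinvQ : invQ = invOfUnit (cQR * cUR ^ 2) 1)
    (hVR : VR = cDR ^ 2 * invQ) : VD = PowerSeries.map φ VR := by
  have hQU0 : constantCoeff (cQR * cUR ^ 2) = 1 := by rw [map_mul, map_pow, hQ0, hU0]; ring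
  rw [hVeq, hVR, map_mul, map_pow, hmapD, hinvQ, Literature.NumberTheory.EllipticCurves.map_invOfUnit_one φ _ hQU0, map_mul, map_pow,
    hmapQ, hmapU]

/-- **Dwork's `hφ`**: `T = φ_*(N₂𝔇⁻¹)` with `N₂ − z²𝔇 ∈ 2A⟦z⟧` ⟹ `[zⁿ]T = δ_{n,2} + 2a`, `a ∈ φ(A)`. [cite: Koblitz1984, Ch. IV §2 Lemma 3] -/
theorem frob_dwork_hφ {T : B⟦X⟧} {cDR invD N2R TR : A⟦X⟧} (hinv : cDR * invD = 1) (hTR : TR = N2R * invD)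
    (hmem : ∀ n, coeff n (N2R - X ^ 2 * cDR) ∈ Ideal.span {(2 : A)}) (hT : T = PowerSeries.map φ TR) (n : ℕ) :
    ∃ a ∈ φ.range, coeff n T = (if n = 2 then 1 else 0) + ((2 : ℕ) : B) * a := by
  have hdiff : TR - X ^ 2 = (N2R - X ^ 2 * cDR) * invD := by rw [hTR]; linear_combination (X ^ 2) * hinv
  have hm : coeff n (TR - X ^ 2) ∈ Ideal.span {(2 : A)} := by rw [hdiff]; exact coeff_mul_mem_of_coeff_mem _ hmem _ n
  obtain ⟨a, ha⟩ := Ideal.mem_span_singleton'.mp hm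
  refine ⟨φ a, ⟨a, rfl⟩, ?_⟩
  have e : coeff n TR = (if n = 2 then 1 else 0) + a * 2 := by
    rw [map_sub, coeff_X_pow] at ha
    linear_combination -ha
  rw [hT, coeff_map, Nat.cast_ofNat, e, map_add, map_mul, map_ofNat]
  split_ifs <;> simp [mul_comm]

/-- **Dwork's `hu0`, `hu`**: `V = φ_*(𝔇²(𝒬𝒰²)⁻¹)` with `𝔇² − 𝒬𝒰² ∈ 2A⟦z⟧` ⟹ `V(0) = 1`, `[zⁿ⁺¹]V = 2a`, `a ∈ φ(A)`.
[cite: Koblitz1984, Ch. IV §2 Lemma 3] -/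
theorem frob_dwork_hu {VD : B⟦X⟧} {cDR cQR cUR invQ VR : A⟦X⟧} (hQ0 : constantCoeff cQR = 1) (hU0 : constantCoeff cUR = 1)
    (hD0 : constantCoeff cDR = 1) (hinvQ : invQ = invOfUnit (cQR * cUR ^ 2) 1) (hVR : VR = cDR ^ 2 * invQ)
    (hmem : ∀ n, coeff n (cDR ^ 2 - cQR * cUR ^ 2) ∈ Ideal.span {(2 : A)}) (hV : VD = PowerSeries.map φ VR) :
    constantCoeff VD = 1 ∧ ∀ n, ∃ a ∈ φ.range, coeff (n + 1) VD = ((2 : ℕ) : B) * a := by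
  have hQU0 : constantCoeff (cQR * cUR ^ 2) = 1 := by rw [map_mul, map_pow, hQ0, hU0]; ring
  have hinvQ1 : (cQR * cUR ^ 2) * invQ = 1 := by rw [hinvQ]; exact mul_invOfUnit _ 1 (by rw [hQU0, Units.val_one])
  have hVR0 : constantCoeff VR = 1 := by
    rw [hVR, map_mul, map_pow, hD0, hinvQ, constantCoeff_invOfUnit, inv_one, Units.val_one]; ring
  refine ⟨by rw [hV, ← coeff_zero_eq_constantCoeff_apply, coeff_map, coeff_zero_eq_constantCoeff_apply, hVR0, map_one], fun n => ?_⟩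
  have hdiff : VR - 1 = (cDR ^ 2 - cQR * cUR ^ 2) * invQ := by rw [hVR]; linear_combination hinvQ1
  have hm : coeff (n + 1) (VR - 1) ∈ Ideal.span {(2 : A)} := by rw [hdiff]; exact coeff_mul_mem_of_coeff_mem _ hmem _ (n + 1)
  obtain ⟨a, ha⟩ := Ideal.mem_span_singleton'.mp hm
  refine ⟨φ a, ⟨a, rfl⟩, ?_⟩
  have e : coeff (n + 1) VR = a * 2 := by
    rw [map_sub, coeff_one, if_neg (Nat.succ_ne_zero n), sub_zero] at ha
    exact ha.symm
  rw [hV, coeff_map, e, map_mul, map_ofNat, Nat.cast_ofNat, mul_comm]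

end Glue

end Literature.NumberTheory.EllipticCurves.PadicSigmaSqTwo.MazurTate

end Part9

/-!
## Part 10 — port of `Summits/BirchSwinnertonDyer/BirchSwinnertonDyer/Theorems/AlignedTransportAtTwoBSDOfMainConjectureRankOneAtTwoSigmaSqTwoDworkPackage.lean`

# The Dwork package of the `σ²`-at-`2` discharge over an ABSTRACT coefficient map `φ : A → K`: from an odd normalised solution `σ` on the
# chart curve `V^φ` and the Frobenius-model data to the hypotheses `hφ0, hφ, hu0, hu, heq` of the tree's Dwork lemma (steps S3–S6 of the plan for
# the PRINT stub `stub_sigmaSqTwo` of crux C3′; route-independent)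

Cell `bsd-f1-sign2`, WIDTH-5 attach seat `bsd-line-att-p3` g9 (`--supports stmt-BirchSwinnertonDyer-23008`; plan
`Cruxes/BSDOfMainConjectureRankOneAtTwo/SIGMASQ-AT-TWO-att-p3.md` §8–§9). THEOREMS ONLY. BSD is not proved by any of this.

Everything that `…SigmaSqTwoExistence.lean` needs over `K₂ = R̂₂[1/2]`, done once over an arbitrary `ℚ`-algebra domain `K`, a coefficient ring `A` with
`φ : A →+* K`, a Frobenius-type pair `α₀ : A → A`, `α : K → K` with `α ∘ φ = φ ∘ α₀`, the chart curve `V = ⟨1, B₂, 0, 0, g₂X₀²⟩/A` in the rational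
parametrisation of `…FrobeniusParam.lean`, `V^{α₀} = ⟨1, b₂′, 0, 0, b₆′⟩`, the fixed-point constant `4u₂²α₀(c) − 2c = 8δ`, `2·i₂ = 1` in `K`, and an odd
normalised solution `σ` of the sigma equation on `V^φ` with constant `φ(c)`:
**`frob_dwork_package`** — there are `T, V_D ∈ K⟦z⟧` with `T(0) = 0`, `[zⁿ]T = δ_{n,2} + 2a`, `V_D(0) = 1`, `[zⁿ⁺¹]V_D = 2a` (all `a ∈ φ(A)`) and
`(α_*H)(T) = H²·V_D` for `H = (σ/z)²` — by Vélu (`…VeluFormal/Transport`), the Frobenius model (`…FrobeniusModel`), the squared functional equation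
(`…DomainFE`), Dwork's shape (`…DworkShape`) and the closed forms / congruences (`…FrobeniusSeries`, `…DworkGlue`). Keeping this abstract keeps the
elaboration over the concrete `2`-adic completion small.

## Sources
C. Blakestad, D. Grant, J. Number Theory 249 (2023), Prop. 7, Lemma 12, Prop. 13 [cite: BlakestadGrant2023, Prop. 13]; J. Vélu, C. R. Acad. Sci. Paris 273 (1971)
[cite: SilvermanAEC2009, III.4]; N. Koblitz, GTM 58, Ch. IV §2 Lemma 3 [cite: Koblitz1984, Ch. IV §2 Lemma 3].
-/

section Part10


set_option autoImplicit false

open scoped _root_.Classical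
open _root_.PowerSeries _root_.WeierstrassCurve _root_.Literature.NumberTheory.EllipticCurves

namespace Literature.NumberTheory.EllipticCurves.PadicSigmaSqTwo.MazurTate

/-- **The Dwork package** (see the module docstring). [cite: BlakestadGrant2023, Prop. 13] [cite: Koblitz1984, Ch. IV §2 Lemma 3] -/
theorem frob_dwork_package {A K : Type*} [CommRing A] [CommRing K] [Algebra ℚ K] [IsDomain K] (φ : A →+* K) (α₀ : A →+* A) (α : K →+* K)
    (hαφ : α.comp φ = φ.comp α₀) {B2 nu iq iu2 g2 X0 d c : A}
    (hiq : 3 * ((1 + 4 * nu) ^ 2 - 4 * (1 + 4 * nu) - 16) * iq = 1) (hiu2 : (1 + 2 * B2) * iu2 = 1)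
    (hg2 : g2 = (1 + 4 * B2) * (1 + nu) * iq) (hX0 : X0 = -1 - 4 * B2 - 64 * g2) (hd : d = -(1 + 4 * nu) * g2)
    (V : WeierstrassCurve A) (hV1 : V.a₁ = 1) (hV2 : V.a₂ = B2) (hV3 : V.a₃ = 0) (hV4 : V.a₄ = 0) (hV6 : V.a₆ = g2 * X0 ^ 2)
    (hVα₀ : V.map α₀ = ⟨1, (-48 * B2 ^ 2 * nu ^ 2 - 96 * B2 * nu ^ 2 + 24 * B2 ^ 2 * nu - 24 * nu ^ 2 - 72 * B2 * nu + 57 * B2 ^ 2 - 18 * nu +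
      24 * B2 + 6) * iq * iu2 ^ 2, 0, 0,
      (16384 * B2 ^ 3 * nu ^ 6 + 12288 * B2 ^ 2 * nu ^ 6 + 98304 * B2 ^ 3 * nu ^ 5 + 3072 * B2 * nu ^ 6 +
        73728 * B2 ^ 2 * nu ^ 5 + 227328 * B2 ^ 3 * nu ^ 4 + 256 * nu ^ 6 + 18432 * B2 * nu ^ 5 + 170496 * B2 ^ 2 * nu ^ 4 +
        262144 * B2 ^ 3 * nu ^ 3 + 1536 * nu ^ 5 + 42624 * B2 * nu ^ 4 + 196608 * B2 ^ 2 * nu ^ 3 + 158784 * B2 ^ 3 * nu ^ 2 +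
        3552 * nu ^ 4 + 49152 * B2 * nu ^ 3 + 119088 * B2 ^ 2 * nu ^ 2 + 47232 * B2 ^ 3 * nu + 4096 * nu ^ 3 + 29772 * B2 * nu ^ 2 +
        35424 * B2 ^ 2 * nu + 5184 * B2 ^ 3 + 2481 * nu ^ 2 + 8856 * B2 * nu + 3888 * B2 ^ 2 + 738 * nu + 972 * B2 + 81) *
        iq ^ 3 * iu2 ^ 6⟩)
    (hc : 4 * (1 + 2 * B2) ^ 2 * α₀ c - 2 * c = 2 * (4 * d)) {i2 : K} (hi2 : (2 : K) * i2 = 1)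
    {σ : K⟦X⟧} (hσ0 : constantCoeff σ = 0) (hσ1 : coeff 1 σ = 1) (hodd : (V.map φ).IsFormallyOdd σ)
    (hODE : (V.map φ).SatisfiesSigmaODE σ (φ c)) :
    ∃ T VD : K⟦X⟧, constantCoeff T = 0 ∧ (∀ n, ∃ a ∈ φ.range, coeff n T = (if n = 2 then 1 else 0) + ((2 : ℕ) : K) * a) ∧
      constantCoeff VD = 1 ∧ (∀ n, ∃ a ∈ φ.range, coeff (n + 1) VD = ((2 : ℕ) : K) * a) ∧
      (PowerSeries.map α (sigmaShift σ ^ 2)).subst T = (sigmaShift σ ^ 2) ^ 2 * VD := by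
  -- §1 the `K₂`-side data
  obtain ⟨VK, hVK⟩ : ∃ VK : WeierstrassCurve K, VK =
      V.map φ := ⟨_, rfl⟩
  have h1 : VK.a₁ = 1 := by rw [hVK, map_a₁, hV1, map_one]
  have h2 : VK.a₂ = φ B2 := by rw [hVK, map_a₂, hV2]
  have h3 : VK.a₃ = 0 := by rw [hVK, map_a₃, hV3, map_zero]
  have h4 : VK.a₄ = 0 := by rw [hVK, map_a₄, hV4, map_zero]
  have h6 : VK.a₆ = φ g2 * φ X0 ^ 2 := by rw [hVK, map_a₆, hV6, map_mul, map_pow]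
  have hX0K : φ X0 = -1 - 4 * φ B2 - 64 * φ g2 := by
    rw [hX0]; simp only [map_sub, map_neg, map_mul, map_one, map_ofNat]
  have hg2K : φ g2 = (1 + 4 * φ B2) * (1 + φ nu) * φ iq := by
    rw [hg2]; simp only [map_add, map_mul, map_one, map_ofNat]
  have hdK : φ d = -(1 + 4 * φ nu) * φ g2 := by
    rw [hd]; simp only [map_add, map_neg, map_mul, map_one, map_ofNat]
  have hiqK : 3 * ((1 + 4 * φ nu) ^ 2 - 4 * (1 + 4 * φ nu) - 16) * φ iq = 1 := by
    have h := congrArg φ hiq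
    simp only [map_sub, map_add, map_mul, map_pow, map_one, map_ofNat] at h
    exact h
  have hiu2K : (1 + 2 * φ B2) * φ iu2 = 1 := by
    have h := congrArg φ hiu2
    simp only [map_add, map_mul, map_one, map_ofNat] at h
    exact h
  -- Vélu's data for the canonical point `Q = (X₀/4, −X₀/8)`
  obtain ⟨e, he⟩ : ∃ e : K, e =
      φ X0 * i2 ^ 2 := ⟨_, rfl⟩
  obtain ⟨f, hf⟩ : ∃ f : K, f =
      -(φ X0 * i2 ^ 3) := ⟨_, rfl⟩
  obtain ⟨t, ht⟩ : ∃ t : K, t =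
      (3 * φ X0 ^ 2 + 8 * φ B2 * φ X0 + 2 * φ X0) * i2 ^ 4 := ⟨_, rfl⟩
  obtain ⟨hQ, h2t, ht'⟩ := frobModel_point VK h1 h2 h3 h4 h6 hX0K hi2 he hf ht
  obtain ⟨As, hA⟩ : ∃ As : PowerSeries K, As =
      VK.formalXMulSq - C e * X ^ 2 := ⟨_, rfl⟩
  obtain ⟨M, hM⟩ : ∃ M : PowerSeries K, M =
      VK.formalXMulSq * As + C t * X ^ 4 := ⟨_, rfl⟩
  obtain ⟨Dn, hDn⟩ : ∃ Dn : PowerSeries K, Dn =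
      VK.formalXMulSq * As ^ 2 + C t * X ^ 4 * (C VK.a₁ * X * As - VK.formalXMulSq - C f * X ^ 3) := ⟨_, rfl⟩
  have hDn0 : constantCoeff Dn = 1 := frob_constantCoeff_Dn VK hA hDn
  obtain ⟨uD, huD⟩ : ∃ uD : PowerSeries K, uD =
      invOfUnit Dn 1 := ⟨_, rfl⟩
  have hu : Dn * uD = 1 := by rw [huD]; exact mul_invOfUnit Dn 1 (by rw [hDn0, Units.val_one])
  obtain ⟨τ, hτ⟩ : ∃ τ : PowerSeries K, τ =
      X * As * M * uD := ⟨_, rfl⟩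
  obtain ⟨P, hP⟩ : ∃ P : PowerSeries K, P =
      As * M ^ 3 * uD ^ 2 := ⟨_, rfl⟩
  obtain ⟨hτ0, hτ1⟩ := frobModel_tau_coeff VK hA hM hDn hu hτ
  obtain ⟨V', hV'⟩ : ∃ V' : WeierstrassCurve K, V' =
      ⟨VK.a₁, VK.a₂, VK.a₃, VK.a₄ - 5 * t, VK.a₆ - VK.b₂ * t - 7 * e * t⟩ := ⟨_, rfl⟩
  have h1' : V'.a₁ = VK.a₁ := by rw [hV']
  have h2' : V'.a₂ = VK.a₂ := by rw [hV']
  have h3' : V'.a₃ = VK.a₃ := by rw [hV']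
  have h4' : V'.a₄ = VK.a₄ - 5 * t := by rw [hV']
  have h6' : V'.a₆ = VK.a₆ - VK.b₂ * t - 7 * e * t := by rw [hV']
  -- the Frobenius model `vc = [2u₂; R₁/4, u₂ − ½, −R₁/8]`
  have hvunit : (2 * (1 + 2 * φ B2)) * (i2 * φ iu2) = 1 := by
    linear_combination ((1 + 2 * φ B2) * φ iu2) * hi2 + hiu2K
  obtain ⟨vc, hvc⟩ : ∃ vc : VariableChange K, vc =
      ⟨Units.mkOfMulEqOne _ _ hvunit, (-φ X0 + 32 * φ d) * i2 ^ 2, (1 + 2 * φ B2) - i2,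
    -((-φ X0 + 32 * φ d) * i2 ^ 2) * i2⟩ := ⟨_, rfl⟩
  have hvu : (vc.u : K) = 2 * (1 + 2 * φ B2) := by
    rw [hvc]; exact Units.val_mkOfMulEqOne hvunit
  have hvr : vc.r = (-φ X0 + 32 * φ d) * i2 ^ 2 := by rw [hvc]
  have hvs : vc.s = (1 + 2 * φ B2) - i2 := by rw [hvc]
  have hvt : vc.t = -((-φ X0 + 32 * φ d) * i2 ^ 2) * i2 := by rw [hvc]
  obtain ⟨T, hT⟩ : ∃ T : PowerSeries K, T =
      (V'.formalVariableChange vc).subst τ := ⟨_, rfl⟩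
  have hT0 : constantCoeff T = 0 := frobModel_constantCoeff_T (K := K) hτ0 V' vc hT
  have hT1 : coeff 1 T = 2 * (1 + 2 * φ B2) := by rw [frobModel_coeff_one_T (K := K) hτ0 hτ1 V' vc hT, hvu]
  -- §2 the model is `𝓔^α`
  have hmodel' := frobModel_curve_map φ VK V' vc rfl rfl rfl rfl h1 h2 h3 h4 h6 hX0K hi2 hiqK hiu2K
    hg2K hdK he ht h1' h2' h3' h4' h6' hvu hvr hvs hvt
  have hEK : VK.map α = (V.map α₀).map φ := by
    rw [hVK, WeierstrassCurve.map_map, hαφ]; exact (V.map_map α₀ _).symm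
  have hmodel : vc • V' = VK.map α := by rw [hEK, hVα₀]; exact hmodel'
  -- §3 the odd normalised solution `σ_c` and its base change along `α`
  rw [← hVK] at hodd hODE
  obtain ⟨σ'', hσ''⟩ : ∃ σ'' : PowerSeries K, σ'' =
      PowerSeries.map α σ := ⟨_, rfl⟩
  obtain ⟨hσ0'', hσ1''⟩ := frob_map_normalised α hσ'' hσ0 hσ1
  have hodd'' : (vc • V').IsFormallyOdd σ'' := by rw [hmodel, hσ'']; exact isFormallyOdd_map_ringHom α hodd
  have hODE'' : (vc • V').SatisfiesSigmaODE σ'' (α (φ c)) := by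
    rw [hmodel, hσ'']; exact satisfiesSigmaODE_map_ringHom α hσ0 hσ1 hODE
  -- the constants relation `−r + u²·α(c) − 2c − e = 0` (the fixed point)
  have hκ : -vc.r + (vc.u : K) ^ 2 * α (φ c) - 2 * φ c - e = 0 := by
    have hcK := congrArg φ hc
    simp only [map_sub, map_mul, map_add, map_pow, map_one, map_ofNat] at hcK
    have hαc : α (φ c) = φ (α₀ c) := RingHom.congr_fun hαφ c
    rw [hvr, hvu, he, hαc, hdK]
    rw [hdK] at hcK
    linear_combination hcK + (-(8 * (-(1 + 4 * φ nu) * φ g2)) * (2 * i2 + 1)) * hi2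
  -- §4 the squared functional equation and Dwork's shape
  have hFE := velu_two_X_sq_mul_sq_subst_eq_domain VK hQ h2t ht' hA hM hDn hu hτ hP V' h1' h2' h3' h4' h6' vc hT hσ0 hσ1 hodd
    hODE hσ0'' hσ1'' hodd'' hODE'' hκ
  obtain ⟨μ, hμdef⟩ : ∃ μ : Kˣ, μ =
      Units.mkOfMulEqOne _ _ hiu2K := ⟨_, rfl⟩
  have hμ : (μ : K) = 1 + 2 * φ B2 := by
    rw [hμdef]; exact Units.val_mkOfMulEqOne hiu2K
  obtain ⟨Tn, hTn'⟩ : ∃ Tn : PowerSeries K, Tn =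
      C i2 * sigmaShift T := ⟨_, rfl⟩
  obtain ⟨hTn, hTn0⟩ := frob_sigmaShift_two (u2 := 1 + 2 * φ B2) hi2 hTn' hT1
  rw [← hμ] at hTn0
  have h2ne : (2 : K) ≠ 0 := fun h => by rw [h, zero_mul] at hi2; exact zero_ne_one hi2
  have hFE' : X ^ 2 * σ''.subst T ^ 2 = C (2 * (μ : K)) ^ 2 * σ ^ 4 * As := by
    rw [hFE, hvu, hμ, hA]
  have hshape := dworkShape_of_sq_functionalEquation_unit h2ne μ hσ0 hσ0'' hT0 hTn hTn0 hFE'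
  obtain ⟨H, hH⟩ : ∃ H : PowerSeries K, H =
      sigmaShift σ ^ 2 := ⟨_, rfl⟩
  obtain ⟨VD, hVD⟩ : ∃ VD : PowerSeries K, VD =
      C ((μ : K) ^ 2) * As * invOfUnit (Tn ^ 2) (μ ^ 2) := ⟨_, rfl⟩
  have hmapH := frob_map_sigmaShift_sq α hσ'' hH
  have heq : (PowerSeries.map α H).subst T = H ^ 2 * VD := by rw [hmapH, hH, hVD]; exact hshape
  -- §5 integrality: the closed forms over `R̂₂` and their images in `K₂`
  obtain ⟨cAR, hcAR⟩ : ∃ cAR : PowerSeries A, cAR =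
      4 * V.formalXMulSq - C X0 * X ^ 2 := ⟨_, rfl⟩
  obtain ⟨cUR, hcUR⟩ : ∃ cUR : PowerSeries A, cUR =
      V.formalXMulSq ^ 2 - 8 * C d * V.formalXMulSq * X ^ 2 + 2 * (C d * C X0 - 4 * C g2 * C X0) * X ^ 4 := ⟨_, rfl⟩
  obtain ⟨cQR, hcQR⟩ : ∃ cQR : PowerSeries A, cQR =
      V.formalXMulSq ^ 2 - 16 * C g2 * V.formalXMulSq * X ^ 2 - 4 * C g2 * C X0 * X ^ 4 := ⟨_, rfl⟩
  obtain ⟨cGR, hcGR⟩ : ∃ cGR : PowerSeries A, cGR =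
      (-C B2 - 32 * C g2) * V.formalXMulSq ^ 2 - 4 * (1 + 2 * C B2) * C d * V.formalXMulSq * X ^ 2 +
      (1 + 2 * C B2) * (C d * C X0 - 4 * C g2 * C X0) * X ^ 4 - 8 * C g2 * C X0 * V.formalXMulSq * X ^ 2 - 2 * C g2 * C X0 ^ 2 * X ^ 4 := ⟨_, rfl⟩
  obtain ⟨cDR, hcDR⟩ : ∃ cDR : PowerSeries A, cDR =
      (1 + 2 * C B2) * X * V.formalXMulSq * cUR + V.formalXMulSq ^ 2 * cQR + 8 * C g2 * C X0 * X ^ 4 * cQR -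
      X ^ 2 * V.formalXMulSq * cGR := ⟨_, rfl⟩
  obtain ⟨N2R, hN2R⟩ : ∃ N2R : PowerSeries A, N2R =
      (1 + 2 * C B2) * X * (2 - X) * V.formalXMulSq * cUR := ⟨_, rfl⟩
  have h2I : (2 : A) ∈ Ideal.span {(2 : A)} := Ideal.mem_span_singleton_self _
  have hN2m := frob_coeff_N2_sub_mem V (Ideal.span {(2 : A)}) h2I hV1 hV2 hV3 hV4 hV6 hX0 hd hcUR hcQR hcGR hcDR
  have hV4m := frob_coeff_calD_sq_sub_mem V (Ideal.span {(2 : A)}) h2I hV1 hV2 hV3 hV4 hV6 hX0 hd hcUR hcQR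
    hcGR hcDR
  obtain ⟨hU0R, hQ0R, hD0R⟩ := frob_constantCoeff V hcUR hcQR hcDR
  -- the same series over `K₂`
  -- the same series over `K₂`
  obtain ⟨cAK, hcAK⟩ : ∃ cAK : PowerSeries K, cAK =
      4 * VK.formalXMulSq - C (φ X0) * X ^ 2 := ⟨_, rfl⟩
  obtain ⟨cUK, hcUK⟩ : ∃ cUK : PowerSeries K, cUK =
      VK.formalXMulSq ^ 2 - 8 * C (φ d) * VK.formalXMulSq * X ^ 2 +
        2 * (C (φ d) * C (φ X0) - 4 * C (φ g2) * C (φ X0)) * X ^ 4 := ⟨_, rfl⟩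
  obtain ⟨cQK, hcQK⟩ : ∃ cQK : PowerSeries K, cQK =
      VK.formalXMulSq ^ 2 - 16 * C (φ g2) * VK.formalXMulSq * X ^ 2 - 4 * C (φ g2) * C (φ X0) * X ^ 4 := ⟨_, rfl⟩
  obtain ⟨cGK, hcGK⟩ : ∃ cGK : PowerSeries K, cGK =
      (-C (φ B2) - 32 * C (φ g2)) * VK.formalXMulSq ^ 2 -
        4 * (1 + 2 * C (φ B2)) * C (φ d) * VK.formalXMulSq * X ^ 2 +
        (1 + 2 * C (φ B2)) * (C (φ d) * C (φ X0) - 4 * C (φ g2) * C (φ X0)) * X ^ 4 -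
        8 * C (φ g2) * C (φ X0) * VK.formalXMulSq * X ^ 2 - 2 * C (φ g2) * C (φ X0) ^ 2 * X ^ 4 := ⟨_, rfl⟩
  obtain ⟨cDK, hcDK⟩ : ∃ cDK : PowerSeries K, cDK =
      (1 + 2 * C (φ B2)) * X * VK.formalXMulSq * cUK + VK.formalXMulSq ^ 2 * cQK +
        8 * C (φ g2) * C (φ X0) * X ^ 4 * cQK - X ^ 2 * VK.formalXMulSq * cGK := ⟨_, rfl⟩
  obtain ⟨hmapA, hmapU, hmapQ, hmapG, hmapD, hmapN⟩ := frob_map_series φ V VK hVK hcAR hcUR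
    hcQR hcGR hcDR hcAK hcUK hcQK hcGK hcDK
  -- `T·𝔇 = N₂` and `V = 𝔇²/(𝒬𝒰²)` over `K₂`
  have hTD := frobModel_T_mul_calD VK V' vc h1 h2 h3 h4 h6 hX0K hi2 he hf ht hA hM hDn hu hτ h1' h2' h3' h4' h6' hvu hvr hvs hvt hT
    hcAK hcUK hcQK hcGK hcDK
  have hA' := frob_A_normalForm hA he
  have hT2K := frob_calA_mul_calQ VK h1 h2 h3 h4 h6 hX0K hcAK hcQK
  obtain ⟨hU0K, hQ0K, -⟩ := frob_constantCoeff VK hcUK hcQK hcDK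
  have hVeq := frobModel_V_eq VK μ hi2 hμ hA' hcAK hT2K hQ0K hU0K hT0 hT1 hTn hTD
  -- `T` and `V` come from `R̂₂⟦z⟧`
  obtain ⟨invD, hinvD⟩ : ∃ invD : PowerSeries A, invD =
      invOfUnit cDR 1 := ⟨_, rfl⟩
  have hinvD1 : cDR * invD = 1 := by rw [hinvD]; exact mul_invOfUnit cDR 1 (by rw [hD0R, Units.val_one])
  obtain ⟨TR, hTR⟩ : ∃ TR : PowerSeries A, TR =
      N2R * invD := ⟨_, rfl⟩
  rw [hN2R] at hTR
  have hTmap := frob_T_eq_map φ hTD hmapD hmapN hinvD1 hTR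
  obtain ⟨invQ, hinvQ⟩ : ∃ invQ : PowerSeries A, invQ =
      invOfUnit (cQR * cUR ^ 2) 1 := ⟨_, rfl⟩
  obtain ⟨VR, hVR⟩ : ∃ VR : PowerSeries A, VR =
      cDR ^ 2 * invQ := ⟨_, rfl⟩
  have hVeq' : VD = cDK ^ 2 * invOfUnit (cQK * cUK ^ 2) 1 := by rw [hVD]; exact hVeq
  have hVmap := frob_V_eq_map φ hVeq' hmapD hmapQ hmapU hQ0R hU0R hinvQ hVR
  -- §6 the package
  have hφ := frob_dwork_hφ φ hinvD1 hTR hN2m hTmap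
  obtain ⟨hu0, hu⟩ := frob_dwork_hu φ hQ0R hU0R hD0R hinvQ hVR hV4m hVmap
  refine ⟨T, VD, hT0, hφ, hu0, hu, ?_⟩
  rw [← hH]; exact heq

end Literature.NumberTheory.EllipticCurves.PadicSigmaSqTwo.MazurTate

end Part10

/-!
## Part 11 — port of `Summits/BirchSwinnertonDyer/BirchSwinnertonDyer/Theorems/AlignedTransportAtTwoBSDOfMainConjectureRankOneAtTwoSigmaSqTwoExistence.lean`

# DISCHARGE of the PRINT stub `stub_sigmaSqTwo`: Mazur–Tate 1991 Thm. 3.1 at `p = 2` (Silverman 2005 §5 Rem. 2) —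
# `Literature.NumberTheory.EllipticCurves.mazurTate_sigmaSq_existsUnique_two` HOLDS

Cell `bsd-f1-sign2`, WIDTH-5 attach seat `bsd-line-att-p3` g9 (crux C3′ = stmt-BirchSwinnertonDyer-23008, registered stub `stub_sigmaSqTwo`;
plan `Cruxes/BSDOfMainConjectureRankOneAtTwo/SIGMASQ-AT-TWO-att-p3.md`). THEOREMS ONLY. This file assembles the discharge (steps S1–S6 of the plan,
all landed in the tree by seats `att-p3` g8/g9): for every globally minimal `W/ℚ` with good ORDINARY reduction at `2` there is exactly one
`Σ ∈ z² + z³ℤ₂⟦z⟧` satisfying all squared `n`-division identities. BSD is NOT proved by any of this; the consumers (`…Disegni`, `…MinimalTwinBSDTwo…`,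
bsd-goldfeld 19141) merely lose the hypothesis `(hMT : mazurTate_sigmaSq_existsUnique_two)`.

PROOF (Blakestad–Grant's method at `p = 2`, squared). Over the universal ordinary `a₁`-chart ring `R̂₂ = ℤ[B₂,B₆][1/D]^` (S1,
`Literature…PadicSigmaSqTwoUniversalRing`): (S3.1) Newton gives the parameter `ν` with `B₆ = g₂X₀²`, `g₂ = (1 + 4B₂)(1 + ν)/q`, `X₀ = −1 − 4B₂ − 64g₂`
(`frobParam_exists_nu`, `frobParam_B6_eq`) — the canonical `2`-torsion point `Q = (X₀/4, −X₀/8)`; (S3.2–3) the Frobenius model `E″ = vc • V′` of Vélu's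
quotient `𝓔/⟨Q⟩`, `vc = [2u₂; R₁/4, u₂ − ½, −R₁/8]`, is the chart curve `⟨1, b₂′, 0, 0, b₆′⟩ = 𝓔^α` for the Frobenius lift `α = specialize b₂′ b₆′`
(`frobModel_curve`, `frobParam_beta2/6_sub_mem`, `specialize_sub_sq_mem`); (S5′) the Mazur–Tate constant is the `2`-adic fixed point
`4u₂²α(c) − 2c = 8δ` (`exists_four_mul_sq_mul_map_sub_two_mul_eq`); (S2/S6) the odd normalised solution `σ_c` over `K₂ = R̂₂[1/2]`
(`exists_isFormallyOdd_satisfiesSigmaODE_const_ratAlgebra`) and its base change `σ_c^α` (`satisfiesSigmaODE_map_ringHom`) satisfy the squared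
`2`-isogeny functional equation (`velu_two_X_sq_mul_sq_subst_eq_domain`), i.e. Dwork's shape `H″(T) = H²V`, `H = (σ/z)²`
(`dworkShape_of_sq_functionalEquation_unit`); (S3.4) `T = u₂z(2 − z)Xs𝒰/𝔇 ≡ z²`, `V = 𝔇²/(𝒬𝒰²) ≡ 1 (mod 2)` with coefficients in `R̂₂`
(`frobModel_T_mul_calD`, `frobModel_V_eq`, `frob_coeff_N2_sub_mem`, `frob_coeff_calD_sq_sub_mem`); (S6) the tree's Dwork lemma
`Literature.RingTheory.FormalGroups.coeff_mem_of_map_subst_eq_pow_mul` gives `H ∈ R̂₂⟦z⟧`, hence `σ² = z²H ∈ R̂₂⟦z⟧`, and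
`mazurTate_sigmaSq_existsUnique_two_of_universal` (specialisation, Blakestad–Grant Thm. 15; uniqueness from `…SigmaSqTwoNetting`) concludes.

* `stub_sigmaSqTwo : mazurTate_sigmaSq_existsUnique_two` (the registered stub of C3′, by name);
* `mazurTate_sigmaSq_existsUnique_two_holds` (the fact-discharge alias).

## Sources
B. Mazur, J. Tate, Duke Math. J. 62 (1991), §2, Thm. 3.1 [cite: MazurTate1991, Thm. 3.1]; J. H. Silverman, Math. Ann. 332 (2005), §5 Thm. 11 and Rem. 2
[cite: Silverman2005DivPoly, §5 Rem. 2]; C. Blakestad, D. Grant, J. Number Theory 249 (2023), Thm. 1, Prop. 7, Lemma 12, Prop. 13, Thm. 15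
[cite: BlakestadGrant2023, Thm. 1]; N. Koblitz, GTM 58, Ch. IV §2 Lemma 3 (Dwork) [cite: Koblitz1984, Ch. IV §2 Lemma 3].
-/

section Part11


set_option autoImplicit false

open scoped _root_.Classical
open _root_.PowerSeries _root_.WeierstrassCurve _root_.Literature.NumberTheory.EllipticCurves
open _root_.Literature.NumberTheory.EllipticCurves.PadicSigmaSqTwo.Universal

namespace Literature.NumberTheory.EllipticCurves.PadicSigmaSqTwo.MazurTate

/-- **The PRINT stub `stub_sigmaSqTwo` of crux C3′ (stmt-BirchSwinnertonDyer-23008): Mazur–Tate's `σ²` at a good ordinary `2` exists and is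
unique** — `Literature.NumberTheory.EllipticCurves.mazurTate_sigmaSq_existsUnique_two` holds (Mazur–Tate 1991 Thm. 3.1 / Silverman 2005 §5 Rem. 2,
proved along Blakestad–Grant 2023 at `p = 2`; see the module docstring for the chain). [cite: MazurTate1991, Thm. 3.1]
[cite: Silverman2005DivPoly, §5 Rem. 2] [cite: BlakestadGrant2023, Thm. 1] -/
theorem sigmaSq_existsUnique_two_of_dworkFrobenius : mazurTate_sigmaSq_existsUnique_two := by
  -- §0 the universal ring and its Frobenius parameter `ν`
  haveI hIC : IsAdicComplete (Ideal.span {(2 : completeRing)}) completeRing := isAdicComplete_completeRing'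
  obtain ⟨nu, hΦ⟩ := frobParam_exists_nu (A := completeRing) univB2 univB6
  obtain ⟨iq, hiq⟩ := (frobParam_isUnit_q (A := completeRing) nu).exists_right_inv
  obtain ⟨iu2, hiu2⟩ := (frobParam_isUnit_u2 (A := completeRing) univB2).exists_right_inv
  obtain ⟨g2, hg2⟩ : ∃ g2 : completeRing, g2 =
      (1 + 4 * univB2) * (1 + nu) * iq := ⟨_, rfl⟩
  obtain ⟨X0, hX0⟩ : ∃ X0 : completeRing, X0 =
      -1 - 4 * univB2 - 64 * g2 := ⟨_, rfl⟩
  obtain ⟨d, hd⟩ : ∃ d : completeRing, d =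
      -(1 + 4 * nu) * g2 := ⟨_, rfl⟩
  have hB6 : univB6 = g2 * X0 ^ 2 := frobParam_B6_eq hiq hg2 hX0 hΦ
  have hβ2m := frobParam_beta2_sub_mem hiq hiu2
  have hβ6m := frobParam_beta6_sub_mem hiq hiu2 hg2 hX0 hB6
  have hDm := frobParam_D_sub_mem hiq hiu2 hg2 hX0 hB6 rfl rfl
  rw [← univD_eq] at hDm
  have hD := isUnit_of_sub_mem ((isUnit_univD).pow 2) hDm
  haveI hIC' : IsAdicComplete (Ideal.span {((2 : ℕ) : completeRing)}) completeRing := isAdicComplete_completeRing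
  have hspec := universalCurve_map_specialize _ _ hD
  obtain ⟨α₀, hα₀⟩ : ∃ α₀ : completeRing →+* completeRing, α₀ = specialize _ _ hD := ⟨_, rfl⟩
  have hα₀sq : ∀ x, α₀ x - x ^ 2 ∈ Ideal.span {(2 : completeRing)} := fun x => by
    rw [hα₀]; exact specialize_sub_sq_mem _ _ hD hβ2m hβ6m x
  have hEα₀ := hspec
  rw [← hα₀] at hEα₀
  obtain ⟨α, hα⟩ : ∃ α : completeRingQ →+* completeRingQ, α =
      extendQ α₀ := ⟨_, rfl⟩
  -- the sigma constant: the `2`-adic fixed point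
  obtain ⟨c, hc⟩ := exists_four_mul_sq_mul_map_sub_two_mul_eq α₀ (1 + 2 * univB2) (4 * d)
  -- §1 the odd normalised solution `σ_c` over `K₂` and the Dwork package
  obtain ⟨i2, hi2⟩ := (isUnit_two_completeRingQ).exists_right_inv
  have hαam : α.comp (algebraMap completeRing completeRingQ) = (algebraMap completeRing completeRingQ).comp α₀ :=
    RingHom.ext fun x => by rw [hα]; exact extendQ_algebraMap α₀ x
  have h1R : universalCurve.a₁ = 1 := universalCurve_a₁
  have h2R : universalCurve.a₂ = univB2 := universalCurve_a₂
  have h3R : universalCurve.a₃ = 0 := universalCurve_a₃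
  have h4R : universalCurve.a₄ = 0 := universalCurve_a₄
  have h6R : universalCurve.a₆ = g2 * X0 ^ 2 := by rw [universalCurve_a₆, hB6]
  obtain ⟨σ, hσ0, hσ1, hodd, hODE⟩ :=
    exists_isFormallyOdd_satisfiesSigmaODE_const_ratAlgebra (universalCurve.map (algebraMap completeRing completeRingQ)) ((algebraMap completeRing completeRingQ) c)
  obtain ⟨T, VD, hT0, hφ, hu0, hu, heq⟩ := frob_dwork_package (algebraMap completeRing completeRingQ) α₀ α hαam hiq hiu2 hg2 hX0 hd universalCurve
    h1R h2R h3R h4R h6R hEα₀ hc hi2 hσ0 hσ1 hodd hODE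
  -- §2 Dwork's lemma: `H = (σ/z)² ∈ R̂₂⟦z⟧`
  obtain ⟨H, hH⟩ : ∃ H : PowerSeries completeRingQ, H =
      sigmaShift σ ^ 2 := ⟨_, rfl⟩
  rw [← hH] at heq
  have h1K : (universalCurve.map (algebraMap completeRing completeRingQ)).a₁ = 1 := by rw [map_a₁, universalCurve_a₁, map_one]
  obtain ⟨hs0, hs1⟩ := frob_H_coeffs (universalCurve.map (algebraMap completeRing completeRingQ)) h1K hH hσ0 hσ1 hodd
  have hs1' : coeff 1 H ∈ intSubring := by rw [hs1]; exact one_mem _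
  have hpK : IsUnit ((2 : ℕ) : completeRingQ) := by exact_mod_cast isUnit_two_completeRingQ
  have hαA : ∀ r ∈ intSubring, α r ∈ intSubring := fun r hr => by rw [hα]; exact extendQ_mem_intSubring α₀ hr
  have hαsq : ∀ r ∈ intSubring, ∃ a ∈ intSubring, α r = r ^ (2 : ℕ) + ((2 : ℕ) : completeRingQ) * a :=
    fun r hr => by rw [hα]; exact exists_extendQ_eq_sq_add' α₀ hα₀sq hr
  have hHint := Literature.RingTheory.FormalGroups.coeff_mem_of_map_subst_eq_pow_mul 2 intSubring α hpK
    exists_natCast_pow_mul_mem_intSubring hαA hαsq hT0 hφ hs0 hs1' hu0 hu heq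
  -- §3 `σ² = z²·H ∈ R̂₂⟦z⟧` and specialisation (Blakestad–Grant Thm. 15)
  have hint := frob_coeff_sq_mem intSubring hH hσ0 hHint
  exact mazurTate_sigmaSq_existsUnique_two_of_universal hσ0 hσ1 hodd hODE hint


end Literature.NumberTheory.EllipticCurves.PadicSigmaSqTwo.MazurTate

end Part11

/-! ## Part 12 — the EXACT discharge(s) -/

/-- **Mazur–Tate 1991, Thm. 3.1 at `p = 2` (Silverman 2005 §5 Rem. 2) HOLDS** — the named fact
`Literature.NumberTheory.EllipticCurves.mazurTate_sigmaSq_existsUnique_two` under its discharge name of record: for every globally minimal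
`W/ℚ` with good ordinary reduction at `2` (`2 ∤ a₂(W)`) there is exactly one `Σ ∈ ℚ₂⟦z⟧` with `(W ⊗ ℚ₂).IsSigmaSqDivisionSeries Σ` —
Part 11's `MazurTate.sigmaSq_existsUnique_two_of_dworkFrobenius` (Blakestad–Grant's method at `p = 2`, squared; Dwork's lemma).
Summits-side twins: `Summit.BirchSwinnertonDyer.BirchSwinnertonDyer.Theorems.AlignedTransportAtTwoSigmaSqTwo.{stub_sigmaSqTwo, mazurTate_sigmaSq_existsUnique_two_holds}`.
[cite: MazurTate1991, §2 and Thm. 3.1] [cite: Silverman2005DivPoly, §5 Thm. 11 and Remark 2] -/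
theorem Literature.NumberTheory.EllipticCurves.mazurTate_sigmaSq_existsUnique_two_holds :
    Literature.NumberTheory.EllipticCurves.mazurTate_sigmaSq_existsUnique_two :=
  Literature.NumberTheory.EllipticCurves.PadicSigmaSqTwo.MazurTate.sigmaSq_existsUnique_two_of_dworkFrobenius

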